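import Literature.Analysis.FluidPDE.TaoClassSliceData
import Literature.Analysis.FluidPDE.AxisymTransportIBP
import Literature.Analysis.FluidPDE.HouLiSpaceTime
import Literature.Analysis.FluidPDE.AxisymmetricNoSwirlGlobal
import Literature.Analysis.FluidPDE.AxisymQuotientBounds
import HarnessLib

/-!
# Axisymmetric flows without swirl: the co-signed meridional flux `∫ (ω_θ/r)⁺ dx` and the
# `L¹(Ω, dr dz)` norm of `ω_θ` are non-increasing (Gallay–Šverák 2015, Lemma 5.1)

Analysis/FluidPDE proof file (theorems only; no definitions, no named facts).

For the axisymmetric Navier–Stokes equations **without swirl** the azimuthal vorticity obeys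
`∂ₜω_θ + u·∇ω_θ − (u_r/r) ω_θ = ν(Δ − r⁻²) ω_θ` on the half-plane `Ω = {(r, z) : r > 0}` with
`ω_θ = 0` on the axis, and Gallay–Šverák record the basic a-priori estimate

> **Lemma 5.1.** The solution of (2.7) satisfies `‖ω_θ(t)‖_{L¹(Ω)} ≤ ‖ω₀‖_{L¹(Ω)}` for all
> `t ∈ [0, T]`. Moreover, if `ω₀ ≢ 0`, the map `t ↦ ‖ω_θ(t)‖_{L¹(Ω)}` is strictly decreasing.

(Th. Gallay, V. Šverák, *Remarks on the Cauchy problem for the axisymmetric Navier–Stokes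
equations*, Confluentes Math. 7 (2015) 67–92 = arXiv:1510.01036, §5, Lemma 5.1; proof: for
`ω₀ ≥ 0`, `d/dt ∫_Ω ω_θ dr dz = −2∫_ℝ ∂ᵣω_θ(0, z, t) dz < 0` by Hopf's lemma — the flux leaks
through the axis — and the general case by the linear splitting `ω_θ = ω_θ⁺ − ω_θ⁻`). In terms
of `η = ω_θ/r` (Ukhovskii–Yudovich 1968, Ladyzhenskaya 1968; the paper's (2.9)):
`∂ₜη + u·∇η = ν(Δ + (2/r)∂ᵣ)η` and `‖η(t)‖_{L¹(ℝ³)} = 2π ‖ω_θ(t)‖_{L¹(Ω)}` (the paper's remark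
after Lemma 5.1: "the map `t ↦ ‖η(t)‖_{L¹(ℝ³)} ≡ ‖ω_θ(t)‖_{L¹(Ω)}` is decreasing").

This file proves the smooth-class form of the first half of Lemma 5.1, together with its
**signed** refinement (the positive and negative parts separately), in the vocabulary of the
tree's Lei–Zhang / Hou–Li quotient calculus: `η = Ω = angVortQuot u = ω^θ/r`
(`AxisymHouLiVariables`), whose equation for a classical axisymmetric solution is the tree's
`IsClassicalNSSolutionOn.angVortQuot_eq` (`Ω' + DΩ[u] = ν(ΔΩ + 2 radDerivQuot Ω) − 2ΦJ`, the
source `−2ΦJ = −2(u^θ/r)(ωʳ/r)` vanishing without swirl).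

* `integral_deriv_comp_mul_le_of_drift_laplacian` — **the fixed-time inequality for a convex
  functional.** For `β ∈ C²` with `β(0) = β'(0) = 0`, `0 ≤ β'' ≤ K`, and an axisymmetric scalar
  `G ∈ C²` on `ℝ³` with `G, ∂ᵢG, ∂ᵢ∂ᵢG, radDerivQuot G ∈ L²`, `G'` with `β'(G) G'` integrable,
  obeying `G' + DG[b] = ν(ΔG + 2 radDerivQuot G)` for a divergence-free `b ∈ C¹` bounded with
  bounded derivative, `ν ≥ 0`: `∫ β'(G) G' ≤ 0`. (Pairing the equation with `β'(G)`: the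
  transport term vanishes, `∫ β'(G)ΔG = −∫ β''(G)|∇G|² ≤ 0`, and the axis term
  `2ν∫ β'(G) (∂ᵣG)/r = −ν c₂ ∫ β(G(0,0,z)) dz ≤ 0` by cylindrical Fubini and the fundamental
  theorem of calculus on each ray — `IsAxisymmetricScalar.integral_deriv_comp_mul_radDerivQuot_nonpos`,
  the convex-functional twin of the tree's `…integral_mul_radDerivQuot_nonpos`. This is the
  smooth substitute for Gallay–Šverák's `−2∫∂ᵣω_θ(0,z)dz < 0`; everything is `L²`-integrable
  because `|β'(v)| ≤ K|v|`, `β(v) ≤ K v²`.)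
* `integral_comp_eq_add_of_ae_hasDerivAt` / `antitoneOn_integral_comp_of_ae_hasDerivAt` — the
  balance `∫ β(g(b)) = ∫ β(g(0)) + ∫₀ᵇ∫ β'(g) g'` from a.e. time-line derivatives (the tree's
  `integral_sq_eq_add_of_ae_hasDerivAt` with `v²` replaced by `β(v)`), and monotonicity when the
  inner integrals are `≤ 0`.
* `IsTaoSolutionOn.integral_deriv_comp_mul_angVortQuot_nonpos` — the slice inequality
  `∫ β'(Ω(t)) Ω'(t) dx ≤ 0` along a Tao-class solution with axisymmetric swirl-free slices
  (`Ω' = angVortQuot (∂ₜu)`; no swirl ⇒ `angVelQuot u = 0`, `angVelQuot_eq_zero_of_hasNoSwirl`).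
* `IsTaoSolutionOn.antitoneOn_integral_comp_angVortQuot` — **in Tao's smooth class**
  (`IsTaoSolutionOn T ν u₀ u p`, `ν ≥ 0`) with axisymmetric swirl-free slices:
  `t ↦ ∫ β(Ω(t, x)) dx` is non-increasing on `[0, T]` for every such `β`
  (all `L²` data from `IsTaoSolutionOn.memLp_angVortQuot_data`, joint smoothness of `Ω` from
  `IsSmoothSpaceTimeOn.angVortQuot_family`).
* `IsTaoSolutionOn.lintegral_posPart_angVortQuot_le`, `…_negPart_…`, `…_abs_…` — letting
  `β ↑ (·)⁺` through the explicit family `β_δ(v) = ∫₀ᵛ smoothTransition (r/δ) dr`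
  (`0 ≤ β_δ ≤ (·)⁺`, `|β_δ − (·)⁺| ≤ δ`) and Fatou: for `0 ≤ s ≤ t ≤ T`,
  `∫⁻ (Ω(t))⁺ ≤ ∫⁻ (Ω(s))⁺`, `∫⁻ (Ω(t))⁻ ≤ ∫⁻ (Ω(s))⁻`, `∫⁻ |Ω(t)| ≤ ∫⁻ |Ω(s)|` in `ℝ≥0∞`
  (no integrability hypothesis: if `η(s) ∈ L¹` then so is `η(t)` with smaller norm — the first
  half of Lemma 5.1 — and the CO-SIGNED meridional flux `∫_{ℝ³}(ω_θ/r)⁺ dx = 2π∫_Ω (ω_θ)₊ dr dz`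
  never increases).

* `IsTaoSolutionOn.lintegral_posPart_angVortQuot_le_add_swirlSource` (and `…negPart…`) —
  **with swirl** (axisymmetric slices only): for `0 ≤ s ≤ t ≤ T`,
  `∫⁻ (Ω(t))⁺ ≤ ∫⁻ (Ω(s))⁺ + ofReal (∫ₛᵗ∫ (−2ΦJ)⁺ dx dτ)`, `Φ = angVelQuot = u^θ/r`,
  `J = radVelQuot ∘ curl = ωʳ/r`: the co-signed meridional flux is raised only by the positive
  part of the swirl (vortex-tilting) source `−2(u^θ/r)(ωʳ/r)` of the `Ω`-equation — transport `0`,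
  diffusion `≤ 0`, axis leak `≤ 0` (slice form `…integral_deriv_comp_mul_angVortQuot_le_swirlSource`,
  sourced balance `integral_comp_le_add_intervalIntegral_of_ae_hasDerivAt`, limit
  `…lintegral_comp_angVortQuot_le_of_approx_swirlSource`).

* `IsAxisymmetric.neg_two_mul_angVelQuot_mul_radVelQuot_curl_eq` — **the swirl source is an
  axial derivative**: `−2ΦJ = 2Φ∂_zΦ = ∂_z(Φ²)` pointwise (`J = −∂_zΦ`, Lei–Zhang 2017 below
  (1.4), the tree's `IsAxisymmetric.radVelQuot_curl_eq_neg_fderiv_angVelQuot`); hence the slice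
  inequality in axial-flux form `∫ β'(Ω)Ω' ≤ ∫ β'(Ω) ∂_z(Φ²)`
  (`…integral_deriv_comp_mul_angVortQuot_le_fderiv_sq`), its integration by parts in `z`
  `∫ β'(Ω) ∂_z(Φ²) = −∫ β''(Ω) ∂_zΩ Φ²` (`…integral_deriv_comp_mul_fderiv_sq_eq`: the swirl acts
  only where `β''(Ω) ≠ 0`, `…_le_neg_integral_transition`), and the sharp co-signed ledger
  `IsTaoSolutionOn.lintegral_posPart_angVortQuot_le_add_setIntegral_fderiv_sq`:
  `∫⁻ (Ω(t))⁺ ≤ ∫⁻ (Ω(s))⁺ + ofReal (∫ₛᵗ ∫_{Ω(τ)>0} ∂_z(Φ(τ)²) dx dτ)` — the co-signed meridional flux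
  is raised only by the net axial flux of the swirl energy density `(u^θ/r)²` INTO `{ω_θ > 0}`
  across the nodal set `{ω_θ = 0}` (`∫_{ℝ³} ∂_z(Φ²) = 0`); in particular
  `…lintegral_posPart_angVortQuot_le_of_ae_pos`: during an era in which `ω_θ > 0` a.e. at every
  time, swirl notwithstanding, `∫⁻ (Ω(t))⁺ ≤ ∫⁻ (Ω(s))⁺` (approximants `β_δ' = smoothTransition(·/δ)
  ↑ 1_{(0,∞)}`, dominated convergence in `x` and `τ`, Fatou).

* `angVortQuot_eq_hadamardQuotFst_curl` — dictionary: for axisymmetric swirl-free `u ∈ C³` the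
  quotient `angVortQuot u` equals the KNSS/Ladyzhenskaya quotient `hadamardQuotFst (ω₁)` of
  `AxisymNoSwirlVorticity` (so `ladyzhenskaya_weighted_estimate` is the `L²` companion of this
  file); `IsTaoSolutionOn.…_of_datum` — the statements from an axisymmetric swirl-free DATUM
  (`ν > 0`; symmetry propagates by `IsTaoSolutionOn.isAxisymmetric`, `…hasNoSwirl`).

What is NOT here: the strict decrease (Hopf's lemma), the `L¹(Ω)`/measure-valued initial data and
mild-solution theory of the paper (Thms. 1.1–1.2, §§3–4), the `L¹ → L^∞` smoothing Lemma 5.2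
(Feng–Šverák) and Prop. 5.3. With swirl the source `−2ΦJ = ∂_z(Φ²)` has no sign: only the balances
above (positive part over all space; signed axial flux into `{Ω > 0}`).

Dictionary: `r² · angVortQuot u = swirl (curl u) = x₀ω₁ − x₁ω₀ = r ω_θ`
(`IsAxisymmetric.cylRadius_sq_mul_angVortQuot`), so `angVortQuot u = ω_θ/r = η` off the axis
and, `dx = r dr dθ dz`, `∫_{ℝ³} |η| dx = 2π ∫_Ω |ω_θ| dr dz`.

## Mathlib / tree search

Tree (all used): `IsClassicalNSSolutionOn.angVortQuot_eq` (`AxisymQuotientEquationsOmega`),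
`integral_mul_fderiv_apply_eq_neg_of_isDivFree'`-type whole-space integrations by parts
(`AxisymOmegaEnergy`, `HouLeiLiEstimate`: `integral_mul_fderiv_eq_neg_of_differentiable`,
`IsAxisymmetricScalar.integral_eq`, `Wei2016.ae_integrableOn_profile`,
`mul_radDerivQuot_eq_fderiv_zero`), `IsTaoSolutionOn.memLp_angVortQuot_data`,
`…exists_lintegral_sq_quot_le`, `…exists_bound_fderiv_velocity`, `exists_bound_velocity`
(`TaoClassSliceData`, `TaoClassQuotientBalance`, `TaoClassGlue`),
`IsSmoothSpaceTimeOn.angVortQuot_family`, `…timeDerivWithin_angVortQuot` (`HouLiSpaceTime`),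
`integral_sq_eq_add_of_ae_hasDerivAt` (pattern; `SqIntegralBalance`). `lean search
'posPart_angVortQuot|integral_comp_angVortQuot|GallaySverak'`: nothing before this file; the
`L²` version `∫ (ω_θ/r)²` non-increasing is the tree's `ladyzhenskaya_weighted_estimate` /
`IsTaoSolutionOn.integral_hadamardQuotFst_sq_le`. Mathlib: `Real.smoothTransition`,
`intervalIntegral.integral_hasDerivAt_right`, `lintegral_liminf_le`,
`integral_mul_fderiv_eq_neg_fderiv_mul_of_integrable`.

## References

* Th. Gallay, V. Šverák, *Remarks on the Cauchy problem for the axisymmetric Navier–Stokes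
  equations*, Confluentes Math. 7 (2015), no. 2, 67–92 = arXiv:1510.01036, §5 Lemma 5.1
  (arXiv p. 16) and (2.9) (the equation for `η = ω_θ/r`). [GallaySverak2016]
* M. R. Ukhovskii, V. I. Yudovich, J. Appl. Math. Mech. 32 (1968) 52–61; O. A. Ladyzhenskaya,
  Zap. Naučn. Sem. LOMI 7 (1968) 155–177 (the equation and maximum principle for `ω_θ/r`).
* Z. Lei, Q. S. Zhang, Pacific J. Math. 289 (2017) 169–187 = arXiv:1505.02628, §1 (1.4), §3
  (the `Ω`-equation and the axis boundary terms of its energy identities). [LeiZhang2017]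
-/

noncomputable section

open MeasureTheory Set Function Filter Topology InnerProductSpace WithLp
open scoped RealInnerProductSpace Laplacian ContDiff ENNReal NNReal Topology

namespace Literature.Analysis.FluidPDE

/-! ### Convex `C²` functions with `β(0) = β'(0) = 0`, `0 ≤ β'' ≤ K` -/

section Convex

variable {β : ℝ → ℝ} {K : ℝ}

/-- For `β ∈ C²`: `β` and `β'` are differentiable, with `(β)' = deriv β`, `(β')' = deriv (deriv β)`.
[folklore] -/
private theorem differentiable_deriv_of_contDiff_two (hβ : ContDiff ℝ 2 β) :
    Differentiable ℝ β ∧ Differentiable ℝ (deriv β) := by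
  refine ⟨hβ.differentiable (by norm_num), ?_⟩
  have h1 : ContDiff ℝ 1 (deriv β) := ContDiff.deriv' (n := 1) (by exact_mod_cast hβ)
  exact h1.differentiable one_ne_zero

/-- For `β ∈ C²`, `β''` is continuous. [folklore] -/
private theorem continuous_deriv_deriv_of_contDiff_two (hβ : ContDiff ℝ 2 β) :
    Continuous (deriv (deriv β)) := by
  have h1 : ContDiff ℝ 1 (deriv β) := ContDiff.deriv' (n := 1) (by exact_mod_cast hβ)
  exact h1.continuous_deriv le_rfl

/-- If `β'(0) = 0` and `|β''| ≤ K` then `|β'(v)| ≤ K |v|` (mean value inequality). [folklore] -/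
private theorem abs_deriv_le_mul_abs (hβ : ContDiff ℝ 2 β) (h0 : deriv β 0 = 0)
    (hK : ∀ v, |deriv (deriv β) v| ≤ K) (v : ℝ) : |deriv β v| ≤ K * |v| := by
  obtain ⟨-, hd'⟩ := differentiable_deriv_of_contDiff_two hβ
  have h := Convex.norm_image_sub_le_of_norm_deriv_le (f := deriv β) (s := univ) (x := 0) (y := v)
    (fun x _ => hd' x) (fun x _ => by rw [Real.norm_eq_abs]; exact hK x) convex_univ (mem_univ _)
    (mem_univ _)
  rw [h0, sub_zero, sub_zero, Real.norm_eq_abs, Real.norm_eq_abs] at h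
  exact h

/-- If `β(0) = β'(0) = 0` and `|β''| ≤ K` then `|β(v)| ≤ K v²`. [folklore] -/
private theorem abs_le_mul_sq (hβ : ContDiff ℝ 2 β) (h00 : β 0 = 0) (h0 : deriv β 0 = 0)
    (hK : ∀ v, |deriv (deriv β) v| ≤ K) (v : ℝ) : |β v| ≤ K * v ^ 2 := by
  obtain ⟨hd, -⟩ := differentiable_deriv_of_contDiff_two hβ
  have hK0 : 0 ≤ K := (abs_nonneg _).trans (hK 0)
  -- on the segment `[0, v]` (or `[v, 0]`): `|β'| ≤ K|v|`
  have hseg : ∀ x ∈ uIcc 0 v, ‖deriv β x‖ ≤ K * |v| := by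
    intro x hx
    rw [Real.norm_eq_abs]
    refine (abs_deriv_le_mul_abs hβ h0 hK x).trans (mul_le_mul_of_nonneg_left ?_ hK0)
    rcases le_total 0 v with hv | hv
    · rw [uIcc_of_le hv] at hx
      rw [abs_of_nonneg hx.1, abs_of_nonneg hv]; exact hx.2
    · rw [uIcc_of_ge hv] at hx
      rw [abs_of_nonpos hx.2, abs_of_nonpos hv]; linarith [hx.1]
  have h := Convex.norm_image_sub_le_of_norm_deriv_le (f := β) (s := uIcc 0 v) (x := 0) (y := v)
    (fun x _ => hd x) hseg (convex_uIcc 0 v) left_mem_uIcc right_mem_uIcc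
  rw [h00, sub_zero, sub_zero, Real.norm_eq_abs, Real.norm_eq_abs] at h
  calc |β v| ≤ K * |v| * |v| := h
    _ = K * v ^ 2 := by rw [mul_assoc, abs_mul_abs_self, sq]

/-- If `β(0) = β'(0) = 0` and `β'' ≥ 0` then `β ≥ 0` (`β'` is nondecreasing, so `β` decreases on
`(-∞, 0]` and increases on `[0, ∞)`). [folklore] -/
private theorem nonneg_of_deriv2_nonneg (hβ : ContDiff ℝ 2 β) (h00 : β 0 = 0) (h0 : deriv β 0 = 0)
    (hnn : ∀ v, 0 ≤ deriv (deriv β) v) (v : ℝ) : 0 ≤ β v := by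
  obtain ⟨hd, hd'⟩ := differentiable_deriv_of_contDiff_two hβ
  have hmono : Monotone (deriv β) := monotone_of_deriv_nonneg hd' hnn
  rcases le_total 0 v with hv | hv
  · -- `β` is nondecreasing on `[0, ∞)`
    have hm : MonotoneOn β (Ici 0) :=
      monotoneOn_of_deriv_nonneg (convex_Ici 0) hd.continuous.continuousOn
        (hd.differentiableOn.mono interior_subset) fun x hx => by
          rw [interior_Ici] at hx
          have := hmono hx.le
          rwa [h0] at this
    have := hm (self_mem_Ici (a := (0 : ℝ))) (show v ∈ Ici (0 : ℝ) from hv) hv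
    rwa [h00] at this
  · have hm : AntitoneOn β (Iic 0) :=
      antitoneOn_of_deriv_nonpos (convex_Iic 0) hd.continuous.continuousOn
        (hd.differentiableOn.mono interior_subset) fun x hx => by
          rw [interior_Iic] at hx
          have := hmono hx.le
          rwa [h0] at this
    have := hm (show v ∈ Iic (0 : ℝ) from hv) (self_mem_Iic (a := (0 : ℝ))) hv
    rwa [h00] at this

/-- Chain rule: `D(β ∘ G)(x) w = β'(G x) · DG(x) w`. [folklore] -/
private theorem fderiv_comp_deriv_apply {G : EuclideanSpace ℝ (Fin 3) → ℝ} (hβ : Differentiable ℝ β)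
    (hG : Differentiable ℝ G) (x w : EuclideanSpace ℝ (Fin 3)) :
    fderiv ℝ (fun y => β (G y)) x w = deriv β (G x) * fderiv ℝ G x w := by
  have h := ((hβ (G x)).hasDerivAt.comp_hasFDerivAt x (hG x).hasFDerivAt)
  rw [show (fun y => β (G y)) = β ∘ G from rfl, h.fderiv]
  simp [smul_eq_mul]

end Convex

/-! ### The axis term for a convex functional: `∫ β'(H) (∂ᵣH)/r dx = −(c₂) ∫ β(H(0,0,z)) dz ≤ 0` -/

section Axis

/-- **On a ray, `∫₀^∞ β'(H) ∂_ρH dρ = −β(H(0))`.** For `H` differentiable, `β ∈ C¹`, along the ray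
`ρ ↦ (ρ, 0, z)` with `ρ ↦ β'(H) ∂₀H` and `ρ ↦ ρ β(H)` integrable on `(0, ∞)`: `β(H)` has the
integrable derivative `β'(H)∂₀H`, is integrable on `(1, ∞)` (dominated by `ρ β(H)`), hence tends to
`0`, and the fundamental theorem of calculus on `(0, ∞)` applies (the tree's
`integral_Ioi_mul_fderiv_ray_nonpos` is the case `β = v²/2`). [folklore] -/
private theorem integral_Ioi_deriv_comp_mul_fderiv_ray {H : EuclideanSpace ℝ (Fin 3) → ℝ} {β : ℝ → ℝ}
    (hHd : Differentiable ℝ H) (hβ : ContDiff ℝ 1 β) (z : ℝ)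
    (h1 : IntegrableOn (fun ρ : ℝ => deriv β (H (meridianPoint (ρ, z))) *
      fderiv ℝ H (meridianPoint (ρ, z)) (EuclideanSpace.single 0 1)) (Ioi 0))
    (h2 : IntegrableOn (fun ρ : ℝ => ρ * β (H (meridianPoint (ρ, z)))) (Ioi 0)) :
    ∫ ρ in Ioi (0 : ℝ), deriv β (H (meridianPoint (ρ, z))) *
      fderiv ℝ H (meridianPoint (ρ, z)) (EuclideanSpace.single 0 1) =
      -β (H (meridianPoint (0, z))) := by
  set φ : ℝ → ℝ := fun ρ => β (H (meridianPoint (ρ, z))) with hφ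
  set φ' : ℝ → ℝ := fun ρ => deriv β (H (meridianPoint (ρ, z))) *
    fderiv ℝ H (meridianPoint (ρ, z)) (EuclideanSpace.single 0 1) with hφ'
  have hβd : Differentiable ℝ β := hβ.differentiable one_ne_zero
  have hline : ∀ ρ, HasDerivAt (fun ρ : ℝ => H (meridianPoint (ρ, z)))
      (fderiv ℝ H (meridianPoint (ρ, z)) (EuclideanSpace.single 0 1)) ρ := fun ρ =>
    (hHd _).hasFDerivAt.comp_hasDerivAt ρ (hasDerivAt_meridianPoint_fst ρ z)
  have hderiv : ∀ ρ, HasDerivAt φ (φ' ρ) ρ := by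
    intro ρ
    have h := (hβd (H (meridianPoint (ρ, z)))).hasDerivAt.comp ρ (hline ρ)
    refine h.congr_deriv ?_
    simp only [hφ']
  have hcontH : Continuous fun ρ : ℝ => H (meridianPoint (ρ, z)) :=
    continuous_iff_continuousAt.2 fun ρ => (hline ρ).continuousAt
  have hcontφ : Continuous φ := hβd.continuous.comp hcontH
  -- `φ` is integrable on `(1, ∞)`
  have hφint : IntegrableOn φ (Ioi 1) := by
    have hdom : IntegrableOn (fun ρ : ℝ => ρ * β (H (meridianPoint (ρ, z)))) (Ioi 1) :=
      h2.mono_set (Ioi_subset_Ioi zero_le_one)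
    refine Integrable.mono hdom hcontφ.aestronglyMeasurable ?_
    refine (ae_restrict_iff' measurableSet_Ioi).2 (Eventually.of_forall fun ρ (hρ : 1 < ρ) => ?_)
    simp only [hφ]
    rw [Real.norm_eq_abs, Real.norm_eq_abs, abs_mul, abs_of_pos (zero_lt_one.trans hρ)]
    exact le_mul_of_one_le_left (abs_nonneg _) hρ.le
  have htend : Tendsto φ atTop (𝓝 0) :=
    tendsto_zero_of_hasDerivAt_of_integrableOn_Ioi (a := 1) (fun ρ _ => hderiv ρ)
      (h1.mono_set (Ioi_subset_Ioi zero_le_one)) hφint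
  have hFTC := integral_Ioi_of_hasDerivAt_of_tendsto' (a := 0) (fun ρ _ => hderiv ρ) h1 htend
  rw [hFTC, zero_sub]

variable {H : EuclideanSpace ℝ (Fin 3) → ℝ} {β : ℝ → ℝ}

/-- **The axis term of a convex functional has a sign.** For an axisymmetric scalar `H ∈ C²`,
`β ∈ C¹` with `β ≥ 0`, and `β'(H) q_H`, `β(H)` integrable (`q_H = radDerivQuot H = (∂ᵣH)/r`):
`∫ β'(H) q_H dx = −c₂ ∫ β(H(0,0,z)) dz ≤ 0`.
Proof: the integrand is an integrable axisymmetric scalar, so by cylindrical Fubini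
(`IsAxisymmetricScalar.integral_eq`) `∫ β'(H) q_H = ∫ dz c₂ ∫₀^∞ ρ β'(H) q_H (ρ,0,z) dρ`, and on
each ray `ρ q_H = ∂₀H` (`mul_radDerivQuot_eq_fderiv_zero`), so the inner integral is
`∫₀^∞ β'(H)∂_ρH = −β(H(0,0,z)) ≤ 0` (`integral_Ioi_deriv_comp_mul_fderiv_ray`, the rays being
integrable for a.e. `z`). This is the smooth form of the axis leak `−2∫ ∂ᵣω_θ(0,z) dz` of
Gallay–Šverák's proof of Lemma 5.1. [cite: GallaySverak2016, §5 Lemma 5.1 proof (arXiv p. 16, (5.1))] -/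
theorem IsAxisymmetricScalar.integral_deriv_comp_mul_radDerivQuot_nonpos
    (hax : IsAxisymmetricScalar H) (hH : ContDiff ℝ 2 H) (hβ : ContDiff ℝ 1 β)
    (hβnn : ∀ v, 0 ≤ β v)
    (hi1 : Integrable fun x => deriv β (H x) * radDerivQuot H x)
    (hi2 : Integrable fun x => β (H x)) :
    ∫ x, deriv β (H x) * radDerivQuot H x ≤ 0 := by
  have hHd : Differentiable ℝ H := hH.differentiable two_ne_zero
  have hfax : IsAxisymmetricScalar fun x => deriv β (H x) * radDerivQuot H x := fun θ x => by
    simp only [hax θ x, isAxisymmetricScalar_radDerivQuot hH hax θ x]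
  have hβax : IsAxisymmetricScalar fun x => β (H x) := fun θ x => by simp only [hax θ x]
  rw [hfax.integral_eq hi1]
  apply integral_nonpos_of_ae
  filter_upwards [Wei2016.ae_integrableOn_profile hfax hi1,
    Wei2016.ae_integrableOn_profile hβax hi2] with z hfz hHz
  have heq : EqOn
      (fun ρ : ℝ => ρ * (deriv β (H (meridianPoint (ρ, z))) * radDerivQuot H (meridianPoint (ρ, z))))
      (fun ρ : ℝ => deriv β (H (meridianPoint (ρ, z))) *
        fderiv ℝ H (meridianPoint (ρ, z)) (EuclideanSpace.single 0 1)) (Ioi 0) := by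
    intro ρ _
    have h := mul_radDerivQuot_eq_fderiv_zero hH hax (meridianPoint (ρ, z))
    rw [meridianPoint_apply_zero] at h
    simp only
    rw [← h]
    ring
  have h1 : IntegrableOn (fun ρ : ℝ => deriv β (H (meridianPoint (ρ, z))) *
      fderiv ℝ H (meridianPoint (ρ, z)) (EuclideanSpace.single 0 1)) (Ioi 0) :=
    hfz.congr_fun heq measurableSet_Ioi
  have hray := integral_Ioi_deriv_comp_mul_fderiv_ray hHd hβ z h1 hHz
  have hint : ∫ ρ in Ioi (0 : ℝ), ρ • (deriv β (H (meridianPoint (ρ, z))) *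
      radDerivQuot H (meridianPoint (ρ, z))) ≤ 0 := by
    simp only [smul_eq_mul]
    rw [setIntegral_congr_fun measurableSet_Ioi heq, hray]
    have : 0 ≤ β (H (meridianPoint (0, z))) := hβnn _
    linarith
  rw [smul_eq_mul]
  exact mul_nonpos_of_nonneg_of_nonpos radialConst₂_pos.le hint

end Axis

/-! ### The fixed-time inequality for a convex functional of a drift–Laplacian scalar -/

section Slice

variable {G G' R : EuclideanSpace ℝ (Fin 3) → ℝ}
  {b : EuclideanSpace ℝ (Fin 3) → EuclideanSpace ℝ (Fin 3)} {ν K : ℝ} {β : ℝ → ℝ}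

/-- `β'(G) ∈ L²` when `|β'(v)| ≤ K|v|` and `G ∈ L²` is continuous. [folklore] -/
private theorem memLp_deriv_comp (hβ : ContDiff ℝ 2 β) (h0 : deriv β 0 = 0)
    (hK : ∀ v, |deriv (deriv β) v| ≤ K) (hGc : Continuous G) (hG : MemLp G 2 volume) :
    MemLp (fun x => deriv β (G x)) 2 volume := by
  obtain ⟨-, hd'⟩ := differentiable_deriv_of_contDiff_two hβ
  refine MemLp.of_le_mul (c := K) hG (hd'.continuous.comp hGc).aestronglyMeasurable
    (Eventually.of_forall fun x => ?_)
  rw [Real.norm_eq_abs, Real.norm_eq_abs]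
  exact abs_deriv_le_mul_abs hβ h0 hK (G x)

/-- `β(G) ∈ L¹` when `|β(v)| ≤ K v²` and `G ∈ L²` is continuous. [folklore] -/
private theorem integrable_comp (hβ : ContDiff ℝ 2 β) (h00 : β 0 = 0) (h0 : deriv β 0 = 0)
    (hK : ∀ v, |deriv (deriv β) v| ≤ K) (hGc : Continuous G) (hG : MemLp G 2 volume) :
    Integrable (fun x => β (G x)) := by
  obtain ⟨hd, -⟩ := differentiable_deriv_of_contDiff_two hβ
  refine (hG.integrable_sq.const_mul K).mono' (hd.continuous.comp hGc).aestronglyMeasurable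
    (Eventually.of_forall fun x => ?_)
  rw [Real.norm_eq_abs]
  exact abs_le_mul_sq hβ h00 h0 hK (G x)

/-- **The transport term vanishes**: `∫ β'(G) DG[b] = 0` for a divergence-free `b ∈ C¹` bounded
with bounded derivative, `G ∈ C¹ ∩ L²` with `∂ᵢG ∈ L²`, `β ∈ C²`, `β(0) = β'(0) = 0`, `|β''| ≤ K`
(`∫ 1 · D(β∘G)[b] = −∫ D1[b] · β(G) = 0`). [folklore] -/
private theorem integral_deriv_comp_mul_fderiv_apply_eq_zero (hβ : ContDiff ℝ 2 β) (h00 : β 0 = 0)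
    (h0 : deriv β 0 = 0) (hK : ∀ v, |deriv (deriv β) v| ≤ K) (hG : ContDiff ℝ 1 G)
    (hL2 : MemLp G 2 volume)
    (h1 : ∀ i : Fin 3, MemLp (fun x => fderiv ℝ G x (EuclideanSpace.single i 1)) 2 volume)
    (hb : ContDiff ℝ 1 b) (hdiv : VectorCalculus.IsDivFree b)
    {B : ℝ} (hbB : ∀ x, ‖b x‖ ≤ B) {B' : ℝ} (hDb : ∀ x, ‖fderiv ℝ b x‖ ≤ B') :
    ∫ x, deriv β (G x) * fderiv ℝ G x (b x) = 0 := by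
  obtain ⟨hd, hd'⟩ := differentiable_deriv_of_contDiff_two hβ
  have hGd : Differentiable ℝ G := hG.differentiable one_ne_zero
  have hβG : ContDiff ℝ 1 fun y => β (G y) := (hβ.of_le (by norm_num)).comp hG
  have hchain : ∀ x w, fderiv ℝ (fun y => β (G y)) x w = deriv β (G x) * fderiv ℝ G x w :=
    fun x w => fderiv_comp_deriv_apply hd hGd x w
  have hβ'L2 : MemLp (fun x => deriv β (G x)) 2 volume := memLp_deriv_comp hβ h0 hK hG.continuous hL2
  have h := integral_mul_fderiv_apply_eq_neg_of_isDivFree' (a := fun _ => (1 : ℝ))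
    (b := fun y => β (G y)) contDiff_const hβG hb hdiv hbB hDb ?_ ?_ ?_
  · simpa [hchain] using h
  · simpa only [one_mul] using integrable_comp hβ h00 h0 hK hG.continuous hL2
  · intro i
    simp
  · intro i
    simp only [one_mul, hchain]
    exact hβ'L2.integrable_mul (h1 i)

/-- **The diffusion term is dissipative**: `∫ β'(G) ∂ᵢ∂ᵢG = −∫ β''(G) (∂ᵢG)² ≤ 0` for `G ∈ C²`
with `G, ∂ᵢG, ∂ᵢ∂ᵢG ∈ L²` and `β ∈ C²` convex with `β'(0) = 0`, `β'' ≤ K`. [folklore] -/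
private theorem integral_deriv_comp_mul_fderiv_fderiv_nonpos (hβ : ContDiff ℝ 2 β) (h0 : deriv β 0 = 0)
    (hnn : ∀ v, 0 ≤ deriv (deriv β) v) (hK : ∀ v, |deriv (deriv β) v| ≤ K)
    (hG : ContDiff ℝ 2 G) (hL2 : MemLp G 2 volume) (i : Fin 3)
    (h1 : MemLp (fun x => fderiv ℝ G x (EuclideanSpace.single i 1)) 2 volume)
    (h2 : MemLp (fun x => fderiv ℝ (fun y => fderiv ℝ G y (EuclideanSpace.single i 1)) x
      (EuclideanSpace.single i 1)) 2 volume) :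
    ∫ x, deriv β (G x) * fderiv ℝ (fun y => fderiv ℝ G y (EuclideanSpace.single i 1)) x
      (EuclideanSpace.single i 1) ≤ 0 := by
  obtain ⟨hd, hd'⟩ := differentiable_deriv_of_contDiff_two hβ
  have hGd : Differentiable ℝ G := hG.differentiable two_ne_zero
  have hgd : Differentiable ℝ fun y => fderiv ℝ G y (EuclideanSpace.single i 1) :=
    (contDiff_fderiv_apply_const_succ (n := 1) (by exact_mod_cast hG) _).differentiable one_ne_zero
  have hfd : Differentiable ℝ fun y => deriv β (G y) := hd'.comp hGd
  have hchain : ∀ x, fderiv ℝ (fun y => deriv β (G y)) x (EuclideanSpace.single i 1) =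
      deriv (deriv β) (G x) * fderiv ℝ G x (EuclideanSpace.single i 1) :=
    fun x => fderiv_comp_deriv_apply hd' hGd x _
  have hβ'L2 : MemLp (fun x => deriv β (G x)) 2 volume := memLp_deriv_comp hβ h0 hK hG.continuous hL2
  -- `β''(G) (∂ᵢG)²` is integrable (bounded × L¹)
  have hgg : Integrable (fun x => fderiv ℝ G x (EuclideanSpace.single i 1) *
      fderiv ℝ G x (EuclideanSpace.single i 1)) := h1.integrable_mul h1
  have hsq : Integrable (fun x => deriv (deriv β) (G x) *
      (fderiv ℝ G x (EuclideanSpace.single i 1) * fderiv ℝ G x (EuclideanSpace.single i 1))) :=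
    hgg.bdd_mul ((continuous_deriv_deriv_of_contDiff_two hβ).comp hG.continuous).aestronglyMeasurable
      (ae_of_all _ fun x => by rw [Real.norm_eq_abs]; exact hK (G x))
  have i1 : Integrable (fun x => fderiv ℝ (fun y => deriv β (G y)) x (EuclideanSpace.single i 1) *
      fderiv ℝ G x (EuclideanSpace.single i 1)) := by
    refine hsq.congr (Eventually.of_forall fun x => ?_)
    simp only [hchain]
    ring
  have i2 : Integrable (fun x => deriv β (G x) *
      fderiv ℝ (fun y => fderiv ℝ G y (EuclideanSpace.single i 1)) x (EuclideanSpace.single i 1)) :=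
    hβ'L2.integrable_mul h2
  have i3 : Integrable (fun x => deriv β (G x) * fderiv ℝ G x (EuclideanSpace.single i 1)) :=
    hβ'L2.integrable_mul h1
  rw [integral_mul_fderiv_eq_neg_of_differentiable hfd hgd _ i1 i2 i3, neg_nonpos]
  refine integral_nonneg fun x => ?_
  show 0 ≤ fderiv ℝ (fun y => deriv β (G y)) x (EuclideanSpace.single i 1) *
      fderiv ℝ G x (EuclideanSpace.single i 1)
  rw [hchain x, mul_assoc]
  exact mul_nonneg (hnn (G x)) (mul_self_nonneg _)

/-- **The fixed-time inequality for a convex functional** (pairing the drift–Laplacian equation with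
`β'(G)`). Let `β ∈ C²` with `β(0) = β'(0) = 0`, `0 ≤ β'' ≤ K`; `G ∈ C²` an axisymmetric scalar
with `G, ∂ᵢG, ∂ᵢ∂ᵢG, radDerivQuot G ∈ L²`, `β'(G) R` integrable, `b ∈ C¹`
divergence-free, bounded with bounded derivative, `ν ≥ 0`, and pointwise
`G' + DG[b] = ν (ΔG + 2 radDerivQuot G) + R`. Then `∫ β'(G) G' ≤ ∫ β'(G) R`: the transport term
vanishes, `ν∫β'(G)ΔG = −ν∫β''(G)|∇G|² ≤ 0`, and the axis term `2ν∫β'(G)(∂ᵣG)/r ≤ 0`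
(`IsAxisymmetricScalar.integral_deriv_comp_mul_radDerivQuot_nonpos`). With `R = 0`, `G = ω_θ/r`
this is `d/dt ∫ β(ω_θ/r) dx ≤ 0`, the smooth form of Gallay–Šverák's computation (5.1).
[cite: GallaySverak2016, §5 Lemma 5.1 proof (arXiv p. 16)] -/
theorem integral_deriv_comp_mul_le_of_drift_laplacian (hβ : ContDiff ℝ 2 β) (h00 : β 0 = 0)
    (h0 : deriv β 0 = 0) (hnn : ∀ v, 0 ≤ deriv (deriv β) v) (hK : ∀ v, |deriv (deriv β) v| ≤ K)
    (hG : ContDiff ℝ 2 G) (hax : IsAxisymmetricScalar G) (hν : 0 ≤ ν) (hL2 : MemLp G 2 volume)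
    (h1 : ∀ i : Fin 3, MemLp (fun x => fderiv ℝ G x (EuclideanSpace.single i 1)) 2 volume)
    (h2 : ∀ i : Fin 3, MemLp (fun x => fderiv ℝ (fun y => fderiv ℝ G y (EuclideanSpace.single i 1)) x
      (EuclideanSpace.single i 1)) 2 volume)
    (hq : MemLp (radDerivQuot G) 2 volume)
    (hR : Integrable (fun x => deriv β (G x) * R x))
    (hb : ContDiff ℝ 1 b) (hdiv : VectorCalculus.IsDivFree b)
    {B : ℝ} (hbB : ∀ x, ‖b x‖ ≤ B) {B' : ℝ} (hDb : ∀ x, ‖fderiv ℝ b x‖ ≤ B')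
    (heq : ∀ x, G' x + fderiv ℝ G x (b x) = ν * ((Δ G) x + 2 * radDerivQuot G x) + R x) :
    ∫ x, deriv β (G x) * G' x ≤ ∫ x, deriv β (G x) * R x := by
  obtain ⟨hd, hd'⟩ := differentiable_deriv_of_contDiff_two hβ
  have hG1 : ContDiff ℝ 1 G := hG.of_le (by norm_num)
  have hβ1 : ContDiff ℝ 1 β := hβ.of_le (by norm_num)
  have hβnn : ∀ v, 0 ≤ β v := nonneg_of_deriv2_nonneg hβ h00 h0 hnn
  have hβ'L2 : MemLp (fun x => deriv β (G x)) 2 volume := memLp_deriv_comp hβ h0 hK hG.continuous hL2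
  -- the four pieces
  have htr := integral_deriv_comp_mul_fderiv_apply_eq_zero hβ h00 h0 hK hG1 hL2 h1 hb hdiv hbB hDb
  have hlap : ∫ x, deriv β (G x) * (Δ G) x ≤ 0 := by
    have iJ : ∀ i : Fin 3, Integrable (fun x => deriv β (G x) *
        fderiv ℝ (fun y => fderiv ℝ G y (EuclideanSpace.single i 1)) x (EuclideanSpace.single i 1)) :=
      fun i => hβ'L2.integrable_mul (h2 i)
    have hsum : ∫ x, deriv β (G x) * (Δ G) x =
        (∫ x, deriv β (G x) * fderiv ℝ (fun y => fderiv ℝ G y (EuclideanSpace.single 0 1)) x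
          (EuclideanSpace.single 0 1)) +
        (∫ x, deriv β (G x) * fderiv ℝ (fun y => fderiv ℝ G y (EuclideanSpace.single 1 1)) x
          (EuclideanSpace.single 1 1)) +
        ∫ x, deriv β (G x) * fderiv ℝ (fun y => fderiv ℝ G y (EuclideanSpace.single 2 1)) x
          (EuclideanSpace.single 2 1) := by
      have i3 : Integrable (fun x =>
          deriv β (G x) * fderiv ℝ (fun y => fderiv ℝ G y (EuclideanSpace.single 0 1)) x
            (EuclideanSpace.single 0 1) +
          deriv β (G x) * fderiv ℝ (fun y => fderiv ℝ G y (EuclideanSpace.single 1 1)) x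
            (EuclideanSpace.single 1 1)) := (iJ 0).add (iJ 1)
      rw [← integral_add (iJ 0) (iJ 1), ← integral_add i3 (iJ 2)]
      refine integral_congr_ae (Eventually.of_forall fun x => ?_)
      beta_reduce
      rw [laplacian_eq_sum_fderiv_fderiv (EuclideanSpace.basisFun (Fin 3) ℝ) hG x]
      simp only [EuclideanSpace.basisFun_apply, Fin.sum_univ_three]
      ring
    rw [hsum]
    have := integral_deriv_comp_mul_fderiv_fderiv_nonpos hβ h0 hnn hK hG hL2 0 (h1 0) (h2 0)
    have := integral_deriv_comp_mul_fderiv_fderiv_nonpos hβ h0 hnn hK hG hL2 1 (h1 1) (h2 1)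
    have := integral_deriv_comp_mul_fderiv_fderiv_nonpos hβ h0 hnn hK hG hL2 2 (h1 2) (h2 2)
    linarith
  have hax' : ∫ x, deriv β (G x) * radDerivQuot G x ≤ 0 :=
    hax.integral_deriv_comp_mul_radDerivQuot_nonpos hG hβ1 hβnn (hβ'L2.integrable_mul hq)
      (integrable_comp hβ h00 h0 hK hG.continuous hL2)
  -- integrability of the pieces
  have iL : Integrable (fun x => deriv β (G x) * (Δ G) x) := by
    have iJ : ∀ i : Fin 3, Integrable (fun x => deriv β (G x) *
        fderiv ℝ (fun y => fderiv ℝ G y (EuclideanSpace.single i 1)) x (EuclideanSpace.single i 1)) :=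
      fun i => hβ'L2.integrable_mul (h2 i)
    have i3 : Integrable (fun x =>
        deriv β (G x) * fderiv ℝ (fun y => fderiv ℝ G y (EuclideanSpace.single 0 1)) x
          (EuclideanSpace.single 0 1) +
        deriv β (G x) * fderiv ℝ (fun y => fderiv ℝ G y (EuclideanSpace.single 1 1)) x
          (EuclideanSpace.single 1 1) +
        deriv β (G x) * fderiv ℝ (fun y => fderiv ℝ G y (EuclideanSpace.single 2 1)) x
          (EuclideanSpace.single 2 1)) := ((iJ 0).add (iJ 1)).add (iJ 2)
    refine i3.congr (Eventually.of_forall fun x => ?_)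
    beta_reduce
    rw [laplacian_eq_sum_fderiv_fderiv (EuclideanSpace.basisFun (Fin 3) ℝ) hG x]
    simp only [EuclideanSpace.basisFun_apply, Fin.sum_univ_three]
    ring
  have iQ : Integrable (fun x => deriv β (G x) * radDerivQuot G x) := hβ'L2.integrable_mul hq
  have hbid : ∀ i : Fin 3, Differentiable ℝ fun x => b x i := fun i =>
    (contDiff_apply_coord_vec3 hb i).differentiable one_ne_zero
  have hbiB : ∀ (i : Fin 3) x, ‖b x i‖ ≤ B := fun i x => (PiLp.norm_apply_le (b x) i).trans (hbB x)
  have iA : ∀ i : Fin 3, Integrable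
      (fun x => b x i * (deriv β (G x) * fderiv ℝ G x (EuclideanSpace.single i 1))) := fun i =>
    (hβ'L2.integrable_mul (h1 i)).bdd_mul (hbid i).continuous.aestronglyMeasurable
      (ae_of_all _ (hbiB i))
  have iT : Integrable (fun x => deriv β (G x) * fderiv ℝ G x (b x)) := by
    have i3 : Integrable (fun x => b x 0 * (deriv β (G x) * fderiv ℝ G x (EuclideanSpace.single 0 1)) +
        b x 1 * (deriv β (G x) * fderiv ℝ G x (EuclideanSpace.single 1 1)) +
        b x 2 * (deriv β (G x) * fderiv ℝ G x (EuclideanSpace.single 2 1))) :=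
      ((iA 0).add (iA 1)).add (iA 2)
    refine i3.congr (Eventually.of_forall fun x => ?_)
    beta_reduce
    rw [fderiv_apply_eq_sum_three G x (b x)]
    ring
  -- integrate `β'(G) ×` the equation
  have hpt : ∀ x, deriv β (G x) * G' x =
      -(deriv β (G x) * fderiv ℝ G x (b x)) + ν * (deriv β (G x) * (Δ G) x) +
        2 * ν * (deriv β (G x) * radDerivQuot G x) + deriv β (G x) * R x := by
    intro x
    have h := heq x
    have : G' x = -fderiv ℝ G x (b x) + ν * ((Δ G) x + 2 * radDerivQuot G x) + R x := by linarith
    rw [this]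
    ring
  have iTn : Integrable (fun x => -(deriv β (G x) * fderiv ℝ G x (b x))) := iT.neg
  have iLν : Integrable (fun x => ν * (deriv β (G x) * (Δ G) x)) := iL.const_mul ν
  have iQν : Integrable (fun x => 2 * ν * (deriv β (G x) * radDerivQuot G x)) :=
    iQ.const_mul (2 * ν)
  have i12 : Integrable (fun x => -(deriv β (G x) * fderiv ℝ G x (b x)) +
      ν * (deriv β (G x) * (Δ G) x)) := iTn.add iLν
  have i123 : Integrable (fun x => -(deriv β (G x) * fderiv ℝ G x (b x)) +
      ν * (deriv β (G x) * (Δ G) x) + 2 * ν * (deriv β (G x) * radDerivQuot G x)) := i12.add iQν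
  have hint : ∫ x, deriv β (G x) * G' x =
      -(∫ x, deriv β (G x) * fderiv ℝ G x (b x)) + ν * (∫ x, deriv β (G x) * (Δ G) x) +
        2 * ν * (∫ x, deriv β (G x) * radDerivQuot G x) + ∫ x, deriv β (G x) * R x := by
    rw [integral_congr_ae (Eventually.of_forall hpt), integral_add i123 hR, integral_add i12 iQν,
      integral_add iTn iLν, integral_neg, integral_const_mul, integral_const_mul]
  rw [hint, htr]
  nlinarith [mul_nonpos_iff.2 (Or.inl ⟨hν, hlap⟩), mul_nonpos_iff.2 (Or.inl ⟨hν, hax'⟩)]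

end Slice

/-! ### The balance `∫ β(g(b)) = ∫ β(g(0)) + ∫₀ᵇ ∫ β'(g) g'` from a.e. time-line derivatives -/

section Balance

variable {X : Type*} [MeasurableSpace X] {μ : Measure X} [SFinite μ]

/-- **Balance of a composite functional from a.e. time-line derivatives** (the tree's
`integral_sq_eq_add_of_ae_hasDerivAt` with `v²` replaced by `Φ(v)`, `Φ ∈ C¹`). Let `T > 0` and
`g g' : ℝ → X → ℝ`. Assume: for `μ`-a.e. `x`, `t ↦ g t x` and `t ↦ g' t x` are continuous on
`[0, T]` and `t ↦ g t x` has derivative `g' t x` at every `t ∈ (0, T)`; `(t, x) ↦ Φ'(g t x) g' t x`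
is a.e.-strongly measurable for `(vol|_(0,T)) × μ` with `∫ |Φ'(g(t)) g'(t)| dμ ≤ K < ∞` for
`t ∈ (0, T)`; and each slice `Φ(g(t))`, `t ∈ [0, T]`, is integrable. Then for `b ∈ (0, T]`,
`∫ Φ(g(b)) dμ = ∫ Φ(g(0)) dμ + ∫_{t ∈ (0,b)} ∫ Φ'(g(t)) g'(t) dμ dt` (the time integration of
(5.1) in the proof of Gallay–Šverák's Lemma 5.1, for functionals `∫ Φ(η)`).
[cite: GallaySverak2016, §5 Lemma 5.1 proof (time integration of (5.1), arXiv p. 16)] -/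
theorem integral_comp_eq_add_of_ae_hasDerivAt {T : ℝ} {g g' : ℝ → X → ℝ} {Φ : ℝ → ℝ}
    (hΦ : ContDiff ℝ 1 Φ)
    (hline : ∀ᵐ x ∂μ, ContinuousOn (fun t => g t x) (Icc 0 T) ∧
      ContinuousOn (fun t => g' t x) (Icc 0 T) ∧ ∀ t ∈ Ioo 0 T, HasDerivAt (fun t => g t x) (g' t x) t)
    (hmeas : AEStronglyMeasurable (uncurry fun t x => deriv Φ (g t x) * g' t x)
      ((volume.restrict (Ioo 0 T)).prod μ))
    {K : ℝ≥0∞} (hK : K ≠ ⊤) (hbound : ∀ t ∈ Ioo 0 T, ∫⁻ x, ‖deriv Φ (g t x) * g' t x‖ₑ ∂μ ≤ K)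
    (hint : ∀ t ∈ Icc 0 T, Integrable (fun x => Φ (g t x)) μ) {b : ℝ} (hb : b ∈ Ioc 0 T) :
    ∫ x, Φ (g b x) ∂μ = (∫ x, Φ (g 0 x) ∂μ) + ∫ t in Ioo 0 b, ∫ x, deriv Φ (g t x) * g' t x ∂μ := by
  have hT : 0 < T := hb.1.trans_le hb.2
  have hΦd : Differentiable ℝ Φ := hΦ.differentiable one_ne_zero
  have hΦc : Continuous (deriv Φ) := hΦ.continuous_deriv le_rfl
  -- the product measure on `(0, b) × X` as a restriction of the one on `(0, T) × X`
  set μb : Measure (ℝ × X) := (volume.restrict (Ioo 0 b)).prod μ with hμb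
  have hμb' : μb = ((volume.restrict (Ioo 0 T)).prod μ).restrict (Ioo 0 b ×ˢ univ) := by
    rw [hμb, ← Measure.prod_restrict, Measure.restrict_univ,
      Measure.restrict_restrict measurableSet_Ioo,
      inter_eq_self_of_subset_left (Ioo_subset_Ioo le_rfl hb.2)]
  have hmeas_b : AEStronglyMeasurable (uncurry fun t x => deriv Φ (g t x) * g' t x) μb := by
    rw [hμb']; exact hmeas.restrict
  -- product integrability on `(0, b) × X`
  have hI : Integrable (uncurry fun t x => deriv Φ (g t x) * g' t x) μb := by
    refine ⟨hmeas_b, ?_⟩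
    have hle := lintegral_prod_le (μ := volume.restrict (Ioo 0 b)) (ν := μ)
      (fun z : ℝ × X => ‖uncurry (fun t x => deriv Φ (g t x) * g' t x) z‖ₑ)
    refine lt_of_le_of_lt hle ?_
    calc ∫⁻ t in Ioo 0 b, ∫⁻ x, ‖uncurry (fun t x => deriv Φ (g t x) * g' t x) (t, x)‖ₑ ∂μ
        ≤ ∫⁻ _ in Ioo 0 b, K := setLIntegral_mono' measurableSet_Ioo fun t ht =>
            hbound t ⟨ht.1, ht.2.trans_le hb.2⟩
      _ < ⊤ := by
          rw [setLIntegral_const]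
          exact ENNReal.mul_lt_top hK.lt_top (by simp)
  -- the fundamental theorem of calculus on a.e. time line
  have hFTC : ∀ᵐ x ∂μ, ∫ t in Ioo 0 b, deriv Φ (g t x) * g' t x = Φ (g b x) - Φ (g 0 x) := by
    filter_upwards [hline] with x hx
    obtain ⟨hgc, hg'c, hder⟩ := hx
    have hsub : Icc 0 b ⊆ Icc 0 T := Icc_subset_Icc le_rfl hb.2
    have hcont : ContinuousOn (fun t => Φ (g t x)) (Icc 0 b) :=
      hΦd.continuous.comp_continuousOn (hgc.mono hsub)
    have hderiv : ∀ t ∈ Ioo 0 b, HasDerivAt (fun t => Φ (g t x)) (deriv Φ (g t x) * g' t x) t := by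
      intro t ht
      exact (hΦd (g t x)).hasDerivAt.comp t (hder t ⟨ht.1, ht.2.trans_le hb.2⟩)
    have hint' : IntervalIntegrable (fun t => deriv Φ (g t x) * g' t x) volume 0 b :=
      ((hΦc.comp_continuousOn (hgc.mono hsub)).mul (hg'c.mono hsub)).intervalIntegrable_of_Icc
        hb.1.le
    have h := intervalIntegral.integral_eq_sub_of_hasDerivAt_of_le hb.1.le hcont hderiv hint'
    rwa [intervalIntegral.integral_of_le hb.1.le, integral_Ioc_eq_integral_Ioo] at h
  -- Fubini
  have hswap := integral_integral_swap (μ := volume.restrict (Ioo 0 b)) (ν := μ)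
    (f := fun t x => deriv Φ (g t x) * g' t x) hI
  have hx : ∫ x, (∫ t in Ioo 0 b, deriv Φ (g t x) * g' t x) ∂μ =
      (∫ x, Φ (g b x) ∂μ) - ∫ x, Φ (g 0 x) ∂μ := by
    rw [integral_congr_ae hFTC, integral_sub (hint b ⟨hb.1.le, hb.2⟩) (hint 0 ⟨le_rfl, hT.le⟩)]
  rw [hswap, hx]
  ring

/-- Under the hypotheses of `integral_comp_eq_add_of_ae_hasDerivAt`, the time function
`t ↦ ∫ Φ'(g(t)) g'(t) dμ` is integrable on `(0, T)` (Fubini). [folklore] -/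
private theorem integrableOn_integral_deriv_comp_mul {T : ℝ} {g g' : ℝ → X → ℝ} {Φ : ℝ → ℝ}
    (hmeas : AEStronglyMeasurable (uncurry fun t x => deriv Φ (g t x) * g' t x)
      ((volume.restrict (Ioo 0 T)).prod μ))
    {K : ℝ≥0∞} (hK : K ≠ ⊤) (hbound : ∀ t ∈ Ioo 0 T, ∫⁻ x, ‖deriv Φ (g t x) * g' t x‖ₑ ∂μ ≤ K) :
    IntegrableOn (fun t => ∫ x, deriv Φ (g t x) * g' t x ∂μ) (Ioo 0 T) := by
  have hI : Integrable (uncurry fun t x => deriv Φ (g t x) * g' t x)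
      ((volume.restrict (Ioo 0 T)).prod μ) := by
    refine ⟨hmeas, ?_⟩
    have hle := lintegral_prod_le (μ := volume.restrict (Ioo 0 T)) (ν := μ)
      (fun z : ℝ × X => ‖uncurry (fun t x => deriv Φ (g t x) * g' t x) z‖ₑ)
    refine lt_of_le_of_lt hle ?_
    calc ∫⁻ t in Ioo 0 T, ∫⁻ x, ‖uncurry (fun t x => deriv Φ (g t x) * g' t x) (t, x)‖ₑ ∂μ
        ≤ ∫⁻ _ in Ioo 0 T, K := setLIntegral_mono' measurableSet_Ioo fun t ht => hbound t ht
      _ < ⊤ := by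
          rw [setLIntegral_const]
          exact ENNReal.mul_lt_top hK.lt_top (by simp)
  exact hI.integral_prod_left

/-- **Monotonicity from the balance.** Under the hypotheses of
`integral_comp_eq_add_of_ae_hasDerivAt`, if `∫ Φ'(g(t)) g'(t) dμ ≤ 0` for every `t ∈ (0, T)`,
then `t ↦ ∫ Φ(g(t)) dμ` is non-increasing on `[0, T]` (as in the proof of Gallay–Šverák's
Lemma 5.1: `d/dt ∫ ≤ 0` integrated in time).
[cite: GallaySverak2016, §5 Lemma 5.1 proof (arXiv p. 16)] -/
theorem antitoneOn_integral_comp_of_ae_hasDerivAt {T : ℝ} {g g' : ℝ → X → ℝ} {Φ : ℝ → ℝ}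
    (hΦ : ContDiff ℝ 1 Φ)
    (hline : ∀ᵐ x ∂μ, ContinuousOn (fun t => g t x) (Icc 0 T) ∧
      ContinuousOn (fun t => g' t x) (Icc 0 T) ∧ ∀ t ∈ Ioo 0 T, HasDerivAt (fun t => g t x) (g' t x) t)
    (hmeas : AEStronglyMeasurable (uncurry fun t x => deriv Φ (g t x) * g' t x)
      ((volume.restrict (Ioo 0 T)).prod μ))
    {K : ℝ≥0∞} (hK : K ≠ ⊤) (hbound : ∀ t ∈ Ioo 0 T, ∫⁻ x, ‖deriv Φ (g t x) * g' t x‖ₑ ∂μ ≤ K)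
    (hint : ∀ t ∈ Icc 0 T, Integrable (fun x => Φ (g t x)) μ)
    (hle : ∀ t ∈ Ioo 0 T, ∫ x, deriv Φ (g t x) * g' t x ∂μ ≤ 0) :
    AntitoneOn (fun t => ∫ x, Φ (g t x) ∂μ) (Icc 0 T) := by
  intro s hs t ht hst
  rcases hst.eq_or_lt with rfl | hst'
  · exact le_rfl
  have hF := integrableOn_integral_deriv_comp_mul hmeas hK hbound
  -- `∫ Φ(g t) = ∫ Φ(g s) + ∫_{(s,t)} h` with `h ≤ 0`
  have ht' : t ∈ Ioc 0 T := ⟨hs.1.trans_lt hst', ht.2⟩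
  have hId_t := integral_comp_eq_add_of_ae_hasDerivAt hΦ hline hmeas hK hbound hint ht'
  have hneg : ∀ a b' : ℝ, 0 ≤ a → b' ≤ T → ∫ τ in Ioo a b', ∫ x, deriv Φ (g τ x) * g' τ x ∂μ ≤ 0 := by
    intro a b' ha hb'
    refine setIntegral_nonpos measurableSet_Ioo fun τ hτ => hle τ ⟨ha.trans_lt hτ.1, hτ.2.trans_le hb'⟩
  show ∫ x, Φ (g t x) ∂μ ≤ ∫ x, Φ (g s x) ∂μ
  rcases hs.1.eq_or_lt with rfl | hs0
  · rw [hId_t]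
    linarith [hneg 0 t le_rfl ht.2]
  · have hs' : s ∈ Ioc 0 T := ⟨hs0, hs.2⟩
    have hId_s := integral_comp_eq_add_of_ae_hasDerivAt hΦ hline hmeas hK hbound hint hs'
    -- `(0, s) ⊆ (0, t)` and the time integrand is `≤ 0`
    have hmono : ∫ τ in Ioo 0 t, ∫ x, deriv Φ (g τ x) * g' τ x ∂μ ≤
        ∫ τ in Ioo 0 s, ∫ x, deriv Φ (g τ x) * g' τ x ∂μ := by
      have h1 := setIntegral_mono_set (μ := volume)
        (f := fun τ => -∫ x, deriv Φ (g τ x) * g' τ x ∂μ) (s := Ioo 0 s) (t := Ioo 0 t)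
        ((hF.mono_set (Ioo_subset_Ioo le_rfl ht.2)).neg)
        ((ae_restrict_iff' measurableSet_Ioo).2 (Eventually.of_forall fun τ hτ =>
          neg_nonneg.2 (hle τ ⟨hτ.1, hτ.2.trans_le ht.2⟩)))
        (Ioo_subset_Ioo le_rfl hst).eventuallyLE
      rw [integral_neg, integral_neg] at h1
      linarith
    rw [hId_t, hId_s]
    linarith

end Balance

/-! ### Tao's class: `t ↦ ∫ β(ω_θ/r)(t) dx` is non-increasing for axisymmetric flows without swirl -/

section TaoClass

variable {T ν : ℝ} {u₀ : EuclideanSpace ℝ (Fin 3) → EuclideanSpace ℝ (Fin 3)}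
  {v : ℝ → EuclideanSpace ℝ (Fin 3) → EuclideanSpace ℝ (Fin 3)} {q : ℝ → EuclideanSpace ℝ (Fin 3) → ℝ}
  {β : ℝ → ℝ} {K : ℝ}

/-- Without swirl `u^θ/r ≡ 0`: `angVelQuot u = 0` when `swirl u ≡ 0`. [folklore] -/
private theorem angVelQuot_eq_zero_of_hasNoSwirl {u : EuclideanSpace ℝ (Fin 3) → EuclideanSpace ℝ (Fin 3)}
    (hsw : HasNoSwirl u) : angVelQuot u = 0 := by
  have h0 : swirl u = fun _ => 0 := funext fun x => hsw x
  funext x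
  simp only [angVelQuot, h0, Pi.zero_apply]
  have h1 : radDerivQuot (fun _ : EuclideanSpace ℝ (Fin 3) => (0 : ℝ)) = fun _ => 0 := by
    funext y
    simp [radDerivQuot, hadamardQuotFst]
  simp [radQuot, h1]

/-- From `0 ≤ β'' ≤ K`: `|β''| ≤ K`. [folklore] -/
private theorem abs_deriv_deriv_le (hnn : ∀ v, 0 ≤ deriv (deriv β) v) (hK : ∀ v, deriv (deriv β) v ≤ K)
    (v : ℝ) : |deriv (deriv β) v| ≤ K := by
  rw [abs_of_nonneg (hnn v)]; exact hK v

/-- **The slice inequality in Tao's class.** For a Tao-class solution on `[0, T]` with `ν ≥ 0`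
whose slices are axisymmetric without swirl, `β ∈ C²` with `β(0) = β'(0) = 0`, `0 ≤ β'' ≤ K`,
and `t ∈ [0, T]`: `∫ β'(Ω(t)) Ω'(t) dx ≤ 0`, where `Ω(t) = angVortQuot (v t) = ω_θ/r` and
`Ω'(t) = angVortQuot (∂ₜv t)` (the `Ω`-equation `IsClassicalNSSolutionOn.angVortQuot_eq` has no
source without swirl; all `L²` data from `IsTaoSolutionOn.memLp_angVortQuot_data`).
[cite: GallaySverak2016, §5 Lemma 5.1 proof (arXiv p. 16)] -/
theorem IsTaoSolutionOn.integral_deriv_comp_mul_angVortQuot_nonpos (h : IsTaoSolutionOn T ν u₀ v q)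
    (hT : 0 < T) (hν : 0 ≤ ν) (hax : ∀ t ∈ Icc 0 T, IsAxisymmetric (v t))
    (hsw : ∀ t ∈ Icc 0 T, HasNoSwirl (v t))
    (hβ : ContDiff ℝ 2 β) (h00 : β 0 = 0) (h0 : deriv β 0 = 0)
    (hnn : ∀ w, 0 ≤ deriv (deriv β) w) (hK : ∀ w, deriv (deriv β) w ≤ K) {t : ℝ} (ht : t ∈ Icc 0 T) :
    ∫ x, deriv β (angVortQuot (v t) x) * angVortQuot (timeDerivWithin (Icc 0 T) v t) x ≤ 0 := by
  have hU : UniqueDiffOn ℝ (Icc 0 T) := uniqueDiffOn_Icc hT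
  have hcl := Icc_subset_closure_interior_Icc' hT
  have hK' : ∀ w, |deriv (deriv β) w| ≤ K := abs_deriv_deriv_le hnn hK
  have hvs : ContDiff ℝ ∞ (v t) := h.classical.contDiff_velocity ht
  have hv1 : ContDiff ℝ 1 (v t) := hvs.of_le (by norm_cast)
  have hv3 : ContDiff ℝ 3 (v t) := hvs.of_le (by norm_cast)
  have hΩ2 : ContDiff ℝ 2 (angVortQuot (v t)) :=
    contDiff_angVortQuot (n := 2) (by exact_mod_cast hvs.of_le (by norm_cast))
  have hΩax : IsAxisymmetricScalar (angVortQuot (v t)) := (hax t ht).isAxisymmetricScalar_angVortQuot hv3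
  obtain ⟨m0, m1, m2, mq⟩ := h.memLp_angVortQuot_data hax ht
  obtain ⟨B, -, hB⟩ := exists_bound_velocity h
  obtain ⟨B', -, hB'⟩ := h.exists_bound_fderiv_velocity
  have hΦ0 : angVelQuot (v t) = 0 := angVelQuot_eq_zero_of_hasNoSwirl (hsw t ht)
  have heq : ∀ x, angVortQuot (timeDerivWithin (Icc 0 T) v t) x +
      fderiv ℝ (angVortQuot (v t)) x (v t x) =
      ν * ((Δ (angVortQuot (v t))) x + 2 * radDerivQuot (angVortQuot (v t)) x) + (fun _ => (0 : ℝ)) x :=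
    fun x => by
      rw [h.classical.angVortQuot_eq hU hcl hax ht x, hΦ0]
      simp
  have hR : Integrable (fun x => deriv β (angVortQuot (v t) x) * (fun _ => (0 : ℝ)) x) := by
    simp only [mul_zero]
    exact integrable_zero _ _ _
  have hmain := integral_deriv_comp_mul_le_of_drift_laplacian hβ h00 h0 hnn hK' hΩ2 hΩax hν m0 m1 m2
    mq hR hv1 (h.classical.divFree t ht) (hB t ht) (hB' t ht) heq
  simpa using hmain

/-- **Monotonicity of convex functionals of `ω_θ/r` for axisymmetric flows without swirl** (the
smooth-class form of the computation behind Gallay–Šverák 2015, Lemma 5.1). Let `(v, q)` be a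
Tao-class solution of the unforced Navier–Stokes system on `[0, T] × ℝ³` with viscosity
`ν ≥ 0` (`IsTaoSolutionOn T ν u₀ v q`), axisymmetric without swirl at every time of `[0, T]`, and
let `β ∈ C²` with `β(0) = β'(0) = 0`, `0 ≤ β'' ≤ K`. Then
`t ↦ ∫_{ℝ³} β(Ω(t, x)) dx`, `Ω = angVortQuot (v t) = ω_θ/r`, is non-increasing on `[0, T]`.
(Proof: the slice inequality `…integral_deriv_comp_mul_angVortQuot_nonpos` integrated in time by
`antitoneOn_integral_comp_of_ae_hasDerivAt`, `Ω` being jointly smooth —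
`IsSmoothSpaceTimeOn.angVortQuot_family`, `…timeDerivWithin_angVortQuot` — with uniform `L²`
bounds of `Ω, ∂ₜΩ` from `IsTaoSolutionOn.exists_lintegral_sq_quot_le`.)
[cite: GallaySverak2016, §5 Lemma 5.1 (arXiv p. 16)] -/
theorem IsTaoSolutionOn.antitoneOn_integral_comp_angVortQuot (h : IsTaoSolutionOn T ν u₀ v q)
    (hT : 0 < T) (hν : 0 ≤ ν) (hax : ∀ t ∈ Icc 0 T, IsAxisymmetric (v t))
    (hsw : ∀ t ∈ Icc 0 T, HasNoSwirl (v t))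
    (hβ : ContDiff ℝ 2 β) (h00 : β 0 = 0) (h0 : deriv β 0 = 0)
    (hnn : ∀ w, 0 ≤ deriv (deriv β) w) (hK : ∀ w, deriv (deriv β) w ≤ K) :
    AntitoneOn (fun t => ∫ x, β (angVortQuot (v t) x)) (Icc 0 T) := by
  have hU : UniqueDiffOn ℝ (Icc 0 T) := uniqueDiffOn_Icc hT
  have hcl := Icc_subset_closure_interior_Icc' hT
  have hK' : ∀ w, |deriv (deriv β) w| ≤ K := abs_deriv_deriv_le hnn hK
  have hK0 : 0 ≤ K := (hnn 0).trans (hK 0)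
  obtain ⟨hd, hd'⟩ := differentiable_deriv_of_contDiff_two hβ
  have hβ1 : ContDiff ℝ 1 β := hβ.of_le (by norm_num)
  have hsm : IsSmoothSpaceTimeOn (Icc 0 T) v := h.classical.smooth_velocity
  have hvs : ∀ t ∈ Icc 0 T, ContDiff ℝ ∞ (v t) := fun t ht => h.classical.contDiff_velocity ht
  have hΩc : ∀ t ∈ Icc 0 T, Continuous (angVortQuot (v t)) := fun t ht =>
    (contDiff_angVortQuot (n := 0) (by exact_mod_cast (hvs t ht).of_le (by norm_cast))).continuous
  -- the jointly smooth family `Ω` and its time derivative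
  have hΩ : IsSmoothSpaceTimeOn (Icc 0 T) (fun t => angVortQuot (v t)) :=
    hsm.angVortQuot_family (convex_Icc 0 T) hU
  have hΩ' : IsSmoothSpaceTimeOn (Icc 0 T) (timeDerivWithin (Icc 0 T) fun t => angVortQuot (v t)) :=
    hΩ.timeDerivWithin hU
  have hdt : ∀ t ∈ Icc 0 T, ∀ x, timeDerivWithin (Icc 0 T) (fun s => angVortQuot (v s)) t x =
      angVortQuot (timeDerivWithin (Icc 0 T) v t) x := fun t ht x =>
    hsm.timeDerivWithin_angVortQuot (convex_Icc 0 T) hU hcl hax ht x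
  -- time lines of jointly continuous fields are continuous
  have tl : ∀ {w : ℝ → EuclideanSpace ℝ (Fin 3) → ℝ},
      ContinuousOn (uncurry w) (Icc 0 T ×ˢ univ) → ∀ x, ContinuousOn (fun s => w s x) (Icc 0 T) := by
    intro w hw x
    exact hw.comp (continuous_id.prodMk continuous_const).continuousOn
      fun s hs => mk_mem_prod hs (mem_univ x)
  -- uniform `L²` bounds of `Ω`, `Ω'`
  obtain ⟨C, hC⟩ := h.exists_lintegral_sq_quot_le hT hax
  refine antitoneOn_integral_comp_of_ae_hasDerivAt (μ := volume) (T := T)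
    (g := fun t x => angVortQuot (v t) x)
    (g' := fun t x => angVortQuot (timeDerivWithin (Icc 0 T) v t) x) hβ1
    (ae_of_all _ fun x => ⟨tl hΩ.continuousOn x, (tl hΩ'.continuousOn x).congr fun s hs => ?_,
      fun t ht => ?_⟩) ?_ (K := ENNReal.ofReal K * ((C : ℝ≥0∞) + C))
    (ENNReal.mul_ne_top ENNReal.ofReal_ne_top (by simp)) ?_ ?_ ?_
  · -- `g' s x = ∂ₜΩ s x`
    exact (hdt s hs x).symm
  · -- derivative of the time line at an interior time
    have htI : t ∈ Icc 0 T := Ioo_subset_Icc_self ht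
    have h1 : HasDerivWithinAt (fun s => angVortQuot (v s) x)
        (timeDerivWithin (Icc 0 T) (fun s => angVortQuot (v s)) t x) (Icc 0 T) t := by
      rw [timeDerivWithin_apply]
      exact (hΩ.differentiableWithinAt_time htI x).hasDerivWithinAt
    rw [hdt t htI x] at h1
    exact h1.hasDerivAt (Icc_mem_nhds ht.1 ht.2)
  · -- joint measurability from continuity
    refine aestronglyMeasurable_prod_of_continuousOn_off_axis
      (F := uncurry fun t x => deriv β (angVortQuot (v t) x) *
        angVortQuot (timeDerivWithin (Icc 0 T) v t) x) ?_
    have hsub : Ioo 0 T ×ˢ {x : EuclideanSpace ℝ (Fin 3) | cylRadius x ≠ 0} ⊆ Icc 0 T ×ˢ univ :=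
      prod_mono Ioo_subset_Icc_self (subset_univ _)
    have c1 : ContinuousOn (fun p : ℝ × EuclideanSpace ℝ (Fin 3) => deriv β (uncurry (fun t x =>
        angVortQuot (v t) x) p)) (Icc 0 T ×ˢ univ) := hd'.continuous.comp_continuousOn hΩ.continuousOn
    have c2 : ContinuousOn (uncurry (timeDerivWithin (Icc 0 T) fun t => angVortQuot (v t)))
        (Icc 0 T ×ˢ univ) := hΩ'.continuousOn
    refine ((c1.mul c2).mono hsub).congr fun p hp => ?_
    obtain ⟨t, x⟩ := p
    have htI : t ∈ Icc 0 T := Ioo_subset_Icc_self hp.1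
    simp only [Pi.mul_apply, uncurry_apply_pair]
    rw [hdt t htI x]
  · -- uniform `L¹` bound of `β'(Ω) Ω'`
    intro t ht
    have htI : t ∈ Icc 0 T := Ioo_subset_Icc_self ht
    obtain ⟨hΩC, hΩ'C, -, -⟩ := hC t htI
    calc ∫⁻ x, ‖deriv β (angVortQuot (v t) x) * angVortQuot (timeDerivWithin (Icc 0 T) v t) x‖ₑ
        ≤ ∫⁻ x, ENNReal.ofReal K * (‖angVortQuot (v t) x‖ₑ ^ 2 +
            ‖angVortQuot (timeDerivWithin (Icc 0 T) v t) x‖ₑ ^ 2) := by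
          refine lintegral_mono fun x => ?_
          rw [enorm_mul]
          calc ‖deriv β (angVortQuot (v t) x)‖ₑ * ‖angVortQuot (timeDerivWithin (Icc 0 T) v t) x‖ₑ
              ≤ (ENNReal.ofReal K * ‖angVortQuot (v t) x‖ₑ) *
                  ‖angVortQuot (timeDerivWithin (Icc 0 T) v t) x‖ₑ := by
                gcongr
                have hb := abs_deriv_le_mul_abs hβ h0 hK' (angVortQuot (v t) x)
                rw [← Real.enorm_eq_ofReal hK0, ← enorm_mul, Real.enorm_eq_ofReal_abs,
                  Real.enorm_eq_ofReal_abs, abs_mul, abs_of_nonneg hK0]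
                exact ENNReal.ofReal_le_ofReal hb
            _ = ENNReal.ofReal K * (‖angVortQuot (v t) x‖ₑ *
                  ‖angVortQuot (timeDerivWithin (Icc 0 T) v t) x‖ₑ) := mul_assoc _ _ _
            _ ≤ ENNReal.ofReal K * (‖angVortQuot (v t) x‖ₑ ^ 2 +
                  ‖angVortQuot (timeDerivWithin (Icc 0 T) v t) x‖ₑ ^ 2) := by
                gcongr
                exact ennreal_mul_le_sq_add_sq _ _
      _ = ENNReal.ofReal K * ((∫⁻ x, ‖angVortQuot (v t) x‖ₑ ^ 2) +
            ∫⁻ x, ‖angVortQuot (timeDerivWithin (Icc 0 T) v t) x‖ₑ ^ 2) := by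
          have hmΩ : Measurable fun x => ‖angVortQuot (v t) x‖ₑ ^ 2 :=
            (hΩc t htI).measurable.enorm.pow_const 2
          rw [lintegral_const_mul' _ _ ENNReal.ofReal_ne_top, lintegral_add_left hmΩ]
      _ ≤ ENNReal.ofReal K * ((C : ℝ≥0∞) + C) := by gcongr
  · -- slices `β(Ω(t))` are integrable
    intro t ht
    obtain ⟨m0, -, -, -⟩ := h.memLp_angVortQuot_data hax ht
    exact integrable_comp hβ h00 h0 hK' (hΩc t ht) m0
  · -- the slice inequality
    intro t ht
    exact h.integral_deriv_comp_mul_angVortQuot_nonpos hT hν hax hsw hβ h00 h0 hnn hK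
      (Ioo_subset_Icc_self ht)

end TaoClass

/-! ### Smooth convex approximants of the positive part: `β_δ(w) = ∫₀ʷ smoothTransition (r/δ) dr` -/

section Approx

variable {δ : ℝ}

/-- The integrand `r ↦ smoothTransition (r/δ)` is smooth. [folklore] -/
private theorem contDiff_smoothTransition_div (δ : ℝ) {n : ℕ∞} :
    ContDiff ℝ n fun r : ℝ => Real.smoothTransition (r / δ) :=
  Real.smoothTransition.contDiff.comp (contDiff_id.div_const δ)

/-- `β_δ' (w) = smoothTransition (w/δ)` (fundamental theorem of calculus). [folklore] -/
private theorem hasDerivAt_posApprox (δ w : ℝ) :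
    HasDerivAt (fun w => ∫ r in (0 : ℝ)..w, Real.smoothTransition (r / δ))
      (Real.smoothTransition (w / δ)) w := by
  have hc : Continuous fun r : ℝ => Real.smoothTransition (r / δ) :=
    (contDiff_smoothTransition_div δ (n := 0)).continuous
  exact intervalIntegral.integral_hasDerivAt_right (hc.intervalIntegrable _ _)
    (hc.stronglyMeasurableAtFilter _ _) hc.continuousAt

/-- `deriv β_δ = smoothTransition (·/δ)`. [folklore] -/
private theorem deriv_posApprox (δ : ℝ) :
    deriv (fun w => ∫ r in (0 : ℝ)..w, Real.smoothTransition (r / δ)) =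
      fun w => Real.smoothTransition (w / δ) :=
  funext fun w => (hasDerivAt_posApprox δ w).deriv

/-- `β_δ ∈ C²` (indeed `C^∞`). [folklore] -/
private theorem contDiff_posApprox (δ : ℝ) :
    ContDiff ℝ 2 fun w => ∫ r in (0 : ℝ)..w, Real.smoothTransition (r / δ) := by
  rw [show (2 : WithTop ℕ∞) = 1 + 1 by norm_num, contDiff_succ_iff_deriv]
  refine ⟨fun w => (hasDerivAt_posApprox δ w).differentiableAt, fun h => absurd h (by simp), ?_⟩
  rw [deriv_posApprox]
  exact_mod_cast contDiff_smoothTransition_div δ (n := 1)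

/-- `β_δ(0) = 0`. [folklore] -/
private theorem posApprox_zero (δ : ℝ) : (∫ r in (0 : ℝ)..0, Real.smoothTransition (r / δ)) = 0 :=
  intervalIntegral.integral_same

/-- `β_δ'(0) = 0`. [folklore] -/
private theorem deriv_posApprox_zero (δ : ℝ) :
    deriv (fun w => ∫ r in (0 : ℝ)..w, Real.smoothTransition (r / δ)) 0 = 0 := by
  rw [deriv_posApprox]
  simp [Real.smoothTransition.zero_of_nonpos]

/-- `β_δ''(w) = smoothTransition' (w/δ) / δ`. [folklore] -/
private theorem deriv_deriv_posApprox (δ w : ℝ) :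
    deriv (deriv fun w => ∫ r in (0 : ℝ)..w, Real.smoothTransition (r / δ)) w =
      deriv Real.smoothTransition (w / δ) / δ := by
  rw [deriv_posApprox]
  have h1 : HasDerivAt Real.smoothTransition (deriv Real.smoothTransition (w / δ)) (w / δ) :=
    (Calculus.differentiable_smoothTransition (w / δ)).hasDerivAt
  have h2 := h1.comp w ((hasDerivAt_id w).div_const δ)
  have h : HasDerivAt (fun w => Real.smoothTransition (w / δ))
      (deriv Real.smoothTransition (w / δ) * (1 / δ)) w := h2
  rw [h.deriv]
  ring

/-- `0 ≤ β_δ''` for `δ > 0`. [folklore] -/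
private theorem deriv_deriv_posApprox_nonneg (hδ : 0 < δ) (w : ℝ) :
    0 ≤ deriv (deriv fun w => ∫ r in (0 : ℝ)..w, Real.smoothTransition (r / δ)) w := by
  rw [deriv_deriv_posApprox]
  exact div_nonneg Real.smoothTransition.monotone.deriv_nonneg hδ.le

/-- `β_δ'' ≤ D/δ` for `δ > 0`, `D` a bound of `|smoothTransition'|`. [folklore] -/
private theorem deriv_deriv_posApprox_le (hδ : 0 < δ) {D : ℝ} (hD : ∀ s, |deriv Real.smoothTransition s| ≤ D)
    (w : ℝ) :
    deriv (deriv fun w => ∫ r in (0 : ℝ)..w, Real.smoothTransition (r / δ)) w ≤ D / δ := by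
  rw [deriv_deriv_posApprox]
  exact div_le_div_of_nonneg_right ((le_abs_self _).trans (hD _)) hδ.le

/-- `β_δ(w) = 0` for `w ≤ 0` (the integrand vanishes on `(-∞, 0]`). [folklore] -/
private theorem posApprox_of_nonpos (hδ : 0 < δ) {w : ℝ} (hw : w ≤ 0) :
    (∫ r in (0 : ℝ)..w, Real.smoothTransition (r / δ)) = 0 := by
  rw [intervalIntegral.integral_symm]
  have : (∫ r in w..(0 : ℝ), Real.smoothTransition (r / δ)) = ∫ _ in w..(0 : ℝ), (0 : ℝ) := by
    refine intervalIntegral.integral_congr fun r hr => ?_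
    rw [uIcc_of_le hw] at hr
    exact Real.smoothTransition.zero_of_nonpos (div_nonpos_of_nonpos_of_nonneg hr.2 hδ.le)
  rw [this, intervalIntegral.integral_zero, neg_zero]

/-- `β_δ(w) ≤ w⁺`. [folklore] -/
private theorem posApprox_le_posPart (hδ : 0 < δ) (w : ℝ) :
    (∫ r in (0 : ℝ)..w, Real.smoothTransition (r / δ)) ≤ w⁺ := by
  rcases le_or_gt w 0 with hw | hw
  · rw [posApprox_of_nonpos hδ hw]; exact posPart_nonneg _
  · have h1 : (∫ r in (0 : ℝ)..w, Real.smoothTransition (r / δ)) ≤ ∫ _ in (0 : ℝ)..w, (1 : ℝ) :=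
      intervalIntegral.integral_mono_on hw.le
        ((contDiff_smoothTransition_div δ (n := 0)).continuous.intervalIntegrable _ _)
        (continuous_const.intervalIntegrable _ _) fun r _ => Real.smoothTransition.le_one _
    rw [intervalIntegral.integral_const, smul_eq_mul, mul_one, sub_zero] at h1
    exact h1.trans (le_posPart w)

/-- `w⁺ − δ ≤ β_δ(w)` (the integrand is `≥ 0`, and `= 1` on `[δ, ∞)`). [folklore] -/
private theorem posPart_sub_le_posApprox (hδ : 0 < δ) (w : ℝ) :
    w⁺ - δ ≤ ∫ r in (0 : ℝ)..w, Real.smoothTransition (r / δ) := by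
  have hc : Continuous fun r : ℝ => Real.smoothTransition (r / δ) :=
    (contDiff_smoothTransition_div δ (n := 0)).continuous
  rcases le_or_gt w 0 with hw | hw
  · rw [posApprox_of_nonpos hδ hw, posPart_eq_zero.2 hw]; linarith
  rw [posPart_eq_self.2 hw.le]
  rcases le_or_gt w δ with hwδ | hwδ
  · have h0 : 0 ≤ ∫ r in (0 : ℝ)..w, Real.smoothTransition (r / δ) :=
      intervalIntegral.integral_nonneg hw.le fun r _ => Real.smoothTransition.nonneg _
    linarith
  · -- split at `δ`
    rw [← intervalIntegral.integral_add_adjacent_intervals (b := δ) (hc.intervalIntegrable _ _)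
      (hc.intervalIntegrable _ _)]
    have h0 : 0 ≤ ∫ r in (0 : ℝ)..δ, Real.smoothTransition (r / δ) :=
      intervalIntegral.integral_nonneg hδ.le fun r _ => Real.smoothTransition.nonneg _
    have h1 : (∫ r in δ..w, Real.smoothTransition (r / δ)) = ∫ _ in δ..w, (1 : ℝ) := by
      refine intervalIntegral.integral_congr fun r hr => ?_
      rw [uIcc_of_le hwδ.le] at hr
      exact Real.smoothTransition.one_of_one_le ((one_le_div hδ).2 hr.1)
    rw [h1, intervalIntegral.integral_const, smul_eq_mul, mul_one]
    linarith

/-- `β_{1/(n+1)}(w) → w⁺`. [folklore] -/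
private theorem tendsto_posApprox (w : ℝ) :
    Tendsto (fun n : ℕ => ∫ r in (0 : ℝ)..w, Real.smoothTransition (r / ((1 : ℝ) / (n + 1)))) atTop
      (𝓝 (w⁺)) := by
  have h0 : Tendsto (fun n : ℕ => w⁺ - (1 : ℝ) / ((n : ℝ) + 1)) atTop (𝓝 (w⁺ - 0)) :=
    tendsto_const_nhds.sub tendsto_one_div_add_atTop_nhds_zero_nat
  rw [sub_zero] at h0
  refine tendsto_of_tendsto_of_tendsto_of_le_of_le h0 tendsto_const_nhds (fun n => ?_) fun n => ?_
  · exact posPart_sub_le_posApprox (by positivity) w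
  · exact posApprox_le_posPart (by positivity) w

/-- The mirrored approximant `w ↦ β_δ(−w)` has derivative `−smoothTransition (−w/δ)`. [folklore] -/
private theorem hasDerivAt_negApprox (δ w : ℝ) :
    HasDerivAt (fun w => ∫ r in (0 : ℝ)..(-w), Real.smoothTransition (r / δ))
      (-Real.smoothTransition (-w / δ)) w := by
  have h := (hasDerivAt_posApprox δ (-w)).comp w (hasDerivAt_neg w)
  have e : Real.smoothTransition (-w / δ) * -1 = -Real.smoothTransition (-w / δ) := by ring
  rw [← e]
  exact h

/-- `deriv (w ↦ β_δ(−w)) = −smoothTransition (−·/δ)`. [folklore] -/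
private theorem deriv_negApprox (δ : ℝ) :
    deriv (fun w => ∫ r in (0 : ℝ)..(-w), Real.smoothTransition (r / δ)) =
      fun w => -Real.smoothTransition (-w / δ) :=
  funext fun w => (hasDerivAt_negApprox δ w).deriv

/-- `(w ↦ β_δ(−w))'' (w) = smoothTransition' (−w/δ) / δ`. [folklore] -/
private theorem deriv_deriv_negApprox (δ w : ℝ) :
    deriv (deriv fun w => ∫ r in (0 : ℝ)..(-w), Real.smoothTransition (r / δ)) w =
      deriv Real.smoothTransition (-w / δ) / δ := by
  rw [deriv_negApprox]
  have h1 : HasDerivAt Real.smoothTransition (deriv Real.smoothTransition (-w / δ)) (-w / δ) :=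
    (Calculus.differentiable_smoothTransition (-w / δ)).hasDerivAt
  have h2 := (h1.comp w ((hasDerivAt_neg w).div_const δ)).neg
  have h : HasDerivAt (fun w => -Real.smoothTransition (-w / δ))
      (-(deriv Real.smoothTransition (-w / δ) * (-1 / δ))) w := h2
  rw [h.deriv]
  ring

/-- `w ↦ β_δ(−w)` is `C²`. [folklore] -/
private theorem contDiff_negApprox (δ : ℝ) :
    ContDiff ℝ 2 fun w => ∫ r in (0 : ℝ)..(-w), Real.smoothTransition (r / δ) :=
  (contDiff_posApprox δ).comp contDiff_neg

end Approx

/-! ### The co-signed flux, its mirror, and the `L¹` norm of `ω_θ/r` are non-increasing -/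

section CoSigned

variable {T ν : ℝ} {u₀ : EuclideanSpace ℝ (Fin 3) → EuclideanSpace ℝ (Fin 3)}
  {v : ℝ → EuclideanSpace ℝ (Fin 3) → EuclideanSpace ℝ (Fin 3)} {q : ℝ → EuclideanSpace ℝ (Fin 3) → ℝ}

/-- **From approximants to the limit functional.** If `ψ` is the pointwise limit of a sequence
`βₙ` of admissible functions (`βₙ ∈ C²`, `βₙ(0) = βₙ'(0) = 0`, `0 ≤ βₙ'' ≤ Kₙ`) with `βₙ ≤ ψ`,
then along a Tao-class solution with axisymmetric swirl-free slices and `ν ≥ 0`,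
`∫⁻ ψ(Ω(t)) ≤ ∫⁻ ψ(Ω(s))` in `ℝ≥0∞` for `0 ≤ s ≤ t ≤ T` (monotonicity for each `βₙ`, then Fatou;
the passage from smooth convex functionals to `|·|`, `(·)⁺` in Gallay–Šverák's Lemma 5.1).
[cite: GallaySverak2016, §5 Lemma 5.1 (arXiv p. 16)] -/
theorem IsTaoSolutionOn.lintegral_comp_angVortQuot_le_of_approx (h : IsTaoSolutionOn T ν u₀ v q)
    (hT : 0 < T) (hν : 0 ≤ ν) (hax : ∀ t ∈ Icc 0 T, IsAxisymmetric (v t))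
    (hsw : ∀ t ∈ Icc 0 T, HasNoSwirl (v t)) {ψ : ℝ → ℝ} {βs : ℕ → ℝ → ℝ} {Ks : ℕ → ℝ}
    (hβ : ∀ n, ContDiff ℝ 2 (βs n)) (h00 : ∀ n, βs n 0 = 0) (h0 : ∀ n, deriv (βs n) 0 = 0)
    (hnn : ∀ n w, 0 ≤ deriv (deriv (βs n)) w) (hK : ∀ n w, deriv (deriv (βs n)) w ≤ Ks n)
    (hle : ∀ n w, βs n w ≤ ψ w) (hlim : ∀ w, Tendsto (fun n => βs n w) atTop (𝓝 (ψ w)))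
    {s t : ℝ} (hs : s ∈ Icc 0 T) (ht : t ∈ Icc 0 T) (hst : s ≤ t) :
    ∫⁻ x, ENNReal.ofReal (ψ (angVortQuot (v t) x)) ≤ ∫⁻ x, ENNReal.ofReal (ψ (angVortQuot (v s) x)) := by
  have hvs : ∀ τ ∈ Icc 0 T, ContDiff ℝ ∞ (v τ) := fun τ hτ => h.classical.contDiff_velocity hτ
  have hΩc : ∀ τ ∈ Icc 0 T, Continuous (angVortQuot (v τ)) := fun τ hτ =>
    (contDiff_angVortQuot (n := 0) (by exact_mod_cast (hvs τ hτ).of_le (by norm_cast))).continuous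
  have hβnn : ∀ n w, 0 ≤ βs n w := fun n => nonneg_of_deriv2_nonneg (hβ n) (h00 n) (h0 n) (hnn n)
  -- for each `n`: `∫⁻ βₙ(Ω t) ≤ ∫⁻ βₙ(Ω s) ≤ ∫⁻ ψ(Ω s)`
  have hstep : ∀ n, ∫⁻ x, ENNReal.ofReal (βs n (angVortQuot (v t) x)) ≤
      ∫⁻ x, ENNReal.ofReal (ψ (angVortQuot (v s) x)) := by
    intro n
    have hK' : ∀ w, |deriv (deriv (βs n)) w| ≤ Ks n := abs_deriv_deriv_le (hnn n) (hK n)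
    have hanti := h.antitoneOn_integral_comp_angVortQuot hT hν hax hsw (hβ n) (h00 n) (h0 n) (hnn n)
      (hK n) hs ht hst
    have hi : ∀ τ ∈ Icc 0 T, Integrable (fun x => βs n (angVortQuot (v τ) x)) := fun τ hτ => by
      obtain ⟨m0, -, -, -⟩ := h.memLp_angVortQuot_data hax hτ
      exact integrable_comp (hβ n) (h00 n) (h0 n) hK' (hΩc τ hτ) m0
    calc ∫⁻ x, ENNReal.ofReal (βs n (angVortQuot (v t) x))
        = ENNReal.ofReal (∫ x, βs n (angVortQuot (v t) x)) :=
          (ofReal_integral_eq_lintegral_ofReal (hi t ht) (ae_of_all _ fun x => hβnn n _)).symm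
      _ ≤ ENNReal.ofReal (∫ x, βs n (angVortQuot (v s) x)) := ENNReal.ofReal_le_ofReal hanti
      _ = ∫⁻ x, ENNReal.ofReal (βs n (angVortQuot (v s) x)) :=
          ofReal_integral_eq_lintegral_ofReal (hi s hs) (ae_of_all _ fun x => hβnn n _)
      _ ≤ ∫⁻ x, ENNReal.ofReal (ψ (angVortQuot (v s) x)) :=
          lintegral_mono fun x => ENNReal.ofReal_le_ofReal (hle n _)
  -- Fatou
  have hmeas : ∀ n, Measurable fun x => ENNReal.ofReal (βs n (angVortQuot (v t) x)) := fun n =>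
    (((hβ n).continuous.comp (hΩc t ht)).measurable).ennreal_ofReal
  have hlim' : ∀ x, Tendsto (fun n => ENNReal.ofReal (βs n (angVortQuot (v t) x))) atTop
      (𝓝 (ENNReal.ofReal (ψ (angVortQuot (v t) x)))) := fun x =>
    (ENNReal.continuous_ofReal.tendsto _).comp (hlim _)
  calc ∫⁻ x, ENNReal.ofReal (ψ (angVortQuot (v t) x))
      = ∫⁻ x, liminf (fun n => ENNReal.ofReal (βs n (angVortQuot (v t) x))) atTop :=
        lintegral_congr fun x => ((hlim' x).liminf_eq).symm
    _ ≤ liminf (fun n => ∫⁻ x, ENNReal.ofReal (βs n (angVortQuot (v t) x))) atTop :=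
        lintegral_liminf_le hmeas
    _ ≤ ∫⁻ x, ENNReal.ofReal (ψ (angVortQuot (v s) x)) :=
        liminf_le_of_frequently_le' (Eventually.of_forall hstep).frequently

/-- **The co-signed meridional flux is non-increasing** (signed refinement of Gallay–Šverák 2015,
Lemma 5.1, smooth class). For a Tao-class solution of the unforced Navier–Stokes system on
`[0, T] × ℝ³` with `ν ≥ 0`, axisymmetric without swirl at all times, and `0 ≤ s ≤ t ≤ T`:
`∫⁻ (Ω(t,x))⁺ dx ≤ ∫⁻ (Ω(s,x))⁺ dx` in `ℝ≥0∞`, `Ω = angVortQuot = ω_θ/r` — i.e. the co-signed flux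
`∫_{ℝ³} (ω_θ/r)₊ dx = 2π ∫_Ω (ω_θ)₊ dr dz` of azimuthal vorticity through the meridional
half-plane never increases: viscosity only removes such flux (through the axis and by
cancellation), it never creates it. (In the paper's proof this is the inequality
`∫ω_θ⁺(t) ≤ ∫ω_θ⁺(0)` for the super-solution `ω_θ⁺` of the split linear problem (5.2).)
[cite: GallaySverak2016, §5 Lemma 5.1 (arXiv p. 16)] -/
theorem IsTaoSolutionOn.lintegral_posPart_angVortQuot_le (h : IsTaoSolutionOn T ν u₀ v q)
    (hT : 0 < T) (hν : 0 ≤ ν) (hax : ∀ t ∈ Icc 0 T, IsAxisymmetric (v t))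
    (hsw : ∀ t ∈ Icc 0 T, HasNoSwirl (v t)) {s t : ℝ} (hs : s ∈ Icc 0 T) (ht : t ∈ Icc 0 T)
    (hst : s ≤ t) :
    ∫⁻ x, ENNReal.ofReal ((angVortQuot (v t) x)⁺) ≤ ∫⁻ x, ENNReal.ofReal ((angVortQuot (v s) x)⁺) := by
  obtain ⟨D, -, hD⟩ := Calculus.exists_bound_deriv_smoothTransition
  exact h.lintegral_comp_angVortQuot_le_of_approx hT hν hax hsw
    (βs := fun n w => ∫ r in (0 : ℝ)..w, Real.smoothTransition (r / ((1 : ℝ) / (n + 1))))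
    (Ks := fun n => D / ((1 : ℝ) / (n + 1)))
    (fun n => contDiff_posApprox _) (fun n => posApprox_zero _) (fun n => deriv_posApprox_zero _)
    (fun n w => deriv_deriv_posApprox_nonneg (by positivity) w)
    (fun n w => deriv_deriv_posApprox_le (by positivity) hD w)
    (fun n w => posApprox_le_posPart (by positivity) w) tendsto_posApprox hs ht hst

/-- **The mirror statement for the negative part**: `∫⁻ (Ω(t))⁻ ≤ ∫⁻ (Ω(s))⁻` for
`0 ≤ s ≤ t ≤ T` (approximants `w ↦ β_δ(−w)`). [cite: GallaySverak2016, §5 Lemma 5.1 (arXiv p. 16)] -/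
theorem IsTaoSolutionOn.lintegral_negPart_angVortQuot_le (h : IsTaoSolutionOn T ν u₀ v q)
    (hT : 0 < T) (hν : 0 ≤ ν) (hax : ∀ t ∈ Icc 0 T, IsAxisymmetric (v t))
    (hsw : ∀ t ∈ Icc 0 T, HasNoSwirl (v t)) {s t : ℝ} (hs : s ∈ Icc 0 T) (ht : t ∈ Icc 0 T)
    (hst : s ≤ t) :
    ∫⁻ x, ENNReal.ofReal ((angVortQuot (v t) x)⁻) ≤ ∫⁻ x, ENNReal.ofReal ((angVortQuot (v s) x)⁻) := by
  obtain ⟨D, -, hD⟩ := Calculus.exists_bound_deriv_smoothTransition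
  refine h.lintegral_comp_angVortQuot_le_of_approx hT hν hax hsw
    (βs := fun n w => ∫ r in (0 : ℝ)..(-w), Real.smoothTransition (r / ((1 : ℝ) / (n + 1))))
    (Ks := fun n => D / ((1 : ℝ) / (n + 1)))
    (fun n => contDiff_negApprox _) (fun n => by simp) (fun n => ?_) (fun n w => ?_) (fun n w => ?_)
    (fun n w => ?_) (fun w => ?_) hs ht hst
  · rw [deriv_negApprox]
    simp [Real.smoothTransition.zero_of_nonpos]
  · rw [deriv_deriv_negApprox]
    exact div_nonneg Real.smoothTransition.monotone.deriv_nonneg (by positivity)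
  · rw [deriv_deriv_negApprox]
    exact div_le_div_of_nonneg_right ((le_abs_self _).trans (hD _)) (by positivity)
  · rw [← posPart_neg]
    exact posApprox_le_posPart (by positivity) (-w)
  · rw [← posPart_neg]
    exact tendsto_posApprox (-w)

/-- **Gallay–Šverák 2015, Lemma 5.1 (first half), smooth class**: the `L¹(Ω, dr dz)` norm of
`ω_θ` — equivalently `‖ω_θ/r‖_{L¹(ℝ³)} = 2π‖ω_θ‖_{L¹(Ω)}` — is non-increasing. For a Tao-class
solution of the unforced Navier–Stokes system on `[0, T] × ℝ³` with `ν ≥ 0`, axisymmetric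
without swirl at all times, and `0 ≤ s ≤ t ≤ T`:
`∫⁻ |Ω(t,x)| dx ≤ ∫⁻ |Ω(s,x)| dx` in `ℝ≥0∞`, `Ω = angVortQuot = ω_θ/r` (no integrability
hypothesis: if `Ω(s) ∈ L¹` then `Ω(t) ∈ L¹` with smaller norm). Sum of the positive- and
negative-part statements. [cite: GallaySverak2016, §5 Lemma 5.1 (arXiv p. 16)] -/
theorem IsTaoSolutionOn.lintegral_abs_angVortQuot_le (h : IsTaoSolutionOn T ν u₀ v q)
    (hT : 0 < T) (hν : 0 ≤ ν) (hax : ∀ t ∈ Icc 0 T, IsAxisymmetric (v t))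
    (hsw : ∀ t ∈ Icc 0 T, HasNoSwirl (v t)) {s t : ℝ} (hs : s ∈ Icc 0 T) (ht : t ∈ Icc 0 T)
    (hst : s ≤ t) :
    ∫⁻ x, ‖angVortQuot (v t) x‖ₑ ≤ ∫⁻ x, ‖angVortQuot (v s) x‖ₑ := by
  have hvs : ∀ τ ∈ Icc 0 T, ContDiff ℝ ∞ (v τ) := fun τ hτ => h.classical.contDiff_velocity hτ
  have hΩm : ∀ τ ∈ Icc 0 T, Measurable (angVortQuot (v τ)) := fun τ hτ =>
    (contDiff_angVortQuot (n := 0) (by exact_mod_cast (hvs τ hτ).of_le (by norm_cast))).continuous.measurable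
  have hsplit : ∀ τ ∈ Icc 0 T, ∫⁻ x, ‖angVortQuot (v τ) x‖ₑ =
      (∫⁻ x, ENNReal.ofReal ((angVortQuot (v τ) x)⁺)) + ∫⁻ x, ENNReal.ofReal ((angVortQuot (v τ) x)⁻) := by
    intro τ hτ
    rw [← lintegral_add_left ((hΩm τ hτ).posPart.ennreal_ofReal)]
    refine lintegral_congr fun x => ?_
    rw [← ENNReal.ofReal_add (posPart_nonneg _) (negPart_nonneg _), posPart_add_negPart,
      Real.enorm_eq_ofReal_abs]
  rw [hsplit t ht, hsplit s hs]
  exact add_le_add (h.lintegral_posPart_angVortQuot_le hT hν hax hsw hs ht hst)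
    (h.lintegral_negPart_angVortQuot_le hT hν hax hsw hs ht hst)

end CoSigned

/-! ### With swirl: the co-signed meridional flux is raised only by the positive part of the
swirl source `−2 (u^θ/r)(ωʳ/r)` -/

section Swirl

variable {X : Type*} [MeasurableSpace X] {μ : Measure X} [SFinite μ]

/-- **Balance with a majorant.** Under the hypotheses of `integral_comp_eq_add_of_ae_hasDerivAt`,
if `∫ Φ'(g(τ)) g'(τ) dμ ≤ m(τ)` for `τ ∈ (0, T)` with `m` integrable on `(0, T)`, then
`∫ Φ(g(t)) dμ ≤ ∫ Φ(g(s)) dμ + ∫_{τ ∈ s..t} m(τ)` for `0 ≤ s ≤ t ≤ T` (the sourced form of the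
time integration in Gallay–Šverák's proof of Lemma 5.1).
[cite: GallaySverak2016, §5 Lemma 5.1 proof (arXiv p. 16)] -/
theorem integral_comp_le_add_intervalIntegral_of_ae_hasDerivAt {T : ℝ} {g g' : ℝ → X → ℝ}
    {Φ : ℝ → ℝ} (hΦ : ContDiff ℝ 1 Φ)
    (hline : ∀ᵐ x ∂μ, ContinuousOn (fun t => g t x) (Icc 0 T) ∧
      ContinuousOn (fun t => g' t x) (Icc 0 T) ∧ ∀ t ∈ Ioo 0 T, HasDerivAt (fun t => g t x) (g' t x) t)
    (hmeas : AEStronglyMeasurable (uncurry fun t x => deriv Φ (g t x) * g' t x)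
      ((volume.restrict (Ioo 0 T)).prod μ))
    {K : ℝ≥0∞} (hK : K ≠ ⊤) (hbound : ∀ t ∈ Ioo 0 T, ∫⁻ x, ‖deriv Φ (g t x) * g' t x‖ₑ ∂μ ≤ K)
    (hint : ∀ t ∈ Icc 0 T, Integrable (fun x => Φ (g t x)) μ)
    {m : ℝ → ℝ} (hm : IntegrableOn m (Ioo 0 T))
    (hle : ∀ t ∈ Ioo 0 T, ∫ x, deriv Φ (g t x) * g' t x ∂μ ≤ m t)
    {s t : ℝ} (hs : s ∈ Icc 0 T) (ht : t ∈ Icc 0 T) (hst : s ≤ t) :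
    ∫ x, Φ (g t x) ∂μ ≤ (∫ x, Φ (g s x) ∂μ) + ∫ τ in s..t, m τ := by
  rcases hst.eq_or_lt with rfl | hst'
  · simp
  have hT : 0 < T := (hs.1.trans_lt hst').trans_le ht.2
  set F : ℝ → ℝ := fun τ => ∫ x, deriv Φ (g τ x) * g' τ x ∂μ with hFdef
  have hF : IntegrableOn F (Ioo 0 T) := integrableOn_integral_deriv_comp_mul hmeas hK hbound
  -- `∫ Φ(g b) = ∫ Φ(g 0) + ∫ in 0..b, F` for `b ∈ [0, T]`
  have hId : ∀ b ∈ Icc 0 T, ∫ x, Φ (g b x) ∂μ = (∫ x, Φ (g 0 x) ∂μ) + ∫ τ in (0 : ℝ)..b, F τ := by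
    intro b hb
    rcases hb.1.eq_or_lt with rfl | hb0
    · simp
    · rw [integral_comp_eq_add_of_ae_hasDerivAt hΦ hline hmeas hK hbound hint ⟨hb0, hb.2⟩,
        intervalIntegral.integral_of_le hb.1, integral_Ioc_eq_integral_Ioo]
  -- interval integrability of `F` and `m` on subintervals of `[0, T]`
  have hFi : ∀ a b : ℝ, 0 ≤ a → a ≤ b → b ≤ T → IntervalIntegrable F volume a b := by
    intro a b ha hab hb
    rw [intervalIntegrable_iff_integrableOn_Ioo_of_le hab]
    exact hF.mono_set (Ioo_subset_Ioo ha hb)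
  have hmi : IntervalIntegrable m volume s t := by
    rw [intervalIntegrable_iff_integrableOn_Ioo_of_le hst]
    exact hm.mono_set (Ioo_subset_Ioo hs.1 ht.2)
  have hsub : (∫ τ in (0 : ℝ)..t, F τ) - ∫ τ in (0 : ℝ)..s, F τ = ∫ τ in s..t, F τ :=
    intervalIntegral.integral_interval_sub_left (hFi 0 t le_rfl ht.1 ht.2) (hFi 0 s le_rfl hs.1 hs.2)
  have hmono : ∫ τ in s..t, F τ ≤ ∫ τ in s..t, m τ :=
    intervalIntegral.integral_mono_on_of_le_Ioo hst (hFi s t hs.1 hst ht.2) hmi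
      fun τ hτ => hle τ ⟨hs.1.trans_lt hτ.1, hτ.2.trans_le ht.2⟩
  rw [hId t ht, hId s hs]
  linarith

variable {T ν : ℝ} {u₀ : EuclideanSpace ℝ (Fin 3) → EuclideanSpace ℝ (Fin 3)}
  {v : ℝ → EuclideanSpace ℝ (Fin 3) → EuclideanSpace ℝ (Fin 3)} {q : ℝ → EuclideanSpace ℝ (Fin 3) → ℝ}
  {β : ℝ → ℝ} {K : ℝ}

/-- `L²`/`L^∞`/continuity data of the swirl source `Φ J = (u^θ/r)(ωʳ/r)` at a time of a Tao-class
solution with axisymmetric slices: `Φ(t)` is continuous, bounded and in `L²`, `J(t)` is continuous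
and in `L²`, hence `Φ J ∈ L¹ ∩ L²`. [folklore] -/
private theorem IsTaoSolutionOn.swirlSource_data (h : IsTaoSolutionOn T ν u₀ v q)
    (hax : ∀ t ∈ Icc 0 T, IsAxisymmetric (v t)) {t : ℝ} (ht : t ∈ Icc 0 T) :
    Continuous (angVelQuot (v t)) ∧ Continuous (radVelQuot (curl (v t))) ∧
    MemLp (angVelQuot (v t)) 2 volume ∧ MemLp (radVelQuot (curl (v t))) 2 volume ∧
    MemLp (fun x => angVelQuot (v t) x * radVelQuot (curl (v t)) x) 2 volume ∧
    Integrable (fun x => angVelQuot (v t) x * radVelQuot (curl (v t)) x) := by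
  have hvs : ∀ s ∈ Icc 0 T, ContDiff ℝ ∞ (v s) := fun s hs => h.classical.contDiff_velocity hs
  have hΦc : ContDiff ℝ ∞ (angVelQuot (v t)) := contDiff_angVelQuot_of_contDiff (hvs t ht)
  have hJc : ContDiff ℝ ∞ (radVelQuot (curl (v t))) :=
    contDiff_radVelQuot_of_contDiff (contDiff_curl (n := (⊤ : ℕ∞)) (by simpa using hvs t ht))
  obtain ⟨C0, hC0⟩ := exists_lintegral_sq_iteratedFDeriv_angVelQuot_le hvs hax h.sobolev 0
  have mΦ : MemLp (angVelQuot (v t)) 2 volume :=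
    memLp_two_of_norm_le_coe (F := fun x => iteratedFDeriv ℝ 0 (angVelQuot (v t)) x) hΦc.continuous
      (fun x => by rw [norm_iteratedFDeriv_zero]) (hC0 t ht)
  obtain ⟨mJ, -, -, -⟩ := h.memLp_radVelQuot_curl_data hax ht
  obtain ⟨B, -, hB⟩ := exists_forall_norm_iteratedFDeriv_angVelQuot_le hvs hax h.sobolev 0
  have hBt : ∀ x, ‖angVelQuot (v t) x‖ ≤ B := fun x => by
    rw [← norm_iteratedFDeriv_zero (𝕜 := ℝ) (f := angVelQuot (v t))]; exact hB t ht x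
  have mΦJ : MemLp (fun x => angVelQuot (v t) x * radVelQuot (curl (v t)) x) 2 volume := by
    refine MemLp.of_le_mul (c := B) mJ (hΦc.continuous.mul hJc.continuous).aestronglyMeasurable
      (Eventually.of_forall fun x => ?_)
    rw [norm_mul]
    exact mul_le_mul_of_nonneg_right (hBt x) (norm_nonneg _)
  exact ⟨hΦc.continuous, hJc.continuous, mΦ, mJ, mΦJ, mΦ.integrable_mul mJ⟩

/-- **The slice inequality with swirl.** For a Tao-class solution on `[0, T]` with `ν ≥ 0` and
axisymmetric slices (swirl allowed), `β ∈ C²` with `β(0) = β'(0) = 0`, `0 ≤ β'' ≤ K`, and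
`t ∈ [0, T]`: `∫ β'(Ω(t)) Ω'(t) dx ≤ ∫ β'(Ω(t)) · (−2 Φ(t) J(t)) dx`, where `Ω = ω^θ/r`,
`Φ = angVelQuot = u^θ/r`, `J = radVelQuot (curl u) = ωʳ/r` (Lei–Zhang 2017 (1.4)₂; the swirl
source `−2(u^θ/r)(ωʳ/r) = r⁻²∂_z (u^θ)²` of the `ω_θ/r`-equation, Gallay–Šverák (2.9)).
[cite: GallaySverak2016, §2 (2.9) and §5 Lemma 5.1 proof (arXiv pp. 5, 16)] -/
theorem IsTaoSolutionOn.integral_deriv_comp_mul_angVortQuot_le_swirlSource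
    (h : IsTaoSolutionOn T ν u₀ v q) (hT : 0 < T) (hν : 0 ≤ ν)
    (hax : ∀ t ∈ Icc 0 T, IsAxisymmetric (v t))
    (hβ : ContDiff ℝ 2 β) (h00 : β 0 = 0) (h0 : deriv β 0 = 0)
    (hnn : ∀ w, 0 ≤ deriv (deriv β) w) (hK : ∀ w, deriv (deriv β) w ≤ K) {t : ℝ} (ht : t ∈ Icc 0 T) :
    ∫ x, deriv β (angVortQuot (v t) x) * angVortQuot (timeDerivWithin (Icc 0 T) v t) x ≤
      ∫ x, deriv β (angVortQuot (v t) x) *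
        (-2 * (angVelQuot (v t) x * radVelQuot (curl (v t)) x)) := by
  have hU : UniqueDiffOn ℝ (Icc 0 T) := uniqueDiffOn_Icc hT
  have hcl := Icc_subset_closure_interior_Icc' hT
  have hK' : ∀ w, |deriv (deriv β) w| ≤ K := abs_deriv_deriv_le hnn hK
  have hvs : ContDiff ℝ ∞ (v t) := h.classical.contDiff_velocity ht
  have hv1 : ContDiff ℝ 1 (v t) := hvs.of_le (by norm_cast)
  have hv3 : ContDiff ℝ 3 (v t) := hvs.of_le (by norm_cast)
  have hΩ2 : ContDiff ℝ 2 (angVortQuot (v t)) :=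
    contDiff_angVortQuot (n := 2) (by exact_mod_cast hvs.of_le (by norm_cast))
  have hΩax : IsAxisymmetricScalar (angVortQuot (v t)) := (hax t ht).isAxisymmetricScalar_angVortQuot hv3
  obtain ⟨m0, m1, m2, mq⟩ := h.memLp_angVortQuot_data hax ht
  obtain ⟨B, -, hB⟩ := exists_bound_velocity h
  obtain ⟨B', -, hB'⟩ := h.exists_bound_fderiv_velocity
  obtain ⟨-, -, -, -, mΦJ, -⟩ := h.swirlSource_data hax ht
  have heq : ∀ x, angVortQuot (timeDerivWithin (Icc 0 T) v t) x +
      fderiv ℝ (angVortQuot (v t)) x (v t x) =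
      ν * ((Δ (angVortQuot (v t))) x + 2 * radDerivQuot (angVortQuot (v t)) x) +
        (-2 * (angVelQuot (v t) x * radVelQuot (curl (v t)) x)) := fun x => by
    rw [h.classical.angVortQuot_eq hU hcl hax ht x]
    ring
  have hβ'L2 : MemLp (fun x => deriv β (angVortQuot (v t) x)) 2 volume :=
    memLp_deriv_comp hβ h0 hK' hΩ2.continuous m0
  have hR : Integrable (fun x => deriv β (angVortQuot (v t) x) *
      (-2 * (angVelQuot (v t) x * radVelQuot (curl (v t)) x))) := by
    have := (hβ'L2.integrable_mul mΦJ).const_mul (-2)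
    refine this.congr (Eventually.of_forall fun x => ?_)
    simp only [Pi.mul_apply]
    ring
  exact integral_deriv_comp_mul_le_of_drift_laplacian hβ h00 h0 hnn hK' hΩ2 hΩax hν m0 m1 m2 mq hR
    hv1 (h.classical.divFree t ht) (hB t ht) (hB' t ht) heq

/-- **The time function `τ ↦ ∫ (−2ΦJ)⁺ dx` (and its mirror, and `∫ |2ΦJ|`) is integrable on
`(0, T)`** along a Tao-class solution with axisymmetric slices (joint continuity of the quotient
families `Φ = angVelQuot`, `J = radVelQuot ∘ curl`; uniform `L²` bounds; Fubini). [folklore] -/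
private theorem IsTaoSolutionOn.integrableOn_integral_swirlSource (h : IsTaoSolutionOn T ν u₀ v q)
    (hT : 0 < T) (hax : ∀ t ∈ Icc 0 T, IsAxisymmetric (v t)) {ψ : ℝ → ℝ} (hψ : Continuous ψ)
    (hψle : ∀ w, |ψ w| ≤ |w|) :
    IntegrableOn (fun τ => ∫ x, ψ (-2 * (angVelQuot (v τ) x * radVelQuot (curl (v τ)) x)))
      (Ioo 0 T) := by
  have hU : UniqueDiffOn ℝ (Icc 0 T) := uniqueDiffOn_Icc hT
  have hsm : IsSmoothSpaceTimeOn (Icc 0 T) v := h.classical.smooth_velocity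
  have hvs : ∀ s ∈ Icc 0 T, ContDiff ℝ ∞ (v s) := fun s hs => h.classical.contDiff_velocity hs
  -- joint continuity
  have hΦf : IsSmoothSpaceTimeOn (Icc 0 T) (fun τ => angVelQuot (v τ)) :=
    hsm.angVelQuot_family (convex_Icc 0 T) hU
  have hJf : IsSmoothSpaceTimeOn (Icc 0 T) (fun τ => radVelQuot (vorticity v τ)) :=
    (hsm.isSmoothSpaceTimeOn_vorticity hU).radVelQuot_family (convex_Icc 0 T) hU
  have hcont : ContinuousOn (uncurry fun τ x =>
      ψ (-2 * (angVelQuot (v τ) x * radVelQuot (curl (v τ)) x))) (Icc 0 T ×ˢ univ) :=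
    hψ.comp_continuousOn ((continuousOn_const.mul (hΦf.continuousOn.mul hJf.continuousOn)))
  have hmeas : AEStronglyMeasurable (uncurry fun τ x =>
      ψ (-2 * (angVelQuot (v τ) x * radVelQuot (curl (v τ)) x)))
      ((volume.restrict (Ioo 0 T)).prod volume) :=
    aestronglyMeasurable_prod_of_continuousOn_off_axis
      (hcont.mono (prod_mono Ioo_subset_Icc_self (subset_univ _)))
  -- uniform `L¹` bound
  obtain ⟨CΦ, hCΦ⟩ := exists_lintegral_sq_iteratedFDeriv_angVelQuot_le hvs hax h.sobolev 0
  obtain ⟨C, hC⟩ := h.exists_lintegral_sq_quot_le hT hax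
  have hbound : ∀ τ ∈ Ioo 0 T, ∫⁻ x, ‖ψ (-2 * (angVelQuot (v τ) x * radVelQuot (curl (v τ)) x))‖ₑ ≤
      2 * ((CΦ : ℝ≥0∞) + C) := by
    intro τ hτ
    have hτI : τ ∈ Icc 0 T := Ioo_subset_Icc_self hτ
    obtain ⟨-, -, hJC, -⟩ := hC τ hτI
    have hΦC : ∫⁻ x, ‖angVelQuot (v τ) x‖ₑ ^ 2 ≤ CΦ := by
      have e : ∫⁻ x, ‖angVelQuot (v τ) x‖ₑ ^ 2 = ∫⁻ x, ‖iteratedFDeriv ℝ 0 (angVelQuot (v τ)) x‖ₑ ^ 2 :=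
        lintegral_congr fun x => by rw [← ofReal_norm, ← ofReal_norm, norm_iteratedFDeriv_zero]
      rw [e]; exact hCΦ τ hτI
    have hΦm : Measurable fun x => ‖angVelQuot (v τ) x‖ₑ ^ 2 :=
      (contDiff_angVelQuot_of_contDiff (hvs τ hτI)).continuous.measurable.enorm.pow_const 2
    calc ∫⁻ x, ‖ψ (-2 * (angVelQuot (v τ) x * radVelQuot (curl (v τ)) x))‖ₑ
        ≤ ∫⁻ x, 2 * (‖angVelQuot (v τ) x‖ₑ ^ 2 + ‖radVelQuot (curl (v τ)) x‖ₑ ^ 2) := by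
          refine lintegral_mono fun x => ?_
          have h1 : ‖ψ (-2 * (angVelQuot (v τ) x * radVelQuot (curl (v τ)) x))‖ₑ ≤
              ‖-2 * (angVelQuot (v τ) x * radVelQuot (curl (v τ)) x)‖ₑ := by
            rw [Real.enorm_eq_ofReal_abs, Real.enorm_eq_ofReal_abs]
            exact ENNReal.ofReal_le_ofReal (hψle _)
          refine h1.trans ?_
          rw [enorm_mul, enorm_mul, show ‖(-2 : ℝ)‖ₑ = 2 by
            rw [Real.enorm_eq_ofReal_abs]; norm_num]
          gcongr
          exact ennreal_mul_le_sq_add_sq _ _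
      _ = 2 * ((∫⁻ x, ‖angVelQuot (v τ) x‖ₑ ^ 2) + ∫⁻ x, ‖radVelQuot (curl (v τ)) x‖ₑ ^ 2) := by
          rw [lintegral_const_mul' _ _ (by norm_num), lintegral_add_left hΦm]
      _ ≤ 2 * ((CΦ : ℝ≥0∞) + C) := by gcongr
  have hI : Integrable (uncurry fun τ x =>
      ψ (-2 * (angVelQuot (v τ) x * radVelQuot (curl (v τ)) x)))
      ((volume.restrict (Ioo 0 T)).prod volume) := by
    refine ⟨hmeas, ?_⟩
    have hle := lintegral_prod_le (μ := volume.restrict (Ioo 0 T)) (ν := volume)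
      (fun z : ℝ × EuclideanSpace ℝ (Fin 3) => ‖uncurry (fun τ x =>
        ψ (-2 * (angVelQuot (v τ) x * radVelQuot (curl (v τ)) x))) z‖ₑ)
    refine lt_of_le_of_lt hle ?_
    calc ∫⁻ τ in Ioo 0 T, ∫⁻ x, ‖uncurry (fun τ x =>
          ψ (-2 * (angVelQuot (v τ) x * radVelQuot (curl (v τ)) x))) (τ, x)‖ₑ
        ≤ ∫⁻ _ in Ioo 0 T, 2 * ((CΦ : ℝ≥0∞) + C) :=
          setLIntegral_mono' measurableSet_Ioo fun τ hτ => hbound τ hτ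
      _ < ⊤ := by
          rw [setLIntegral_const]
          exact ENNReal.mul_lt_top (ENNReal.mul_lt_top (by simp) (by simp)) (by simp)
  exact hI.integral_prod_left

/-- **From approximants to the limit functional, with the swirl source.** If `ψ` is the pointwise
limit of admissible `βₙ` with `βₙ ≤ ψ` and `βₙ'(w) r ≤ σ(r)` for all `w, r` (`σ` continuous,
`|σ(r)| ≤ |r|`; e.g. `σ = (·)⁺` when `0 ≤ βₙ' ≤ 1`), then along a Tao-class solution with
axisymmetric slices (swirl allowed) and `ν ≥ 0`, for `0 ≤ s ≤ t ≤ T`: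
`∫⁻ ψ(Ω(t)) ≤ ∫⁻ ψ(Ω(s)) + ofReal (∫ₛᵗ ∫ σ(−2ΦJ) dx dτ)`.
[cite: GallaySverak2016, §5 Lemma 5.1 proof (arXiv p. 16)] -/
theorem IsTaoSolutionOn.lintegral_comp_angVortQuot_le_of_approx_swirlSource
    (h : IsTaoSolutionOn T ν u₀ v q) (hT : 0 < T) (hν : 0 ≤ ν)
    (hax : ∀ t ∈ Icc 0 T, IsAxisymmetric (v t)) {ψ σ : ℝ → ℝ} {βs : ℕ → ℝ → ℝ} {Ks : ℕ → ℝ}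
    (hβ : ∀ n, ContDiff ℝ 2 (βs n)) (h00 : ∀ n, βs n 0 = 0) (h0 : ∀ n, deriv (βs n) 0 = 0)
    (hnn : ∀ n w, 0 ≤ deriv (deriv (βs n)) w) (hK : ∀ n w, deriv (deriv (βs n)) w ≤ Ks n)
    (hle : ∀ n w, βs n w ≤ ψ w) (hlim : ∀ w, Tendsto (fun n => βs n w) atTop (𝓝 (ψ w)))
    (hσ : Continuous σ) (hσle : ∀ r, |σ r| ≤ |r|) (hβσ : ∀ n w r, deriv (βs n) w * r ≤ σ r)
    {s t : ℝ} (hs : s ∈ Icc 0 T) (ht : t ∈ Icc 0 T) (hst : s ≤ t) :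
    ∫⁻ x, ENNReal.ofReal (ψ (angVortQuot (v t) x)) ≤
      (∫⁻ x, ENNReal.ofReal (ψ (angVortQuot (v s) x))) +
        ENNReal.ofReal (∫ τ in s..t, ∫ x, σ (-2 * (angVelQuot (v τ) x * radVelQuot (curl (v τ)) x))) := by
  have hU : UniqueDiffOn ℝ (Icc 0 T) := uniqueDiffOn_Icc hT
  have hcl := Icc_subset_closure_interior_Icc' hT
  have hsm : IsSmoothSpaceTimeOn (Icc 0 T) v := h.classical.smooth_velocity
  have hvs : ∀ τ ∈ Icc 0 T, ContDiff ℝ ∞ (v τ) := fun τ hτ => h.classical.contDiff_velocity hτ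
  have hΩc : ∀ τ ∈ Icc 0 T, Continuous (angVortQuot (v τ)) := fun τ hτ =>
    (contDiff_angVortQuot (n := 0) (by exact_mod_cast (hvs τ hτ).of_le (by norm_cast))).continuous
  have hβnn : ∀ n w, 0 ≤ βs n w := fun n => nonneg_of_deriv2_nonneg (hβ n) (h00 n) (h0 n) (hnn n)
  -- the majorant `m(τ) = ∫ σ(−2ΦJ)` and the constant `M = ∫ₛᵗ m`
  set m : ℝ → ℝ := fun τ => ∫ x, σ (-2 * (angVelQuot (v τ) x * radVelQuot (curl (v τ)) x)) with hm
  have hmI : IntegrableOn m (Ioo 0 T) := h.integrableOn_integral_swirlSource hT hax hσ hσle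
  -- the jointly smooth family `Ω` and its time derivative (as in the swirl-free case)
  have hΩ : IsSmoothSpaceTimeOn (Icc 0 T) (fun t => angVortQuot (v t)) :=
    hsm.angVortQuot_family (convex_Icc 0 T) hU
  have hΩ' : IsSmoothSpaceTimeOn (Icc 0 T) (timeDerivWithin (Icc 0 T) fun t => angVortQuot (v t)) :=
    hΩ.timeDerivWithin hU
  have hdt : ∀ t ∈ Icc 0 T, ∀ x, timeDerivWithin (Icc 0 T) (fun s => angVortQuot (v s)) t x =
      angVortQuot (timeDerivWithin (Icc 0 T) v t) x := fun t ht x =>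
    hsm.timeDerivWithin_angVortQuot (convex_Icc 0 T) hU hcl hax ht x
  have tl : ∀ {w : ℝ → EuclideanSpace ℝ (Fin 3) → ℝ},
      ContinuousOn (uncurry w) (Icc 0 T ×ˢ univ) → ∀ x, ContinuousOn (fun s => w s x) (Icc 0 T) := by
    intro w hw x
    exact hw.comp (continuous_id.prodMk continuous_const).continuousOn
      fun s hs => mk_mem_prod hs (mem_univ x)
  obtain ⟨C, hC⟩ := h.exists_lintegral_sq_quot_le hT hax
  -- for each `n`: the sourced balance `∫ βₙ(Ω t) ≤ ∫ βₙ(Ω s) + ∫ₛᵗ m`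
  have hstep : ∀ n, ∫⁻ x, ENNReal.ofReal (βs n (angVortQuot (v t) x)) ≤
      (∫⁻ x, ENNReal.ofReal (ψ (angVortQuot (v s) x))) + ENNReal.ofReal (∫ τ in s..t, m τ) := by
    intro n
    have hK' : ∀ w, |deriv (deriv (βs n)) w| ≤ Ks n := abs_deriv_deriv_le (hnn n) (hK n)
    have hK0 : 0 ≤ Ks n := (hnn n 0).trans (hK n 0)
    obtain ⟨hd, hd'⟩ := differentiable_deriv_of_contDiff_two (hβ n)
    have hβ1 : ContDiff ℝ 1 (βs n) := (hβ n).of_le (by norm_num)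
    have hi : ∀ τ ∈ Icc 0 T, Integrable (fun x => βs n (angVortQuot (v τ) x)) := fun τ hτ => by
      obtain ⟨m0, -, -, -⟩ := h.memLp_angVortQuot_data hax hτ
      exact integrable_comp (hβ n) (h00 n) (h0 n) hK' (hΩc τ hτ) m0
    -- the real-valued sourced balance
    have hreal : ∫ x, βs n (angVortQuot (v t) x) ≤ (∫ x, βs n (angVortQuot (v s) x)) + ∫ τ in s..t, m τ := by
      refine integral_comp_le_add_intervalIntegral_of_ae_hasDerivAt (μ := volume) (T := T)
        (g := fun t x => angVortQuot (v t) x)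
        (g' := fun t x => angVortQuot (timeDerivWithin (Icc 0 T) v t) x) hβ1
        (ae_of_all _ fun x => ⟨tl hΩ.continuousOn x, (tl hΩ'.continuousOn x).congr fun s hs =>
          (hdt s hs x).symm, fun t ht => ?_⟩) ?_ (K := ENNReal.ofReal (Ks n) * ((C : ℝ≥0∞) + C))
        (ENNReal.mul_ne_top ENNReal.ofReal_ne_top (by simp)) ?_ hi hmI ?_ hs ht hst
      · have htI : t ∈ Icc 0 T := Ioo_subset_Icc_self ht
        have h1 : HasDerivWithinAt (fun s => angVortQuot (v s) x)
            (timeDerivWithin (Icc 0 T) (fun s => angVortQuot (v s)) t x) (Icc 0 T) t := by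
          rw [timeDerivWithin_apply]
          exact (hΩ.differentiableWithinAt_time htI x).hasDerivWithinAt
        rw [hdt t htI x] at h1
        exact h1.hasDerivAt (Icc_mem_nhds ht.1 ht.2)
      · refine aestronglyMeasurable_prod_of_continuousOn_off_axis
          (F := uncurry fun t x => deriv (βs n) (angVortQuot (v t) x) *
            angVortQuot (timeDerivWithin (Icc 0 T) v t) x) ?_
        have hsub : Ioo 0 T ×ˢ {x : EuclideanSpace ℝ (Fin 3) | cylRadius x ≠ 0} ⊆ Icc 0 T ×ˢ univ :=
          prod_mono Ioo_subset_Icc_self (subset_univ _)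
        have c1 : ContinuousOn (fun p : ℝ × EuclideanSpace ℝ (Fin 3) => deriv (βs n) (uncurry (fun t x =>
            angVortQuot (v t) x) p)) (Icc 0 T ×ˢ univ) := hd'.continuous.comp_continuousOn hΩ.continuousOn
        have c2 : ContinuousOn (uncurry (timeDerivWithin (Icc 0 T) fun t => angVortQuot (v t)))
            (Icc 0 T ×ˢ univ) := hΩ'.continuousOn
        refine ((c1.mul c2).mono hsub).congr fun p hp => ?_
        obtain ⟨τ, x⟩ := p
        have hτI : τ ∈ Icc 0 T := Ioo_subset_Icc_self hp.1
        simp only [Pi.mul_apply, uncurry_apply_pair]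
        rw [hdt τ hτI x]
      · intro τ hτ
        have hτI : τ ∈ Icc 0 T := Ioo_subset_Icc_self hτ
        obtain ⟨hΩC, hΩ'C, -, -⟩ := hC τ hτI
        calc ∫⁻ x, ‖deriv (βs n) (angVortQuot (v τ) x) * angVortQuot (timeDerivWithin (Icc 0 T) v τ) x‖ₑ
            ≤ ∫⁻ x, ENNReal.ofReal (Ks n) * (‖angVortQuot (v τ) x‖ₑ ^ 2 +
                ‖angVortQuot (timeDerivWithin (Icc 0 T) v τ) x‖ₑ ^ 2) := by
              refine lintegral_mono fun x => ?_
              rw [enorm_mul]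
              calc ‖deriv (βs n) (angVortQuot (v τ) x)‖ₑ * ‖angVortQuot (timeDerivWithin (Icc 0 T) v τ) x‖ₑ
                  ≤ (ENNReal.ofReal (Ks n) * ‖angVortQuot (v τ) x‖ₑ) *
                      ‖angVortQuot (timeDerivWithin (Icc 0 T) v τ) x‖ₑ := by
                    gcongr
                    have hb := abs_deriv_le_mul_abs (hβ n) (h0 n) hK' (angVortQuot (v τ) x)
                    rw [← Real.enorm_eq_ofReal hK0, ← enorm_mul, Real.enorm_eq_ofReal_abs,
                      Real.enorm_eq_ofReal_abs, abs_mul, abs_of_nonneg hK0]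
                    exact ENNReal.ofReal_le_ofReal hb
                _ = ENNReal.ofReal (Ks n) * (‖angVortQuot (v τ) x‖ₑ *
                      ‖angVortQuot (timeDerivWithin (Icc 0 T) v τ) x‖ₑ) := mul_assoc _ _ _
                _ ≤ ENNReal.ofReal (Ks n) * (‖angVortQuot (v τ) x‖ₑ ^ 2 +
                      ‖angVortQuot (timeDerivWithin (Icc 0 T) v τ) x‖ₑ ^ 2) := by
                    gcongr
                    exact ennreal_mul_le_sq_add_sq _ _
          _ = ENNReal.ofReal (Ks n) * ((∫⁻ x, ‖angVortQuot (v τ) x‖ₑ ^ 2) +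
                ∫⁻ x, ‖angVortQuot (timeDerivWithin (Icc 0 T) v τ) x‖ₑ ^ 2) := by
              have hmΩ : Measurable fun x => ‖angVortQuot (v τ) x‖ₑ ^ 2 :=
                (hΩc τ hτI).measurable.enorm.pow_const 2
              rw [lintegral_const_mul' _ _ ENNReal.ofReal_ne_top, lintegral_add_left hmΩ]
          _ ≤ ENNReal.ofReal (Ks n) * ((C : ℝ≥0∞) + C) := by gcongr
      · -- the slice inequality with swirl, then `βₙ'(Ω) R ≤ σ(R)`
        intro τ hτ
        have hτI : τ ∈ Icc 0 T := Ioo_subset_Icc_self hτ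
        refine (h.integral_deriv_comp_mul_angVortQuot_le_swirlSource hT hν hax (hβ n) (h00 n) (h0 n)
          (hnn n) (hK n) hτI).trans ?_
        obtain ⟨hΦc, hJc, -, -, mΦJ, iΦJ⟩ := h.swirlSource_data hax hτI
        have hβ'L2 : MemLp (fun x => deriv (βs n) (angVortQuot (v τ) x)) 2 volume :=
          memLp_deriv_comp (hβ n) (h0 n) hK' (hΩc τ hτI) (h.memLp_angVortQuot_data hax hτI).1
        have i1 : Integrable (fun x => deriv (βs n) (angVortQuot (v τ) x) *
            (-2 * (angVelQuot (v τ) x * radVelQuot (curl (v τ)) x))) := by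
          have := (hβ'L2.integrable_mul mΦJ).const_mul (-2)
          refine this.congr (Eventually.of_forall fun x => ?_)
          simp only [Pi.mul_apply]
          ring
        have i2 : Integrable (fun x => σ (-2 * (angVelQuot (v τ) x * radVelQuot (curl (v τ)) x))) := by
          refine ((iΦJ.const_mul (-2)).abs).mono' (hσ.comp (continuous_const.mul
            (hΦc.mul hJc))).aestronglyMeasurable (Eventually.of_forall fun x => ?_)
          rw [Real.norm_eq_abs]
          exact hσle _
        exact integral_mono i1 i2 fun x => hβσ n _ _
    calc ∫⁻ x, ENNReal.ofReal (βs n (angVortQuot (v t) x))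
        = ENNReal.ofReal (∫ x, βs n (angVortQuot (v t) x)) :=
          (ofReal_integral_eq_lintegral_ofReal (hi t ht) (ae_of_all _ fun x => hβnn n _)).symm
      _ ≤ ENNReal.ofReal ((∫ x, βs n (angVortQuot (v s) x)) + ∫ τ in s..t, m τ) :=
          ENNReal.ofReal_le_ofReal hreal
      _ ≤ ENNReal.ofReal (∫ x, βs n (angVortQuot (v s) x)) + ENNReal.ofReal (∫ τ in s..t, m τ) :=
          ENNReal.ofReal_add_le
      _ = (∫⁻ x, ENNReal.ofReal (βs n (angVortQuot (v s) x))) + ENNReal.ofReal (∫ τ in s..t, m τ) := by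
          rw [ofReal_integral_eq_lintegral_ofReal (hi s hs) (ae_of_all _ fun x => hβnn n _)]
      _ ≤ (∫⁻ x, ENNReal.ofReal (ψ (angVortQuot (v s) x))) + ENNReal.ofReal (∫ τ in s..t, m τ) := by
          gcongr with x
          exact hle n _
  -- Fatou
  have hmeas : ∀ n, Measurable fun x => ENNReal.ofReal (βs n (angVortQuot (v t) x)) := fun n =>
    (((hβ n).continuous.comp (hΩc t ht)).measurable).ennreal_ofReal
  have hlim' : ∀ x, Tendsto (fun n => ENNReal.ofReal (βs n (angVortQuot (v t) x))) atTop
      (𝓝 (ENNReal.ofReal (ψ (angVortQuot (v t) x)))) := fun x =>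
    (ENNReal.continuous_ofReal.tendsto _).comp (hlim _)
  calc ∫⁻ x, ENNReal.ofReal (ψ (angVortQuot (v t) x))
      = ∫⁻ x, liminf (fun n => ENNReal.ofReal (βs n (angVortQuot (v t) x))) atTop :=
        lintegral_congr fun x => ((hlim' x).liminf_eq).symm
    _ ≤ liminf (fun n => ∫⁻ x, ENNReal.ofReal (βs n (angVortQuot (v t) x))) atTop :=
        lintegral_liminf_le hmeas
    _ ≤ (∫⁻ x, ENNReal.ofReal (ψ (angVortQuot (v s) x))) + ENNReal.ofReal (∫ τ in s..t, m τ) :=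
        liminf_le_of_frequently_le' (Eventually.of_forall hstep).frequently

/-- `r ↦ r⁺` is continuous on `ℝ`. [folklore] -/
private theorem continuous_posPart_real : Continuous fun r : ℝ => r⁺ := by
  have e : (fun r : ℝ => r⁺) = fun r => max r 0 := funext fun r => by rw [posPart_def]
  rw [e]
  exact continuous_id.max continuous_const

/-- `r ↦ r⁻` is continuous on `ℝ`. [folklore] -/
private theorem continuous_negPart_real : Continuous fun r : ℝ => r⁻ := by
  have e : (fun r : ℝ => r⁻) = fun r => max (-r) 0 := funext fun r => by rw [negPart_def]
  rw [e]
  exact continuous_neg.max continuous_const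

/-- **With swirl, the co-signed meridional flux is raised only by the positive part of the swirl
source.** For a Tao-class solution of the unforced Navier–Stokes system on `[0, T] × ℝ³` with
`ν ≥ 0` and axisymmetric slices (swirl allowed), and `0 ≤ s ≤ t ≤ T`:
`∫⁻ (Ω(t))⁺ dx ≤ ∫⁻ (Ω(s))⁺ dx + ofReal (∫ₛᵗ ∫ (−2 Φ J)⁺ dx dτ)`, `Ω = ω^θ/r`, `Φ = u^θ/r`,
`J = ωʳ/r`: transport contributes `0`, diffusion `≤ 0`, the axis leak `≤ 0`; only the positive
part of the swirl (vortex-tilting) source `−2(u^θ/r)(ωʳ/r) = r⁻²∂_z(u^θ)²` can raise the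
co-signed flux of `ω_θ` through the meridional half-plane (the axisymmetric counterpart of the
component balance on `𝕋³`; Gallay–Šverák's Lemma 5.1 is the swirl-free case, source `≡ 0`).
[cite: GallaySverak2016, §2 (2.9), §5 Lemma 5.1 (arXiv pp. 5, 16)] -/
theorem IsTaoSolutionOn.lintegral_posPart_angVortQuot_le_add_swirlSource
    (h : IsTaoSolutionOn T ν u₀ v q) (hT : 0 < T) (hν : 0 ≤ ν)
    (hax : ∀ t ∈ Icc 0 T, IsAxisymmetric (v t)) {s t : ℝ} (hs : s ∈ Icc 0 T) (ht : t ∈ Icc 0 T)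
    (hst : s ≤ t) :
    ∫⁻ x, ENNReal.ofReal ((angVortQuot (v t) x)⁺) ≤
      (∫⁻ x, ENNReal.ofReal ((angVortQuot (v s) x)⁺)) +
        ENNReal.ofReal (∫ τ in s..t, ∫ x,
          (-2 * (angVelQuot (v τ) x * radVelQuot (curl (v τ)) x))⁺) := by
  obtain ⟨D, -, hD⟩ := Calculus.exists_bound_deriv_smoothTransition
  refine h.lintegral_comp_angVortQuot_le_of_approx_swirlSource hT hν hax
    (βs := fun n w => ∫ r in (0 : ℝ)..w, Real.smoothTransition (r / ((1 : ℝ) / (n + 1))))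
    (Ks := fun n => D / ((1 : ℝ) / (n + 1))) (σ := fun r => r⁺)
    (fun n => contDiff_posApprox _) (fun n => posApprox_zero _) (fun n => deriv_posApprox_zero _)
    (fun n w => deriv_deriv_posApprox_nonneg (by positivity) w)
    (fun n w => deriv_deriv_posApprox_le (by positivity) hD w)
    (fun n w => posApprox_le_posPart (by positivity) w) tendsto_posApprox
    continuous_posPart_real (fun r => ?_) (fun n w r => ?_) hs ht hst
  · rw [abs_of_nonneg (posPart_nonneg r), posPart_def]
    exact max_le (le_abs_self r) (abs_nonneg r)
  · -- `0 ≤ βₙ' ≤ 1`, so `βₙ'(w) r ≤ r⁺`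
    rw [deriv_posApprox]
    have h01 : 0 ≤ Real.smoothTransition (w / (1 / (↑n + 1))) ∧
        Real.smoothTransition (w / (1 / (↑n + 1))) ≤ 1 :=
      ⟨Real.smoothTransition.nonneg _, Real.smoothTransition.le_one _⟩
    rcases le_or_gt 0 r with hr | hr
    · calc Real.smoothTransition (w / (1 / (↑n + 1))) * r ≤ 1 * r :=
            mul_le_mul_of_nonneg_right h01.2 hr
        _ = r := one_mul r
        _ ≤ r⁺ := le_posPart r
    · exact (mul_nonpos_of_nonneg_of_nonpos h01.1 hr.le).trans (posPart_nonneg r)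

/-- **Mirror statement with swirl**: `∫⁻ (Ω(t))⁻ ≤ ∫⁻ (Ω(s))⁻ + ofReal (∫ₛᵗ ∫ (−2ΦJ)⁻ dx dτ)` for
`0 ≤ s ≤ t ≤ T`. [cite: GallaySverak2016, §2 (2.9), §5 Lemma 5.1 (arXiv pp. 5, 16)] -/
theorem IsTaoSolutionOn.lintegral_negPart_angVortQuot_le_add_swirlSource
    (h : IsTaoSolutionOn T ν u₀ v q) (hT : 0 < T) (hν : 0 ≤ ν)
    (hax : ∀ t ∈ Icc 0 T, IsAxisymmetric (v t)) {s t : ℝ} (hs : s ∈ Icc 0 T) (ht : t ∈ Icc 0 T)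
    (hst : s ≤ t) :
    ∫⁻ x, ENNReal.ofReal ((angVortQuot (v t) x)⁻) ≤
      (∫⁻ x, ENNReal.ofReal ((angVortQuot (v s) x)⁻)) +
        ENNReal.ofReal (∫ τ in s..t, ∫ x,
          (-2 * (angVelQuot (v τ) x * radVelQuot (curl (v τ)) x))⁻) := by
  obtain ⟨D, -, hD⟩ := Calculus.exists_bound_deriv_smoothTransition
  refine h.lintegral_comp_angVortQuot_le_of_approx_swirlSource hT hν hax
    (βs := fun n w => ∫ r in (0 : ℝ)..(-w), Real.smoothTransition (r / ((1 : ℝ) / (n + 1))))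
    (Ks := fun n => D / ((1 : ℝ) / (n + 1))) (σ := fun r => r⁻)
    (fun n => contDiff_negApprox _) (fun n => by simp) (fun n => ?_) (fun n w => ?_) (fun n w => ?_)
    (fun n w => ?_) (fun w => ?_) continuous_negPart_real (fun r => ?_) (fun n w r => ?_) hs ht hst
  · rw [deriv_negApprox]
    simp [Real.smoothTransition.zero_of_nonpos]
  · rw [deriv_deriv_negApprox]
    exact div_nonneg Real.smoothTransition.monotone.deriv_nonneg (by positivity)
  · rw [deriv_deriv_negApprox]
    exact div_le_div_of_nonneg_right ((le_abs_self _).trans (hD _)) (by positivity)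
  · rw [← posPart_neg]
    exact posApprox_le_posPart (by positivity) (-w)
  · rw [← posPart_neg]
    exact tendsto_posApprox (-w)
  · rw [abs_of_nonneg (negPart_nonneg r), negPart_def]
    exact max_le (neg_le_abs r) (abs_nonneg r)
  · -- `−1 ≤ βₙ' ≤ 0`, so `βₙ'(w) r ≤ r⁻`
    rw [deriv_negApprox]
    have h01 : 0 ≤ Real.smoothTransition (-w / (1 / (↑n + 1))) ∧
        Real.smoothTransition (-w / (1 / (↑n + 1))) ≤ 1 :=
      ⟨Real.smoothTransition.nonneg _, Real.smoothTransition.le_one _⟩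
    rcases le_or_gt 0 r with hr | hr
    · exact (mul_nonpos_of_nonpos_of_nonneg (neg_nonpos.2 h01.1) hr).trans (negPart_nonneg r)
    · calc -Real.smoothTransition (-w / (1 / (↑n + 1))) * r
          = Real.smoothTransition (-w / (1 / (↑n + 1))) * (-r) := by ring
        _ ≤ 1 * (-r) := mul_le_mul_of_nonneg_right h01.2 (by linarith)
        _ = -r := one_mul _
        _ ≤ r⁻ := neg_le_negPart r

end Swirl

/-! ### Dictionary with `f = hadamardQuotFst (ω₁)` and statements from the DATUM -/

section Data

variable {T ν : ℝ} {u₀ : EuclideanSpace ℝ (Fin 3) → EuclideanSpace ℝ (Fin 3)}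
  {v : ℝ → EuclideanSpace ℝ (Fin 3) → EuclideanSpace ℝ (Fin 3)} {q : ℝ → EuclideanSpace ℝ (Fin 3) → ℝ}

/-- **The two tree names of `η = ω_θ/r` agree.** For an axisymmetric swirl-free `u ∈ C³`,
`angVortQuot u = hadamardQuotFst (ω₁)` everywhere (`ω = curl u`): the Lei–Zhang / Hou–Li
quotient `Ω = radQuot (swirl ω)` of this file and the KNSS / Ladyzhenskaya quotient `f` of
`AxisymNoSwirlVorticity` (`ω = f · J`, used by `ladyzhenskaya_weighted_estimate`) coincide —
off the plane `{x₀ = 0}` both equal `(x₀ω₁ − x₁ω₀)/r²`, and both are continuous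
(Gallay–Šverák's `η = ω_θ/r`, (2.9)). [cite: GallaySverak2016, §2 (2.9) (arXiv p. 5)] -/
theorem angVortQuot_eq_hadamardQuotFst_curl {u : EuclideanSpace ℝ (Fin 3) → EuclideanSpace ℝ (Fin 3)}
    (hax : IsAxisymmetric u) (hsw : HasNoSwirl u) (hu : ContDiff ℝ 3 u) :
    angVortQuot u = hadamardQuotFst fun y => curl u y 1 := by
  have hu2 : ContDiff ℝ 2 u := hu.of_le (by norm_num)
  have hω : ∀ x, curl u x = hadamardQuotFst (fun y => curl u y 1) x • rotGen x := fun x =>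
    curl_eq_hadamardQuotFst_smul_rotGen hax hsw hu2 x
  have hΩc : Continuous (angVortQuot u) := (contDiff_angVortQuot (n := 0) (by exact_mod_cast hu)).continuous
  have hfc : Continuous (hadamardQuotFst fun y => curl u y 1) :=
    (contDiff_hadamardQuotFst_curl (n := 0) (by exact_mod_cast hu2)).continuous
  funext x
  refine eq_of_eq_off_ker (EuclideanSpace.proj (0 : Fin 3)) ⟨EuclideanSpace.single 0 1, by simp⟩
    hΩc hfc (fun z hz => ?_) x
  have hz0 : z 0 ≠ 0 := by simpa using hz
  have hρ : z 0 ^ 2 + z 1 ^ 2 ≠ 0 := by positivity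
  have e := hax.cylRadius_sq_mul_angVortQuot hu z
  rw [swirl_eq_inner_rotGen, cylRadius_sq] at e
  simp only at e
  rw [hω z, real_inner_smul_right, inner_rotGen_self_eq] at e
  -- `ρ Ω = f ρ`
  have : (z 0 ^ 2 + z 1 ^ 2) * (angVortQuot u z - hadamardQuotFst (fun y => curl u y 1) z) = 0 := by
    rw [mul_sub, e]; ring
  rcases mul_eq_zero.1 this with h | h
  · exact absurd h hρ
  · linarith

/-- **Gallay–Šverák 2015, Lemma 5.1 (first half) from the datum.** For a Tao-class solution
`(v, q)` on `[0, T]` (`0 < T`) of the unforced Navier–Stokes system with `ν > 0` whose datum `u₀`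
is axisymmetric WITHOUT swirl (the solution then stays so: `IsTaoSolutionOn.isAxisymmetric`,
`…hasNoSwirl`), and `0 ≤ s ≤ t ≤ T`: `∫⁻ |Ω(t)| ≤ ∫⁻ |Ω(s)|`, `Ω = ω_θ/r` — the
`L¹(Ω, dr dz)` norm of `ω_θ` is non-increasing. [cite: GallaySverak2016, §5 Lemma 5.1 (arXiv p. 16)] -/
theorem IsTaoSolutionOn.lintegral_abs_angVortQuot_le_of_datum (h : IsTaoSolutionOn T ν u₀ v q)
    (hT : 0 < T) (hν : 0 < ν) (h0 : IsAxisymmetric u₀) (h0' : HasNoSwirl u₀)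
    {s t : ℝ} (hs : s ∈ Icc 0 T) (ht : t ∈ Icc 0 T) (hst : s ≤ t) :
    ∫⁻ x, ‖angVortQuot (v t) x‖ₑ ≤ ∫⁻ x, ‖angVortQuot (v s) x‖ₑ :=
  h.lintegral_abs_angVortQuot_le hT hν.le (h.isAxisymmetric hν hT h0) (h.hasNoSwirl hν hT h0 h0')
    hs ht hst

/-- **The co-signed meridional flux from the datum**: under the same hypotheses,
`∫⁻ (Ω(t))⁺ ≤ ∫⁻ (Ω(s))⁺` for `0 ≤ s ≤ t ≤ T`. [cite: GallaySverak2016, §5 Lemma 5.1 (arXiv p. 16)] -/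
theorem IsTaoSolutionOn.lintegral_posPart_angVortQuot_le_of_datum (h : IsTaoSolutionOn T ν u₀ v q)
    (hT : 0 < T) (hν : 0 < ν) (h0 : IsAxisymmetric u₀) (h0' : HasNoSwirl u₀)
    {s t : ℝ} (hs : s ∈ Icc 0 T) (ht : t ∈ Icc 0 T) (hst : s ≤ t) :
    ∫⁻ x, ENNReal.ofReal ((angVortQuot (v t) x)⁺) ≤ ∫⁻ x, ENNReal.ofReal ((angVortQuot (v s) x)⁺) :=
  h.lintegral_posPart_angVortQuot_le hT hν.le (h.isAxisymmetric hν hT h0) (h.hasNoSwirl hν hT h0 h0')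
    hs ht hst

/-- **Monotone convex functionals from the datum**: under the same hypotheses, for every `β ∈ C²`
with `β(0) = β'(0) = 0`, `0 ≤ β'' ≤ K`, `t ↦ ∫ β(Ω(t,x)) dx` is non-increasing on `[0, T]`.
[cite: GallaySverak2016, §5 Lemma 5.1 (arXiv p. 16)] -/
theorem IsTaoSolutionOn.antitoneOn_integral_comp_angVortQuot_of_datum (h : IsTaoSolutionOn T ν u₀ v q)
    (hT : 0 < T) (hν : 0 < ν) (h0 : IsAxisymmetric u₀) (h0' : HasNoSwirl u₀)
    {β : ℝ → ℝ} {K : ℝ} (hβ : ContDiff ℝ 2 β) (h00 : β 0 = 0) (hd0 : deriv β 0 = 0)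
    (hnn : ∀ w, 0 ≤ deriv (deriv β) w) (hK : ∀ w, deriv (deriv β) w ≤ K) :
    AntitoneOn (fun t => ∫ x, β (angVortQuot (v t) x)) (Icc 0 T) :=
  h.antitoneOn_integral_comp_angVortQuot hT hν.le (h.isAxisymmetric hν hT h0)
    (h.hasNoSwirl hν hT h0 h0') hβ h00 hd0 hnn hK

end Data

/-! ### With swirl, II: the source `−2ΦJ` is the axial derivative `∂_z (u^θ/r)²`; the co-signed
meridional flux is raised only by the axial flux of `(u^θ/r)²` into `{ω_θ > 0}` -/

section SwirlAxialFlux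

variable {T ν : ℝ} {u₀ : EuclideanSpace ℝ (Fin 3) → EuclideanSpace ℝ (Fin 3)}
  {v : ℝ → EuclideanSpace ℝ (Fin 3) → EuclideanSpace ℝ (Fin 3)} {q : ℝ → EuclideanSpace ℝ (Fin 3) → ℝ}
  {β : ℝ → ℝ} {K : ℝ}

/-- `D(Φ²)(x) = 2Φ(x) DΦ(x)`. [folklore] -/
private theorem hasFDerivAt_sq_comp {Φ : EuclideanSpace ℝ (Fin 3) → ℝ} (hΦ : Differentiable ℝ Φ)
    (x : EuclideanSpace ℝ (Fin 3)) :
    HasFDerivAt (fun y => Φ y ^ 2) ((2 * Φ x) • fderiv ℝ Φ x) x := by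
  have h : HasFDerivAt (fun y => Φ y * Φ y) (Φ x • fderiv ℝ Φ x + Φ x • fderiv ℝ Φ x) x :=
    (hΦ x).hasFDerivAt.mul (hΦ x).hasFDerivAt
  have e2 : (2 * Φ x) • fderiv ℝ Φ x = Φ x • fderiv ℝ Φ x + Φ x • fderiv ℝ Φ x := by
    rw [two_mul, add_smul]
  rw [e2]
  refine h.congr_of_eventuallyEq (Eventually.of_forall fun y => ?_)
  simp [sq]

/-- `∂_w(Φ²)(x) = 2Φ(x) ∂_wΦ(x)`. [folklore] -/
private theorem fderiv_sq_comp_apply {Φ : EuclideanSpace ℝ (Fin 3) → ℝ} (hΦ : Differentiable ℝ Φ)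
    (x w : EuclideanSpace ℝ (Fin 3)) :
    fderiv ℝ (fun y => Φ y ^ 2) x w = 2 * Φ x * fderiv ℝ Φ x w := by
  rw [(hasFDerivAt_sq_comp hΦ x).fderiv]
  simp [smul_eq_mul]

/-- **The swirl source of the `ω_θ/r`-equation is an axial derivative.** For an axisymmetric
`u ∈ C³`, with `Φ = angVelQuot u = u^θ/r` and `J = radVelQuot (curl u) = ωʳ/r = −∂_zΦ`
(Lei–Zhang 2017: "`J = −∂_z v^θ/r`"), the source of (1.4)₂ is
`−2 Φ J = 2 Φ ∂_zΦ = ∂_z(Φ²)` at every point: `-2 * (Φ x * J x) = D(y ↦ Φ(y)²)(x) e_z`.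
[cite: LeiZhang2017, §1 (1.4) and the definition of J (arXiv p. 4)] -/
theorem IsAxisymmetric.neg_two_mul_angVelQuot_mul_radVelQuot_curl_eq
    {u : EuclideanSpace ℝ (Fin 3) → EuclideanSpace ℝ (Fin 3)} (hax : IsAxisymmetric u)
    (hu : ContDiff ℝ 3 u) (x : EuclideanSpace ℝ (Fin 3)) :
    -2 * (angVelQuot u x * radVelQuot (FluidPDE.curl u) x) =
      fderiv ℝ (fun y => angVelQuot u y ^ 2) x (EuclideanSpace.single 2 1) := by
  have hΦ : Differentiable ℝ (angVelQuot u) :=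
    (contDiff_angVelQuot (n := 1) (by exact_mod_cast hu)).differentiable (by norm_num)
  rw [fderiv_sq_comp_apply hΦ, IsAxisymmetric.radVelQuot_curl_eq_neg_fderiv_angVelQuot hax hu x]
  ring

/-- `L²`/`L^∞`/continuity data of `Φ = u^θ/r`, `∂_zΦ` and the axial flux density
`G = ∂_z(Φ²) = 2Φ∂_zΦ` along a Tao-class solution with axisymmetric slices, with a bound of
`∫⁻ ‖G‖ₑ` UNIFORM on the slab. [folklore] -/
private theorem IsTaoSolutionOn.axialFlux_data (h : IsTaoSolutionOn T ν u₀ v q)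
    (hax : ∀ t ∈ Icc 0 T, IsAxisymmetric (v t)) :
    ∃ M : ℝ≥0∞, M ≠ ⊤ ∧ ∀ τ ∈ Icc 0 T,
      Continuous (angVelQuot (v τ)) ∧
      Continuous (fun x => fderiv ℝ (angVelQuot (v τ)) x (EuclideanSpace.single 2 1)) ∧
      MemLp (angVelQuot (v τ)) 2 volume ∧
      MemLp (fun x => fderiv ℝ (angVelQuot (v τ)) x (EuclideanSpace.single 2 1)) 2 volume ∧
      MemLp (fun x => angVelQuot (v τ) x ^ 2) 2 volume ∧
      MemLp (fun x => fderiv ℝ (fun y => angVelQuot (v τ) y ^ 2) x (EuclideanSpace.single 2 1)) 2 volume ∧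
      Integrable (fun x => fderiv ℝ (fun y => angVelQuot (v τ) y ^ 2) x (EuclideanSpace.single 2 1)) ∧
      (∀ x, fderiv ℝ (fun y => angVelQuot (v τ) y ^ 2) x (EuclideanSpace.single 2 1) =
        2 * angVelQuot (v τ) x * fderiv ℝ (angVelQuot (v τ)) x (EuclideanSpace.single 2 1)) ∧
      ∫⁻ x, ‖fderiv ℝ (fun y => angVelQuot (v τ) y ^ 2) x (EuclideanSpace.single 2 1)‖ₑ ≤ M := by
  have hvs : ∀ s ∈ Icc 0 T, ContDiff ℝ ∞ (v s) := fun s hs => h.classical.contDiff_velocity hs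
  obtain ⟨C0, hC0⟩ := exists_lintegral_sq_iteratedFDeriv_angVelQuot_le hvs hax h.sobolev 0
  obtain ⟨C1, hC1⟩ := exists_lintegral_sq_iteratedFDeriv_angVelQuot_le hvs hax h.sobolev 1
  obtain ⟨B, hB0, hB⟩ := exists_forall_norm_iteratedFDeriv_angVelQuot_le hvs hax h.sobolev 0
  refine ⟨2 * ((C0 : ℝ≥0∞) + C1), ENNReal.mul_ne_top (by simp) (by simp), fun τ hτ => ?_⟩
  set Φ := angVelQuot (v τ) with hΦdef
  have hΦc : ContDiff ℝ ∞ Φ := contDiff_angVelQuot_of_contDiff (hvs τ hτ)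
  have hΦ1 : ContDiff ℝ 1 Φ := hΦc.of_le (by norm_cast)
  have hΦd : Differentiable ℝ Φ := hΦc.differentiable (by simp)
  have hBt : ∀ x, ‖Φ x‖ ≤ B := fun x => by
    rw [← norm_iteratedFDeriv_zero (𝕜 := ℝ) (f := Φ)]; exact hB τ hτ x
  have cdz : Continuous fun x => fderiv ℝ Φ x (EuclideanSpace.single 2 1) :=
    (hΦ1.continuous_fderiv one_ne_zero).clm_apply continuous_const
  have mΦ : MemLp Φ 2 volume :=
    memLp_two_of_norm_le_coe (F := fun x => iteratedFDeriv ℝ 0 Φ x) hΦc.continuous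
      (fun x => by rw [norm_iteratedFDeriv_zero]) (hC0 τ hτ)
  have mdz : MemLp (fun x => fderiv ℝ Φ x (EuclideanSpace.single 2 1)) 2 volume :=
    memLp_two_of_norm_le_coe (F := fun x => iteratedFDeriv ℝ 1 Φ x) cdz
      (fun x => norm_fderiv_apply_single_le_iteratedFDeriv Φ x 2) (hC1 τ hτ)
  have mΦsq : MemLp (fun x => Φ x ^ 2) 2 volume := by
    refine MemLp.of_le_mul (c := B) mΦ (hΦc.continuous.pow 2).aestronglyMeasurable
      (Eventually.of_forall fun x => ?_)
    rw [Real.norm_eq_abs, Real.norm_eq_abs, abs_pow, sq]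
    exact mul_le_mul_of_nonneg_right ((Real.norm_eq_abs _).symm.trans_le (hBt x)) (abs_nonneg _)
  have hG : ∀ x, fderiv ℝ (fun y => Φ y ^ 2) x (EuclideanSpace.single 2 1) =
      2 * Φ x * fderiv ℝ Φ x (EuclideanSpace.single 2 1) := fun x => fderiv_sq_comp_apply hΦd x _
  have iG : Integrable (fun x => fderiv ℝ (fun y => Φ y ^ 2) x (EuclideanSpace.single 2 1)) := by
    refine ((mΦ.integrable_mul mdz).const_mul 2).congr (Eventually.of_forall fun x => ?_)
    simp only [Pi.mul_apply, hG x]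
    ring
  have hsq1 : ContDiff ℝ 1 (fun y => Φ y ^ 2) := hΦ1.pow 2
  have cG : Continuous fun x => fderiv ℝ (fun y => Φ y ^ 2) x (EuclideanSpace.single 2 1) :=
    (hsq1.continuous_fderiv one_ne_zero).clm_apply continuous_const
  have mG : MemLp (fun x => fderiv ℝ (fun y => Φ y ^ 2) x (EuclideanSpace.single 2 1)) 2 volume := by
    refine MemLp.of_le_mul (c := 2 * B) mdz cG.aestronglyMeasurable (Eventually.of_forall fun x => ?_)
    rw [hG x, norm_mul, norm_mul, Real.norm_eq_abs, abs_two, mul_assoc, mul_assoc]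
    exact mul_le_mul_of_nonneg_left (mul_le_mul_of_nonneg_right (hBt x) (norm_nonneg _)) zero_le_two
  refine ⟨hΦc.continuous, cdz, mΦ, mdz, mΦsq, mG, iG, hG, ?_⟩
  -- the uniform `L¹` bound of `G = 2Φ∂_zΦ`
  have hΦC : ∫⁻ x, ‖Φ x‖ₑ ^ 2 ≤ C0 := by
    have e : ∫⁻ x, ‖Φ x‖ₑ ^ 2 = ∫⁻ x, ‖iteratedFDeriv ℝ 0 Φ x‖ₑ ^ 2 :=
      lintegral_congr fun x => by rw [← ofReal_norm, ← ofReal_norm, norm_iteratedFDeriv_zero]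
    rw [e]; exact hC0 τ hτ
  have hdzC : ∫⁻ x, ‖fderiv ℝ Φ x (EuclideanSpace.single 2 1)‖ₑ ^ 2 ≤ C1 := by
    refine le_trans (lintegral_mono fun x => ?_) (hC1 τ hτ)
    rw [← ofReal_norm, ← ofReal_norm]
    gcongr
    exact norm_fderiv_apply_single_le_iteratedFDeriv Φ x 2
  have hΦm : Measurable fun x => ‖Φ x‖ₑ ^ 2 := hΦc.continuous.measurable.enorm.pow_const 2
  calc ∫⁻ x, ‖fderiv ℝ (fun y => Φ y ^ 2) x (EuclideanSpace.single 2 1)‖ₑ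
      ≤ ∫⁻ x, 2 * (‖Φ x‖ₑ ^ 2 + ‖fderiv ℝ Φ x (EuclideanSpace.single 2 1)‖ₑ ^ 2) := by
        refine lintegral_mono fun x => ?_
        rw [hG x, enorm_mul, enorm_mul, show ‖(2 : ℝ)‖ₑ = 2 by
          rw [Real.enorm_eq_ofReal_abs]; norm_num, mul_assoc]
        gcongr
        exact ennreal_mul_le_sq_add_sq _ _
    _ = 2 * ((∫⁻ x, ‖Φ x‖ₑ ^ 2) + ∫⁻ x, ‖fderiv ℝ Φ x (EuclideanSpace.single 2 1)‖ₑ ^ 2) := by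
        rw [lintegral_const_mul' _ _ (by norm_num), lintegral_add_left hΦm]
    _ ≤ 2 * ((C0 : ℝ≥0∞) + C1) := by gcongr

/-- **The slice inequality with swirl, axial-flux form.** For a Tao-class solution on `[0, T]`
with `ν ≥ 0` and axisymmetric slices (swirl allowed), `β ∈ C²` admissible (`β(0) = β'(0) = 0`,
`0 ≤ β'' ≤ K`) and `t ∈ [0, T]`:
`∫ β'(Ω(t)) Ω'(t) dx ≤ ∫ β'(Ω(t)) ∂_z(Φ(t)²) dx` (`Ω = ω^θ/r`, `Φ = u^θ/r`; the tree's
`…_le_swirlSource` with the source rewritten by `…neg_two_mul_angVelQuot_mul_radVelQuot_curl_eq`).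
[cite: LeiZhang2017, §1 (1.4) (arXiv p. 4)] -/
theorem IsTaoSolutionOn.integral_deriv_comp_mul_angVortQuot_le_fderiv_sq
    (h : IsTaoSolutionOn T ν u₀ v q) (hT : 0 < T) (hν : 0 ≤ ν)
    (hax : ∀ t ∈ Icc 0 T, IsAxisymmetric (v t))
    (hβ : ContDiff ℝ 2 β) (h00 : β 0 = 0) (h0 : deriv β 0 = 0)
    (hnn : ∀ w, 0 ≤ deriv (deriv β) w) (hK : ∀ w, deriv (deriv β) w ≤ K) {t : ℝ} (ht : t ∈ Icc 0 T) :
    ∫ x, deriv β (angVortQuot (v t) x) * angVortQuot (timeDerivWithin (Icc 0 T) v t) x ≤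
      ∫ x, deriv β (angVortQuot (v t) x) *
        fderiv ℝ (fun y => angVelQuot (v t) y ^ 2) x (EuclideanSpace.single 2 1) := by
  have hv3 : ContDiff ℝ 3 (v t) := (h.classical.contDiff_velocity ht).of_le (by norm_cast)
  have e := fun x => (hax t ht).neg_two_mul_angVelQuot_mul_radVelQuot_curl_eq hv3 x
  refine (h.integral_deriv_comp_mul_angVortQuot_le_swirlSource hT hν hax hβ h00 h0 hnn hK ht).trans
    (le_of_eq (integral_congr_ae (Eventually.of_forall fun x => ?_)))
  simp only [e x]

/-- **Integration by parts in `z`: the swirl contribution is localised on the transition set of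
`β'(Ω)`.** Under the same hypotheses,
`∫ β'(Ω(t)) ∂_z(Φ(t)²) dx = −∫ β''(Ω(t)) ∂_zΩ(t) Φ(t)² dx`
(`β'(Ω) ∈ L² ∩ L^∞`, `∂_zΩ ∈ L²`, `Φ² ∈ L¹ ∩ L²`; Mathlib's
`integral_mul_fderiv_eq_neg_fderiv_mul_of_integrable`). In particular the swirl can change
`∫ β(Ω)` only through the region where `β''(Ω) ≠ 0`. [cite: LeiZhang2017, §1 (1.4) (arXiv p. 4)] -/
theorem IsTaoSolutionOn.integral_deriv_comp_mul_fderiv_sq_eq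
    (h : IsTaoSolutionOn T ν u₀ v q) (hax : ∀ t ∈ Icc 0 T, IsAxisymmetric (v t))
    (hβ : ContDiff ℝ 2 β) (h0 : deriv β 0 = 0)
    (hnn : ∀ w, 0 ≤ deriv (deriv β) w) (hK : ∀ w, deriv (deriv β) w ≤ K) {t : ℝ} (ht : t ∈ Icc 0 T) :
    ∫ x, deriv β (angVortQuot (v t) x) *
        fderiv ℝ (fun y => angVelQuot (v t) y ^ 2) x (EuclideanSpace.single 2 1) =
      -∫ x, deriv (deriv β) (angVortQuot (v t) x) *
        fderiv ℝ (angVortQuot (v t)) x (EuclideanSpace.single 2 1) * angVelQuot (v t) x ^ 2 := by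
  have hK' : ∀ w, |deriv (deriv β) w| ≤ K := abs_deriv_deriv_le hnn hK
  have hK0 : 0 ≤ K := (hnn 0).trans (hK 0)
  obtain ⟨hd, hd'⟩ := differentiable_deriv_of_contDiff_two hβ
  have hvs : ContDiff ℝ ∞ (v t) := h.classical.contDiff_velocity ht
  have hΩc : ContDiff ℝ ∞ (angVortQuot (v t)) := contDiff_angVortQuot_of_contDiff hvs
  have hΩd : Differentiable ℝ (angVortQuot (v t)) := hΩc.differentiable (by simp)
  obtain ⟨m0, m1, -, -⟩ := h.memLp_angVortQuot_data hax ht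
  obtain ⟨M, -, hM⟩ := h.axialFlux_data hax
  obtain ⟨-, -, -, -, mΦsq, mG, -, -, -⟩ := hM t ht
  have hΦd : Differentiable ℝ (angVelQuot (v t)) :=
    (contDiff_angVelQuot_of_contDiff hvs).differentiable (by simp)
  -- `f = β'(Ω)`, `g = Φ²`
  have hβ'L2 : MemLp (fun x => deriv β (angVortQuot (v t) x)) 2 volume :=
    memLp_deriv_comp hβ h0 hK' hΩc.continuous m0
  have hf' : ∀ x, fderiv ℝ (fun y => deriv β (angVortQuot (v t) y)) x (EuclideanSpace.single 2 1) =
      deriv (deriv β) (angVortQuot (v t) x) *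
        fderiv ℝ (angVortQuot (v t)) x (EuclideanSpace.single 2 1) := fun x =>
    fderiv_comp_deriv_apply hd' hΩd x _
  -- `f' = β''(Ω) ∂_zΩ ∈ L²`
  have hf'L2 : MemLp (fun x => deriv (deriv β) (angVortQuot (v t) x) *
      fderiv ℝ (angVortQuot (v t)) x (EuclideanSpace.single 2 1)) 2 volume := by
    refine MemLp.of_le_mul (c := K) (m1 2)
      (((continuous_deriv_deriv_of_contDiff_two hβ).comp hΩc.continuous).mul
        ((hΩc.continuous_fderiv (by simp)).clm_apply continuous_const)).aestronglyMeasurable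
      (Eventually.of_forall fun x => ?_)
    rw [norm_mul, Real.norm_eq_abs]
    exact mul_le_mul_of_nonneg_right (hK' _) (norm_nonneg _)
  have i1 : Integrable (fun x => fderiv ℝ (fun y => deriv β (angVortQuot (v t) y)) x
      (EuclideanSpace.single 2 1) * angVelQuot (v t) x ^ 2) := by
    refine (hf'L2.integrable_mul mΦsq).congr (Eventually.of_forall fun x => ?_)
    simp only [Pi.mul_apply, hf' x]
  have i2 : Integrable (fun x => deriv β (angVortQuot (v t) x) *
      fderiv ℝ (fun y => angVelQuot (v t) y ^ 2) x (EuclideanSpace.single 2 1)) :=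
    hβ'L2.integrable_mul mG
  have i3 : Integrable (fun x => deriv β (angVortQuot (v t) x) * angVelQuot (v t) x ^ 2) :=
    hβ'L2.integrable_mul mΦsq
  have hibp := integral_mul_fderiv_eq_neg_fderiv_mul_of_integrable (μ := volume)
    (f := fun y => deriv β (angVortQuot (v t) y)) (g := fun y => angVelQuot (v t) y ^ 2)
    (v := EuclideanSpace.single 2 1) i1 i2 i3
    (fun x _ => ((hd' (angVortQuot (v t) x)).comp x (hΩd x) :
      DifferentiableAt ℝ (fun y => deriv β (angVortQuot (v t) y)) x))
    (fun x _ => (hΦd x).pow 2)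
  rw [hibp]
  congr 1
  refine integral_congr_ae (Eventually.of_forall fun x => ?_)
  simp only [hf' x]

/-- **The swirl term localised**: combining the two previous statements,
`∫ β'(Ω(t)) Ω'(t) dx ≤ −∫ β''(Ω(t)) ∂_zΩ(t) Φ(t)² dx` — transport contributes `0`, diffusion and
the axis leak `≤ 0`, and the swirl source only where `β''(Ω) ≠ 0`, weighted by the swirl energy
density `Φ² = (u^θ/r)²`. [cite: LeiZhang2017, §1 (1.4) (arXiv p. 4)] -/
theorem IsTaoSolutionOn.integral_deriv_comp_mul_angVortQuot_le_neg_integral_transition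
    (h : IsTaoSolutionOn T ν u₀ v q) (hT : 0 < T) (hν : 0 ≤ ν)
    (hax : ∀ t ∈ Icc 0 T, IsAxisymmetric (v t))
    (hβ : ContDiff ℝ 2 β) (h00 : β 0 = 0) (h0 : deriv β 0 = 0)
    (hnn : ∀ w, 0 ≤ deriv (deriv β) w) (hK : ∀ w, deriv (deriv β) w ≤ K) {t : ℝ} (ht : t ∈ Icc 0 T) :
    ∫ x, deriv β (angVortQuot (v t) x) * angVortQuot (timeDerivWithin (Icc 0 T) v t) x ≤
      -∫ x, deriv (deriv β) (angVortQuot (v t) x) *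
        fderiv ℝ (angVortQuot (v t)) x (EuclideanSpace.single 2 1) * angVelQuot (v t) x ^ 2 := by
  rw [← h.integral_deriv_comp_mul_fderiv_sq_eq hax hβ h0 hnn hK ht]
  exact h.integral_deriv_comp_mul_angVortQuot_le_fderiv_sq hT hν hax hβ h00 h0 hnn hK ht

/-- The axial flux of `Φ²` integrates to zero over the whole space: `∫ ∂_z(Φ(t)²) dx = 0`
(`Φ² ∈ W^{1,1}`). [folklore] -/
private theorem IsTaoSolutionOn.integral_fderiv_angVelQuot_sq_eq_zero (h : IsTaoSolutionOn T ν u₀ v q)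
    (hax : ∀ t ∈ Icc 0 T, IsAxisymmetric (v t)) {t : ℝ} (ht : t ∈ Icc 0 T) :
    ∫ x, fderiv ℝ (fun y => angVelQuot (v t) y ^ 2) x (EuclideanSpace.single 2 1) = 0 := by
  obtain ⟨M, -, hM⟩ := h.axialFlux_data hax
  obtain ⟨-, -, mΦ, -, -, -, iG, -, -⟩ := hM t ht
  have hΦd : Differentiable ℝ (angVelQuot (v t)) :=
    (contDiff_angVelQuot_of_contDiff (h.classical.contDiff_velocity ht)).differentiable (by simp)
  have hibp := integral_mul_fderiv_eq_neg_fderiv_mul_of_integrable (μ := volume)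
    (f := fun _ : EuclideanSpace ℝ (Fin 3) => (1 : ℝ)) (g := fun y => angVelQuot (v t) y ^ 2)
    (v := EuclideanSpace.single 2 1) (by simp) (by simpa using iG)
    (by simpa using mΦ.integrable_sq) (fun x _ => differentiableAt_const _) (fun x _ => (hΦd x).pow 2)
  simpa using hibp

/-- **With swirl, the co-signed meridional flux is raised only by the axial flux of `(u^θ/r)²`
INTO the region `{ω_θ > 0}`.** For a Tao-class solution of the unforced Navier–Stokes system on
`[0, T] × ℝ³` with `ν ≥ 0` and axisymmetric slices (swirl allowed), and `0 ≤ s ≤ t ≤ T`: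
`∫⁻ (Ω(t))⁺ dx ≤ ∫⁻ (Ω(s))⁺ dx + ofReal (∫ₛᵗ ∫_{Ω(τ) > 0} ∂_z(Φ(τ)²) dx dτ)`,
`Ω = ω^θ/r`, `Φ = u^θ/r`. Since `∫_{ℝ³} ∂_z(Φ²) = 0`, the last term is the net flux of the swirl
energy density `Φ²` in the `z`-direction across the nodal set `{ω_θ = 0}` into `{ω_θ > 0}`; it
sharpens the tree's `…_le_add_swirlSource` (`∫ (−2ΦJ)⁺` over all space). (Proof: the sourced
balance for the approximants `β_δ`, whose derivatives `β_δ' = smoothTransition(·/δ) ↑ 1_{(0,∞)}`;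
dominated convergence in `x` and in `τ`, Fatou in the functional.)
[cite: LeiZhang2017, §1 (1.4) (arXiv p. 4); GallaySverak2016, §5 Lemma 5.1 proof (arXiv p. 16)] -/
theorem IsTaoSolutionOn.lintegral_posPart_angVortQuot_le_add_setIntegral_fderiv_sq
    (h : IsTaoSolutionOn T ν u₀ v q) (hT : 0 < T) (hν : 0 ≤ ν)
    (hax : ∀ t ∈ Icc 0 T, IsAxisymmetric (v t)) {s t : ℝ} (hs : s ∈ Icc 0 T) (ht : t ∈ Icc 0 T)
    (hst : s ≤ t) :
    ∫⁻ x, ENNReal.ofReal ((angVortQuot (v t) x)⁺) ≤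
      (∫⁻ x, ENNReal.ofReal ((angVortQuot (v s) x)⁺)) +
        ENNReal.ofReal (∫ τ in s..t, ∫ x in {x | 0 < angVortQuot (v τ) x},
          fderiv ℝ (fun y => angVelQuot (v τ) y ^ 2) x (EuclideanSpace.single 2 1)) := by
  have hU : UniqueDiffOn ℝ (Icc 0 T) := uniqueDiffOn_Icc hT
  have hcl := Icc_subset_closure_interior_Icc' hT
  have hsm : IsSmoothSpaceTimeOn (Icc 0 T) v := h.classical.smooth_velocity
  have hvs : ∀ τ ∈ Icc 0 T, ContDiff ℝ ∞ (v τ) := fun τ hτ => h.classical.contDiff_velocity hτ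
  have hΩc : ∀ τ ∈ Icc 0 T, Continuous (angVortQuot (v τ)) := fun τ hτ =>
    (contDiff_angVortQuot (n := 0) (by exact_mod_cast (hvs τ hτ).of_le (by norm_cast))).continuous
  obtain ⟨D, -, hD⟩ := Calculus.exists_bound_deriv_smoothTransition
  obtain ⟨M, hMtop, hM⟩ := h.axialFlux_data hax
  obtain ⟨C, hC⟩ := h.exists_lintegral_sq_quot_le hT hax
  -- notation: the axial flux density `G τ x = ∂_z(Φ(τ)²)(x)`, the approximants `βₙ`
  set G : ℝ → EuclideanSpace ℝ (Fin 3) → ℝ := fun τ x =>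
    fderiv ℝ (fun y => angVelQuot (v τ) y ^ 2) x (EuclideanSpace.single 2 1) with hGdef
  set δs : ℕ → ℝ := fun n => (1 : ℝ) / (n + 1) with hδs
  have hδpos : ∀ n, 0 < δs n := fun n => by rw [hδs]; positivity
  set βs : ℕ → ℝ → ℝ := fun n w => ∫ r in (0 : ℝ)..w, Real.smoothTransition (r / δs n) with hβs
  have hβd : ∀ n w, deriv (βs n) w = Real.smoothTransition (w / δs n) := fun n w => by
    rw [hβs, deriv_posApprox]
  have hβ01 : ∀ n w, 0 ≤ deriv (βs n) w ∧ deriv (βs n) w ≤ 1 := fun n w => by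
    rw [hβd]; exact ⟨Real.smoothTransition.nonneg _, Real.smoothTransition.le_one _⟩
  have hβnn : ∀ n w, 0 ≤ βs n w := fun n w =>
    nonneg_of_deriv2_nonneg (contDiff_posApprox _) (posApprox_zero _) (deriv_posApprox_zero _)
      (fun w => deriv_deriv_posApprox_nonneg (hδpos n) w) w
  -- joint continuity of `G` on the slab
  have hΦf : IsSmoothSpaceTimeOn (Icc 0 T) (fun τ => angVelQuot (v τ)) :=
    hsm.angVelQuot_family (convex_Icc 0 T) hU
  have hGcont : ContinuousOn (uncurry G) (Icc 0 T ×ˢ univ) := by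
    have c1 : ContinuousOn (fun z : ℝ × EuclideanSpace ℝ (Fin 3) =>
        fderiv ℝ (angVelQuot (v z.1)) z.2 (EuclideanSpace.single 2 1)) (Icc 0 T ×ˢ univ) :=
      (hΦf.continuousOn_fderiv_slice hU).clm_apply continuousOn_const
    refine (((continuousOn_const (c := (2 : ℝ))).mul hΦf.continuousOn).mul c1).congr ?_
    rintro ⟨τ, x⟩ ⟨hτ, -⟩
    obtain ⟨-, -, -, -, -, -, -, hG, -⟩ := hM τ hτ
    show G τ x = 2 * angVelQuot (v τ) x * fderiv ℝ (angVelQuot (v τ)) x (EuclideanSpace.single 2 1)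
    exact hG x
  -- the majorants `mₙ(τ) = ∫ βₙ'(Ω) G` and the limit `m(τ) = ∫_{Ω > 0} G`
  set m : ℕ → ℝ → ℝ := fun n τ => ∫ x, deriv (βs n) (angVortQuot (v τ) x) * G τ x with hm
  set mlim : ℝ → ℝ := fun τ => ∫ x in {x | 0 < angVortQuot (v τ) x}, G τ x with hmlim
  -- (1) uniform bound `|βₙ'(Ω) G| ≤ |G|`, `∫⁻ |G| ≤ M`
  have hmn_bound : ∀ n, ∀ τ ∈ Icc 0 T, ∫⁻ x, ‖deriv (βs n) (angVortQuot (v τ) x) * G τ x‖ₑ ≤ M := by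
    intro n τ hτ
    obtain ⟨-, -, -, -, -, -, -, -, hGM⟩ := hM τ hτ
    refine le_trans (lintegral_mono fun x => ?_) hGM
    rw [enorm_mul, Real.enorm_eq_ofReal_abs, abs_of_nonneg (hβ01 n _).1]
    calc ENNReal.ofReal (deriv (βs n) (angVortQuot (v τ) x)) * ‖G τ x‖ₑ ≤ 1 * ‖G τ x‖ₑ := by
          gcongr; rw [← ENNReal.ofReal_one]; exact ENNReal.ofReal_le_ofReal (hβ01 n _).2
      _ = ‖G τ x‖ₑ := one_mul _
  -- (2) integrability of `mₙ` on `(0, T)` (joint measurability + uniform bound, Fubini)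
  have hmI : ∀ n, IntegrableOn (m n) (Ioo 0 T) := by
    intro n
    obtain ⟨-, hd'⟩ := differentiable_deriv_of_contDiff_two (contDiff_posApprox (δs n))
    have hΩf : IsSmoothSpaceTimeOn (Icc 0 T) (fun τ => angVortQuot (v τ)) :=
      hsm.angVortQuot_family (convex_Icc 0 T) hU
    have hcont : ContinuousOn (uncurry fun τ x => deriv (βs n) (angVortQuot (v τ) x) * G τ x)
        (Icc 0 T ×ˢ univ) :=
      (hd'.continuous.comp_continuousOn hΩf.continuousOn).mul hGcont
    have hmeas : AEStronglyMeasurable (uncurry fun τ x => deriv (βs n) (angVortQuot (v τ) x) * G τ x)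
        ((volume.restrict (Ioo 0 T)).prod volume) :=
      aestronglyMeasurable_prod_of_continuousOn_off_axis
        (hcont.mono (prod_mono Ioo_subset_Icc_self (subset_univ _)))
    have hI : Integrable (uncurry fun τ x => deriv (βs n) (angVortQuot (v τ) x) * G τ x)
        ((volume.restrict (Ioo 0 T)).prod volume) := by
      refine ⟨hmeas, ?_⟩
      have hle := lintegral_prod_le (μ := volume.restrict (Ioo 0 T)) (ν := volume)
        (fun z : ℝ × EuclideanSpace ℝ (Fin 3) => ‖uncurry (fun τ x =>
          deriv (βs n) (angVortQuot (v τ) x) * G τ x) z‖ₑ)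
      refine lt_of_le_of_lt hle ?_
      calc ∫⁻ τ in Ioo 0 T, ∫⁻ x, ‖uncurry (fun τ x =>
            deriv (βs n) (angVortQuot (v τ) x) * G τ x) (τ, x)‖ₑ
          ≤ ∫⁻ _ in Ioo 0 T, M :=
            setLIntegral_mono' measurableSet_Ioo fun τ hτ => hmn_bound n τ (Ioo_subset_Icc_self hτ)
        _ < ⊤ := by
            rw [setLIntegral_const]
            exact ENNReal.mul_lt_top hMtop.lt_top (by simp)
    exact hI.integral_prod_left
  -- (3) for each `n`: the sourced balance, in `ℝ≥0∞`
  have tl : ∀ {w : ℝ → EuclideanSpace ℝ (Fin 3) → ℝ},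
      ContinuousOn (uncurry w) (Icc 0 T ×ˢ univ) → ∀ x, ContinuousOn (fun s => w s x) (Icc 0 T) := by
    intro w hw x
    exact hw.comp (continuous_id.prodMk continuous_const).continuousOn
      fun s hs => mk_mem_prod hs (mem_univ x)
  have hΩ : IsSmoothSpaceTimeOn (Icc 0 T) (fun t => angVortQuot (v t)) :=
    hsm.angVortQuot_family (convex_Icc 0 T) hU
  have hΩ' : IsSmoothSpaceTimeOn (Icc 0 T) (timeDerivWithin (Icc 0 T) fun t => angVortQuot (v t)) :=
    hΩ.timeDerivWithin hU
  have hdt : ∀ t ∈ Icc 0 T, ∀ x, timeDerivWithin (Icc 0 T) (fun s => angVortQuot (v s)) t x =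
      angVortQuot (timeDerivWithin (Icc 0 T) v t) x := fun t ht x =>
    hsm.timeDerivWithin_angVortQuot (convex_Icc 0 T) hU hcl hax ht x
  have hstep : ∀ n, ∫⁻ x, ENNReal.ofReal (βs n (angVortQuot (v t) x)) ≤
      (∫⁻ x, ENNReal.ofReal ((angVortQuot (v s) x)⁺)) + ENNReal.ofReal (∫ τ in s..t, m n τ) := by
    intro n
    have hβ2 : ContDiff ℝ 2 (βs n) := contDiff_posApprox _
    have h00 : βs n 0 = 0 := posApprox_zero _
    have h0 : deriv (βs n) 0 = 0 := deriv_posApprox_zero _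
    have hnn : ∀ w, 0 ≤ deriv (deriv (βs n)) w := fun w => deriv_deriv_posApprox_nonneg (hδpos n) w
    have hKn : ∀ w, deriv (deriv (βs n)) w ≤ D / δs n := fun w =>
      deriv_deriv_posApprox_le (hδpos n) hD w
    have hK' : ∀ w, |deriv (deriv (βs n)) w| ≤ D / δs n := abs_deriv_deriv_le hnn hKn
    have hK0 : 0 ≤ D / δs n := (hnn 0).trans (hKn 0)
    obtain ⟨hd, hd'⟩ := differentiable_deriv_of_contDiff_two hβ2
    have hβ1 : ContDiff ℝ 1 (βs n) := hβ2.of_le (by norm_num)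
    have hi : ∀ τ ∈ Icc 0 T, Integrable (fun x => βs n (angVortQuot (v τ) x)) := fun τ hτ => by
      obtain ⟨m0, -, -, -⟩ := h.memLp_angVortQuot_data hax hτ
      exact integrable_comp hβ2 h00 h0 hK' (hΩc τ hτ) m0
    have hreal : ∫ x, βs n (angVortQuot (v t) x) ≤
        (∫ x, βs n (angVortQuot (v s) x)) + ∫ τ in s..t, m n τ := by
      refine integral_comp_le_add_intervalIntegral_of_ae_hasDerivAt (μ := volume) (T := T)
        (g := fun t x => angVortQuot (v t) x)
        (g' := fun t x => angVortQuot (timeDerivWithin (Icc 0 T) v t) x) hβ1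
        (ae_of_all _ fun x => ⟨tl hΩ.continuousOn x, (tl hΩ'.continuousOn x).congr fun s hs =>
          (hdt s hs x).symm, fun t ht => ?_⟩) ?_ (K := ENNReal.ofReal (D / δs n) * ((C : ℝ≥0∞) + C))
        (ENNReal.mul_ne_top ENNReal.ofReal_ne_top (by simp)) ?_ hi (hmI n) ?_ hs ht hst
      · have htI : t ∈ Icc 0 T := Ioo_subset_Icc_self ht
        have h1 : HasDerivWithinAt (fun s => angVortQuot (v s) x)
            (timeDerivWithin (Icc 0 T) (fun s => angVortQuot (v s)) t x) (Icc 0 T) t := by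
          rw [timeDerivWithin_apply]
          exact (hΩ.differentiableWithinAt_time htI x).hasDerivWithinAt
        rw [hdt t htI x] at h1
        exact h1.hasDerivAt (Icc_mem_nhds ht.1 ht.2)
      · refine aestronglyMeasurable_prod_of_continuousOn_off_axis
          (F := uncurry fun t x => deriv (βs n) (angVortQuot (v t) x) *
            angVortQuot (timeDerivWithin (Icc 0 T) v t) x) ?_
        have hsub : Ioo 0 T ×ˢ {x : EuclideanSpace ℝ (Fin 3) | cylRadius x ≠ 0} ⊆ Icc 0 T ×ˢ univ :=
          prod_mono Ioo_subset_Icc_self (subset_univ _)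
        have c1 : ContinuousOn (fun p : ℝ × EuclideanSpace ℝ (Fin 3) => deriv (βs n) (uncurry (fun t x =>
            angVortQuot (v t) x) p)) (Icc 0 T ×ˢ univ) := hd'.continuous.comp_continuousOn hΩ.continuousOn
        have c2 : ContinuousOn (uncurry (timeDerivWithin (Icc 0 T) fun t => angVortQuot (v t)))
            (Icc 0 T ×ˢ univ) := hΩ'.continuousOn
        refine ((c1.mul c2).mono hsub).congr fun p hp => ?_
        obtain ⟨τ, x⟩ := p
        have hτI : τ ∈ Icc 0 T := Ioo_subset_Icc_self hp.1
        simp only [Pi.mul_apply, uncurry_apply_pair]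
        rw [hdt τ hτI x]
      · intro τ hτ
        have hτI : τ ∈ Icc 0 T := Ioo_subset_Icc_self hτ
        obtain ⟨hΩC, hΩ'C, -, -⟩ := hC τ hτI
        calc ∫⁻ x, ‖deriv (βs n) (angVortQuot (v τ) x) * angVortQuot (timeDerivWithin (Icc 0 T) v τ) x‖ₑ
            ≤ ∫⁻ x, ENNReal.ofReal (D / δs n) * (‖angVortQuot (v τ) x‖ₑ ^ 2 +
                ‖angVortQuot (timeDerivWithin (Icc 0 T) v τ) x‖ₑ ^ 2) := by
              refine lintegral_mono fun x => ?_
              rw [enorm_mul]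
              calc ‖deriv (βs n) (angVortQuot (v τ) x)‖ₑ * ‖angVortQuot (timeDerivWithin (Icc 0 T) v τ) x‖ₑ
                  ≤ (ENNReal.ofReal (D / δs n) * ‖angVortQuot (v τ) x‖ₑ) *
                      ‖angVortQuot (timeDerivWithin (Icc 0 T) v τ) x‖ₑ := by
                    gcongr
                    have hb := abs_deriv_le_mul_abs hβ2 h0 hK' (angVortQuot (v τ) x)
                    rw [← Real.enorm_eq_ofReal hK0, ← enorm_mul, Real.enorm_eq_ofReal_abs,
                      Real.enorm_eq_ofReal_abs, abs_mul, abs_of_nonneg hK0]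
                    exact ENNReal.ofReal_le_ofReal hb
                _ = ENNReal.ofReal (D / δs n) * (‖angVortQuot (v τ) x‖ₑ *
                      ‖angVortQuot (timeDerivWithin (Icc 0 T) v τ) x‖ₑ) := mul_assoc _ _ _
                _ ≤ ENNReal.ofReal (D / δs n) * (‖angVortQuot (v τ) x‖ₑ ^ 2 +
                      ‖angVortQuot (timeDerivWithin (Icc 0 T) v τ) x‖ₑ ^ 2) := by
                    gcongr
                    exact ennreal_mul_le_sq_add_sq _ _
          _ = ENNReal.ofReal (D / δs n) * ((∫⁻ x, ‖angVortQuot (v τ) x‖ₑ ^ 2) +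
                ∫⁻ x, ‖angVortQuot (timeDerivWithin (Icc 0 T) v τ) x‖ₑ ^ 2) := by
              have hmΩ : Measurable fun x => ‖angVortQuot (v τ) x‖ₑ ^ 2 :=
                (hΩc τ hτI).measurable.enorm.pow_const 2
              rw [lintegral_const_mul' _ _ ENNReal.ofReal_ne_top, lintegral_add_left hmΩ]
          _ ≤ ENNReal.ofReal (D / δs n) * ((C : ℝ≥0∞) + C) := by gcongr
      · -- the slice inequality in axial-flux form is exactly `≤ mₙ(τ)`
        intro τ hτ
        exact h.integral_deriv_comp_mul_angVortQuot_le_fderiv_sq hT hν hax hβ2 h00 h0 hnn hKn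
          (Ioo_subset_Icc_self hτ)
    calc ∫⁻ x, ENNReal.ofReal (βs n (angVortQuot (v t) x))
        = ENNReal.ofReal (∫ x, βs n (angVortQuot (v t) x)) :=
          (ofReal_integral_eq_lintegral_ofReal (hi t ht) (ae_of_all _ fun x => hβnn n _)).symm
      _ ≤ ENNReal.ofReal ((∫ x, βs n (angVortQuot (v s) x)) + ∫ τ in s..t, m n τ) :=
          ENNReal.ofReal_le_ofReal hreal
      _ ≤ ENNReal.ofReal (∫ x, βs n (angVortQuot (v s) x)) + ENNReal.ofReal (∫ τ in s..t, m n τ) :=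
          ENNReal.ofReal_add_le
      _ = (∫⁻ x, ENNReal.ofReal (βs n (angVortQuot (v s) x))) + ENNReal.ofReal (∫ τ in s..t, m n τ) := by
          rw [ofReal_integral_eq_lintegral_ofReal (hi s hs) (ae_of_all _ fun x => hβnn n _)]
      _ ≤ (∫⁻ x, ENNReal.ofReal ((angVortQuot (v s) x)⁺)) + ENNReal.ofReal (∫ τ in s..t, m n τ) := by
          gcongr with x
          exact posApprox_le_posPart (hδpos n) _
  -- (4) `mₙ(τ) → m(τ)` for `τ ∈ [0, T]` (dominated convergence in `x`)
  have hlimτ : ∀ τ ∈ Icc 0 T, Tendsto (fun n => m n τ) atTop (𝓝 (mlim τ)) := by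
    intro τ hτ
    obtain ⟨-, -, -, -, -, -, iG, -, -⟩ := hM τ hτ
    have hSm : MeasurableSet {x | 0 < angVortQuot (v τ) x} :=
      measurableSet_lt measurable_const (hΩc τ hτ).measurable
    have e : mlim τ = ∫ x, {x | 0 < angVortQuot (v τ) x}.indicator (G τ) x := by
      rw [hmlim, integral_indicator hSm]
    rw [e]
    show Tendsto (fun n => ∫ x, deriv (βs n) (angVortQuot (v τ) x) * G τ x) atTop
      (𝓝 (∫ x, {x | 0 < angVortQuot (v τ) x}.indicator (G τ) x))
    refine tendsto_integral_of_dominated_convergence (fun x => ‖G τ x‖) (fun n => ?_) iG.norm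
      (fun n => ae_of_all _ fun x => ?_) (ae_of_all _ fun x => ?_)
    · exact (((differentiable_deriv_of_contDiff_two (contDiff_posApprox (δs n))).2.continuous.comp
        (hΩc τ hτ)).mul (hGcont.comp_continuous (continuous_const.prodMk continuous_id)
          fun x => mk_mem_prod hτ (mem_univ x))).aestronglyMeasurable
    · rw [norm_mul, Real.norm_eq_abs, abs_of_nonneg (hβ01 n _).1]
      exact mul_le_of_le_one_left (norm_nonneg _) (hβ01 n _).2
    · -- pointwise: `βₙ'(w) = 1` eventually if `w > 0`, `= 0` if `w ≤ 0`
      by_cases hw : 0 < angVortQuot (v τ) x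
      · rw [indicator_of_mem (show x ∈ {x | 0 < angVortQuot (v τ) x} from hw)]
        refine tendsto_const_nhds.congr' ?_
        obtain ⟨N, hN⟩ := exists_nat_gt (1 / angVortQuot (v τ) x)
        refine (eventually_ge_atTop N).mono fun n hn => ?_
        show G τ x = deriv (βs n) (angVortQuot (v τ) x) * G τ x
        have h1 : 1 ≤ angVortQuot (v τ) x / δs n := by
          rw [hδs]
          simp only [one_div, div_inv_eq_mul]
          have hN' : 1 / angVortQuot (v τ) x < (n : ℝ) + 1 :=
            hN.trans_le (by exact_mod_cast Nat.le_succ_of_le hn)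
          rw [div_lt_iff₀ hw] at hN'
          linarith
        rw [hβd, Real.smoothTransition.one_of_one_le h1, one_mul]
      · rw [indicator_of_notMem (show x ∉ {x | 0 < angVortQuot (v τ) x} from hw)]
        refine tendsto_const_nhds.congr' (Eventually.of_forall fun n => ?_)
        show (0 : ℝ) = deriv (βs n) (angVortQuot (v τ) x) * G τ x
        rw [hβd, Real.smoothTransition.zero_of_nonpos
          (div_nonpos_of_nonpos_of_nonneg (not_lt.1 hw) (hδpos n).le), zero_mul]
  -- (5) `∫ₛᵗ mₙ → ∫ₛᵗ m` (dominated convergence in `τ`, constant bound `M`)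
  have hlimM : Tendsto (fun n => ∫ τ in s..t, m n τ) atTop (𝓝 (∫ τ in s..t, mlim τ)) := by
    have hres : (volume : Measure ℝ).restrict (uIoc s t) = volume.restrict (Ioo s t) := by
      rw [uIoc_of_le hst]
      exact Measure.restrict_congr_set Ioo_ae_eq_Ioc.symm
    refine intervalIntegral.tendsto_integral_filter_of_dominated_convergence (fun _ => M.toReal)
      (Eventually.of_forall fun n => ?_) (Eventually.of_forall fun n => ae_of_all _ fun τ hτ => ?_)
      intervalIntegrable_const (ae_of_all _ fun τ hτ => ?_)
    · rw [hres]
      exact ((hmI n).mono_set (Ioo_subset_Ioo hs.1 ht.2)).aestronglyMeasurable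
    · rw [uIoc_of_le hst] at hτ
      have hτI : τ ∈ Icc 0 T := ⟨hs.1.trans hτ.1.le, hτ.2.trans ht.2⟩
      show ‖∫ x, deriv (βs n) (angVortQuot (v τ) x) * G τ x‖ ≤ M.toReal
      refine (norm_integral_le_lintegral_norm _).trans ?_
      refine ENNReal.toReal_mono hMtop ?_
      refine le_trans (le_of_eq (lintegral_congr fun x => ?_)) (hmn_bound n τ hτI)
      rw [ofReal_norm]
    · rw [uIoc_of_le hst] at hτ
      exact hlimτ τ ⟨hs.1.trans hτ.1.le, hτ.2.trans ht.2⟩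
  -- (6) Fatou in the functional, and the limit of the right-hand sides
  have hmeas : ∀ n, Measurable fun x => ENNReal.ofReal (βs n (angVortQuot (v t) x)) := fun n =>
    (((contDiff_posApprox (δs n)).continuous.comp (hΩc t ht)).measurable).ennreal_ofReal
  have hlim' : ∀ x, Tendsto (fun n => ENNReal.ofReal (βs n (angVortQuot (v t) x))) atTop
      (𝓝 (ENNReal.ofReal ((angVortQuot (v t) x)⁺))) := fun x =>
    (ENNReal.continuous_ofReal.tendsto _).comp (tendsto_posApprox _)
  have hRHS : Tendsto (fun n => (∫⁻ x, ENNReal.ofReal ((angVortQuot (v s) x)⁺)) +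
      ENNReal.ofReal (∫ τ in s..t, m n τ)) atTop
      (𝓝 ((∫⁻ x, ENNReal.ofReal ((angVortQuot (v s) x)⁺)) +
        ENNReal.ofReal (∫ τ in s..t, mlim τ))) :=
    tendsto_const_nhds.add ((ENNReal.continuous_ofReal.tendsto _).comp hlimM)
  calc ∫⁻ x, ENNReal.ofReal ((angVortQuot (v t) x)⁺)
      = ∫⁻ x, liminf (fun n => ENNReal.ofReal (βs n (angVortQuot (v t) x))) atTop :=
        lintegral_congr fun x => ((hlim' x).liminf_eq).symm
    _ ≤ liminf (fun n => ∫⁻ x, ENNReal.ofReal (βs n (angVortQuot (v t) x))) atTop :=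
        lintegral_liminf_le hmeas
    _ ≤ liminf (fun n => (∫⁻ x, ENNReal.ofReal ((angVortQuot (v s) x)⁺)) +
          ENNReal.ofReal (∫ τ in s..t, m n τ)) atTop :=
        liminf_le_liminf (Eventually.of_forall hstep)
    _ = (∫⁻ x, ENNReal.ofReal ((angVortQuot (v s) x)⁺)) +
          ENNReal.ofReal (∫ τ in s..t, mlim τ) := hRHS.liminf_eq

/-- **Single-signed era with swirl: no increase of the meridional flux.** For a Tao-class
solution on `[0, T] × ℝ³` with `ν ≥ 0` and axisymmetric slices (swirl allowed): if on `[s, t]`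
(`0 ≤ s ≤ t ≤ T`) the azimuthal vorticity is positive almost everywhere at every time
(`ω_θ(τ, ·)/r > 0` a.e.), then `∫⁻ (Ω(t))⁺ dx ≤ ∫⁻ (Ω(s))⁺ dx`: the axial flux `∫_{Ω>0} ∂_z(Φ²)`
is then the integral of a derivative over (almost) all of `ℝ³` and vanishes. So swirl can raise
the co-signed meridional flux only after `ω_θ` has changed sign, and then only by the flux of
`(u^θ/r)²` across the nodal set. [cite: LeiZhang2017, §1 (1.4) (arXiv p. 4); GallaySverak2016, §5 Lemma 5.1 proof (arXiv p. 16)] -/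
theorem IsTaoSolutionOn.lintegral_posPart_angVortQuot_le_of_ae_pos
    (h : IsTaoSolutionOn T ν u₀ v q) (hT : 0 < T) (hν : 0 ≤ ν)
    (hax : ∀ t ∈ Icc 0 T, IsAxisymmetric (v t)) {s t : ℝ} (hs : s ∈ Icc 0 T) (ht : t ∈ Icc 0 T)
    (hst : s ≤ t) (hpos : ∀ τ ∈ Icc s t, ∀ᵐ x ∂(volume : Measure (EuclideanSpace ℝ (Fin 3))),
      0 < angVortQuot (v τ) x) :
    ∫⁻ x, ENNReal.ofReal ((angVortQuot (v t) x)⁺) ≤ ∫⁻ x, ENNReal.ofReal ((angVortQuot (v s) x)⁺) := by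
  have hmain := h.lintegral_posPart_angVortQuot_le_add_setIntegral_fderiv_sq hT hν hax hs ht hst
  have hzero : (∫ τ in s..t, ∫ x in {x | 0 < angVortQuot (v τ) x},
      fderiv ℝ (fun y => angVelQuot (v τ) y ^ 2) x (EuclideanSpace.single 2 1)) = 0 := by
    refine (intervalIntegral.integral_congr (g := fun _ => (0 : ℝ)) fun τ hτ => ?_).trans
      intervalIntegral.integral_zero
    rw [uIcc_of_le hst] at hτ
    have hτI : τ ∈ Icc 0 T := ⟨hs.1.trans hτ.1, hτ.2.trans ht.2⟩
    show (∫ x in {x | 0 < angVortQuot (v τ) x},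
      fderiv ℝ (fun y => angVelQuot (v τ) y ^ 2) x (EuclideanSpace.single 2 1)) = 0
    have hS : ∀ᵐ x ∂(volume : Measure (EuclideanSpace ℝ (Fin 3))),
        x ∈ {x | 0 < angVortQuot (v τ) x} := hpos τ hτ
    rw [Measure.restrict_eq_self_of_ae_mem hS]
    exact h.integral_fderiv_angVelQuot_sq_eq_zero hax hτI
  rw [hzero, ENNReal.ofReal_zero, add_zero] at hmain
  exact hmain

end SwirlAxialFlux

end Literature.Analysis.FluidPDE

end
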